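import Summits.KontsevichZagierPeriods.KontsevichZagierPeriods.Theses.TerasomaMultiplication
import Literature.NumberTheory.Transcendental.KZMellinFibres
import Literature.NumberTheory.Transcendental.KZSubcalculusInvariants
import Literature.NumberTheory.Transcendental.KZDominatedFamilyRelations
import Literature.NumberTheory.Transcendental.KZLogCalculusProofs
import Literature.NumberTheory.Transcendental.KZKernelConjectureForms
import Literature.Analysis.SpecialFunctions.SelbergIntegralBasic
import Literature.Analysis.SpecialFunctions.GammaMultiplication

/-!
# Disproof of `MultiplicationThree` (stmt-KontsevichZagierPeriods-3598) — standing adversary, gen 1–2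

Crux (route TerasomaMultiplication, rank 2; shared with TerasomaCovering / MellinCoarea): for every
rational `s > 0`, the box representation `[(0,1)², v₁^{-2/3}(1-v₁)^{s-1} v₂^{-1/3}(1-v₂)^{s-1}]`
(value `B(1/3,s)B(2/3,s)`) and the simplex representation `[{σ₁,σ₂>0, σ₁+σ₂<3}, (σ₁σ₂(3-σ₁-σ₂))^{s-1}]`
are `KZ.Equivalent`.

**Verdict so far: the crux RESISTS — it is an instance of the summit (proved below), so a
refutation would refute Conjecture 1 as formalised.** This file records, as sorry-free Lean
theorems (axioms `propext`, `Classical.choice`, `Quot.sound`), what any proof must use, which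
nearby statements are false, and why no cheap kill exists.

Findings:

1. NON-VACUITY, REDUCTION TO ONE PAIR (§1). For every rational `s > 0` both pinned representations
   EXIST as `KZ.IntegralRep 2`: `boxRep s hs` (semialgebraic integrand via the tree's
   `KZ.isSemialgebraicFunOn_mellinIntegrand`; absolutely integrable = product of two Beta kernels,
   `Measure.restrict_pi_pi` + `Integrable.fintype_prod`) and `simplexRep s hs` (Dirichlet
   integrability by the polynomial chart `Φ(u,v) = (3u, 3(1-u)v)` of the triangle by the box,
   `|det DΦ| = 9(1-u)`, Mathlib's Jacobian criterion). `multiplicationThree_iff_pinned`: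
   the crux ⇔ `∀ s hs, Equivalent (boxRep s hs) (simplexRep s hs)` (other choices differ by
   integrand additivity with a zero representation). A prover may fix these two representations.
2. NO EVALUATION KILL (§2). `value_eq`: ANY `r, r'` satisfying the four pinning hypotheses have
   equal values, for every `s > 0` — in Lean: box `= Γ(1/3)Γ(s)/Γ(s+1/3) · Γ(2/3)Γ(s)/Γ(s+2/3)`
   (Fubini), simplex `= 9·27^{s-1} · Γ(s)Γ(2s)/Γ(3s) · Γ(s)²/Γ(2s)` (chart `Φ` + Fubini), equal by
   the tree's Gauss multiplication `GaussMultiplication.real_formula` at `n = 3` (and at `x = 1/3`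
   for `Γ(1/3)Γ(2/3) = 2π/√3`). Hence `multiplicationThree_of_summit :
   KontsevichZagierPeriods → MultiplicationThree` (through `kzPeriodConjecture'_iff_isRational`,
   i.e. the PROVED `KZ.exists_isRational_equivalent_holds` + soundness). The only proved invariant
   of `KZ.relations` (evaluation) cannot separate the pair; `KZ.coeffSum` is `0` on any pair.
   A kill therefore needs a NEW invariant of the formal calculus vanishing on all four move sets —
   none is known (this would be the headline refutation of the summit; cf. route Neg).
3. LOAD-BEARING HYPOTHESES (§3a). Each of the four pinning clauses `hr`, `hri`, `hr'`, `hri'` is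
   necessary: the variant with it dropped is refuted by evaluation
   (`multiplicationThree_false_without_hr / _hri / _hr' / _hri'`; witnesses: empty-domain and
   zero-integrand representations against the positive value of the other side, at `s = 1`).
4. THE GUARD `0 < s` IS NOT LOAD-BEARING (§3b). `multiplicationThreeWithout_pos_iff`: dropping
   `0 < s` gives an EQUIVALENT statement, because for `s ≤ 0` no representation satisfies the box
   pinning (`no_boxRep_of_nonpos`: `t^{-1/3}(1-t)^{s-1}` is not integrable at `t = 1⁻`, by
   reflection and `intervalIntegral.integrableOn_Ioo_rpow_iff`, transported through Tonelli on
   `Fin 2 → ℝ ≃ ℝ × ℝ`). So `s` enters a proof only through the existence of the data — consistent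
   with the idea cards' claim that their chains are uniform in `s`.
5. REFUTED STRENGTHENING (§4). `not_multiplicationThreeByAdditivity` /
   `not_mem_closure_additivity`: for every `s > 0` and ALL pinned `r, r'`, `[r] − [r']` is NOT in
   the subgroup generated by the additivity moves (1a)+(1b): the tree's `KZ.restrictedEval` over the
   window `W = (1,2) × (1/4,1/2)` (inside the triangle, outside the unit box) kills additivity and
   is `−∫_W (σ₁σ₂(3−σ₁−σ₂))^{s−1} < 0` on the pair. **Every derivation uses a change of variables or
   a Newton–Leibniz move.** (Whether rules (1)+(2) in dimension 2 suffice — the "weighted scissors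
   congruence" form C⁺ of idea card bolza-involution-real-quotient — is NOT decided here: no
   invariant of (1)+(2) beyond evaluation is available; see Near-misses.)
6. NUMERICS. The value identity is PROVED in Lean (item 2), so numerics are only a cross-check:
   kit job j007809 (mpmath, 30 digits; script `num/values_check.py` in the seat folder; attached to
   the item by the compute daemon when it ends — still QUEUED at the time of writing) compares the
   closed forms, the reduction `J = 9·27^{s-1}B(s,2s)B(s,s)`, direct 2-D tanh–sinh quadrature of the
   triangle integral and Gauss `n = 3` at s ∈ {1/100, 1/9, 2/7, 1/3, 1/2, 1, 5/3, 7, 25, 101/4};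
   earlier refuter passes on the item record `B(1/3,s)B(2/3,s) = 3^{3s-1}Γ(s)³/Γ(3s)` to `1e-15`
   (111.0928748424 at `s = 1/9`). The natural mis-normalisation "simplex of side 1" has value
   `Γ(s)³/Γ(3s)`, off by the factor `3^{3s-1}` — equal only at `s = 1/3`.
6b. BOX-TO-BOX FORM (§5). The chart `Φ` is ONE rule-(2) move `[pullbackRep] − [simplexRep] ∈
   changeOfVariablesRel`, `pullbackRep = [box, 9·(27uv(1−v))^{s−1}(1−u)^{2s−1}]` a box-Mellin
   member with RATIONAL constant 9; `multiplicationThree_iff_boxToBox`: the crux ⇔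
   `∀ s hs, Equivalent (boxRep s hs) (pullbackRep s hs)` — a relation between two presented members
   (`isMellinMemberWith_boxRep / _pullbackRep`) of the dimension-2 Mellin box family on the same box.
6c. CALIBRATION AT `s = 1` (§6). `multiplicationThree_at_one`: at `s = 1` the crux HOLDS, by TWO
   rule-(2) moves — the Kummer map `K(u,v) = (u^{1/3}, v^{2/3})` (`[box, u^{-2/3}v^{-1/3}] ~ [box, 9/2]`)
   and the shear `M(u,v) = (3(1−√(1−u)), 3√(1−u)v)` with CONSTANT Jacobian `9/2`, a semialgebraic
   bijection box → triangle (`[box, 9/2] ~ [triangle, 1]`). So any separating invariant must vanish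
   at `s = 1` (and, adding Newton–Leibniz with polynomial primitives, at every `s ∈ ℕ`): a kill must
   be genuinely `s`-dependent; the first cases with content are `s = 1/2`, `1/9`, `1/3`.
6d. BARRIER INSTANCE (no theorem; Chebyshev's criterion on binomial integrals). The naive
   "Fubini-first" line — eliminate `v` from the box side by a Newton–Leibniz move INSIDE dimension 2 —
   needs a `ℚ`-semialgebraic primitive of `v^{-1/3}(1−v)^{s−1}`; by Chebyshev (`m = −1/3, n = 1,
   p = s−1`) the incomplete Beta integral is elementary iff `s ∈ ℤ` or `s ∈ 1/3 + ℤ`, and it is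
   ALGEBRAIC (a polynomial in `v` times `v^{2/3}`) exactly for `s ∈ ℕ`; at `s ∈ 1/3 + ℕ` it carries
   `log`/`arctan` terms (e.g. `∫ v^{-1/3}(1−v)^{-2/3} dv = −3∫ dt/(1+t³)`, `t³ = (1−v)/v`). So the
   catalogued barrier `Literature.Barriers.KontsevichZagierPeriods.AlgebraicPrimitivesObstruction`
   (Ayoub Rem. 1.2 / Cresson–Viu-Sos §2.1) bites every such line for `s ∉ ℕ`, consistent with §6:
   outside `s ∈ ℕ` a chain must change variables non-trivially (Kummer/Terasoma/Bolza-type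
   correspondences) or raise the dimension; the route's Betti-transposition line does the latter.
7. LINE-LEVEL FALSIFIER (2) OF THE ROUTE — DECIDED IN CYCLE 2 (§7): it does NOT bite. Terasoma's
   Betti transposition at `n = 3` is INTEGRAL: `H₁(C°, cusps; ℤ)` is FREE of rank one over
   `ℤ[μ_d × μ_3]` on the real arc (dessin of the Belyi map `y³`, group simply transitive on edges;
   verbatim for every `n`), hence the transfer `q^!Z̄₀` (all `2d` sheets; `deg q = 2d` absorbed by
   rule (1b): `of_sub_nsmul_of_constMul_inv_mem_relations`) is `Θ₃·[γ×γ] + ∂W₃ + (chains in A)` with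
   the UNIQUE, EXPLICIT `Θ₃ = Σ_{i mod d, j mod 3} ([(i,j)|(−i,j+2)] − [(i,j)|(−i,j+1)]) ∈ ℤ[H²]`
   (computed from the period pairings; relative-Stokes consistency verified exactly; numerical
   certificate kit j010553). No torsion, no `N·Z₀`, no passage through `y = ∞`, every `s > 0`: the
   recorded "why it might fail" of this crux and of MultiplicationAccessible (stmt-12305) is void.
   What IS false is the literal UNCORRECTED single-sheet reading "∂W₃ = Z₀ − Θ₃γ²": `q` is simply
   ramified over the barycentre of `Z₀` (`sym_fibre_barycentre`, `ramification_only_at_barycentre`,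
   `jacobian_dft_vieta`: `c₃ = ζ − ζ²`), and the transposition monodromy obstructs every sum of
   single-sheet lifts (Paper Theorem 7.2). Provers: use the transfer `q^!Z̄₀` with `η/(2d)` (R1), or
   correct the lift by `τc − c` along the cusp divisor (R2) — both free in the calculus.
8. Targets: none (`stuck_stubs = []` at both cycles). Near-misses: none claimed as theorems. Open
   adversarial questions (Q1–Q4) are listed at the end of the file; Q2 (torsion) is closed for the
   Betti line.
8c. CYCLE 2, §9: the first moves of that line (box shear, halving, involution, re-addition) are
   CERTIFIED as move instances of the tree's calculus: `boxRep_equivalent_sigmaBoxAvgRep :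
   Equivalent (boxRep s hs) [Σ_box, u^{s−1}(ψ+ψ̄)/2]` for every rational `s > 0`.
8d. CYCLE 2, §10: the simplex-side shear is certified too (`simplexRep_equivalent_ovalRep_two`),
   so the crux is REDUCED by certified moves to ONE relation between sheared representations:
   `multiplicationThree_iff_sheared : MultiplicationThree ↔ ∀ s hs, Equivalent
   [Σ_box, u^{s−1}(ψ+ψ̄)/2] [Σ_oval, 2u^{s−1}/√Q(a,u)]`.
8e. BY-PRODUCT (evidence on stmt-5085 and this item): a complete candidate PROOF of MellinCoarea's
   support item TriplicationCoareaGlue (stmt-KontsevichZagierPeriods-5085: TriplicationFibreTransfer ↔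
   MultiplicationThree), file `TriplicationCoareaGlueProof.lean` (rc 0, axioms standard) — so the
   MellinCoarea crux TriplicationFibreTransfer (stmt-5083) is formally EQUIVALENT to this crux.
8b. CYCLE 2, §8: ATTACK ON THE CHEAPEST LINE FAILED — the idea card bolza-involution-real-quotient's
   two non-classical identities (involution swaps `ψ ↔ ψ̄`; `|∂a/∂v|/√Q = (ψ+ψ̄)/3` for the chart
   `a = −(z−1)²/z`, `z³ = v(1−v)/(1−u−v)`), numerically evidenced by the card, are PROVED here as
   exact `rpow` identities (`bolza_involution_density`, `bolza_lever`); the torsion input is the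
   classical level-3 structure (`hesse_pencil_flex`, `quartic_to_cubic`). Adversary's assessment:
   the crux is TRUE and provable now along bolza by rules (1a),(1b),(2) in dimension 2, uniformly in
   `s`; no recorded failure mode of the item survives (poles/torsion: §7; uniformity: §8).
9. LANDED in the tree (importable; namespace
   `Summit.KontsevichZagierPeriods.TerasomaMultiplication.MultiplicationThreeNegative`; all
   accepted, `--supports stmt-KontsevichZagierPeriods-3598`):
   `Summits/…/Theorems/MultiplicationThree/Negative/Pinned.lean` (p72772: §1),
   `ValueEq.lean` (p73174: §2), `Additivity.lean` (p74082: §4), `LoadBearing.lean` (p74340: §3),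
   `BoxToBox.lean` (p74073: §5), `Calibration.lean` + `CalibrationShear.lean` (p74700, p74789: §6);
   cycle 2: `Transfer.lean` (§7 lemmas: degree absorption, Jacobian `c₃`, ramification at the
   barycentre) and `BolzaLever.lean` (§8 lemmas); proposal ids in the seat's NOTES.md / item
   evidence.
-/

noncomputable section

set_option linter.dupNamespace false

open MeasureTheory Set Real
open scoped BigOperators

namespace Summit.KontsevichZagierPeriods.KontsevichZagierPeriods.Cruxes.MultiplicationThree.Disproof

open Literature.NumberTheory.Transcendental
open Literature.NumberTheory.Transcendental.KZ
open Literature.ModelTheory.ExponentialFields (IsSemialgebraic)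
open MvPolynomial (aeval X C)
open Summit.KontsevichZagierPeriods.KontsevichZagierPeriods.Theses.TerasomaMultiplication
  (MultiplicationThree)

/-! ## §1 Vocabulary: the two pinned representations exist for every rational `s > 0` -/

/-- The open unit box `(0,1)²`, literally the domain clause of the crux. [folklore] -/
def box : Set (Fin 2 → ℝ) := {x | ∀ i, x i ∈ Set.Ioo (0:ℝ) 1}

/-- The open triangle `{σ₁ > 0, σ₂ > 0, σ₁ + σ₂ < 3}`, literally the domain clause of the crux. [folklore] -/
def triangle : Set (Fin 2 → ℝ) := {x | 0 < x 0 ∧ 0 < x 1 ∧ x 0 + x 1 < 3}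

/-- The box integrand `v₁^{-2/3}(1-v₁)^{s-1} v₂^{-1/3}(1-v₂)^{s-1}`, literally as in the crux. [folklore] -/
def boxFun (s : ℚ) : (Fin 2 → ℝ) → ℝ := fun x =>
  (x 0) ^ (-(2:ℝ)/3) * (1 - x 0) ^ ((s:ℝ) - 1) * (x 1) ^ (-(1:ℝ)/3) * (1 - x 1) ^ ((s:ℝ) - 1)

/-- The simplex integrand `(σ₁σ₂(3-σ₁-σ₂))^{s-1}`, literally as in the crux. [folklore] -/
def simplexFun (s : ℚ) : (Fin 2 → ℝ) → ℝ := fun x => (x 0 * x 1 * (3 - x 0 - x 1)) ^ ((s:ℝ) - 1)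

/-- The crux, unfolded over this vocabulary (by `Iff.rfl`). [folklore] -/
theorem multiplicationThree_iff :
    MultiplicationThree ↔ ∀ s : ℚ, 0 < s → ∀ (r r' : IntegralRep 2), r.domain = box →
      EqOn r.integrand (boxFun s) r.domain → r'.domain = triangle →
      EqOn r'.integrand (simplexFun s) r'.domain → Equivalent r r' :=
  Iff.rfl

/-- The box is the product set `∏ (0,1)`. [folklore] -/
theorem box_eq_pi : box = Set.pi Set.univ fun _ : Fin 2 => Set.Ioo (0:ℝ) 1 := by
  ext x; simp [box]

/-- The box is `ℚ`-semialgebraic. [folklore] -/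
theorem isSemialgebraic_box : IsSemialgebraic ℚ box := KZ.isSemialgebraic_box 2

/-- The describing polynomials of the triangle. [folklore] -/
def trianglePolys : Fin 3 → MvPolynomial (Fin 2) ℚ := ![X 0, X 1, 3 - X 0 - X 1]

/-- The triangle is cut out by `trianglePolys > 0`. [folklore] -/
theorem triangle_eq : triangle = {x | ∀ l, 0 < aeval x (trianglePolys l)} := by
  ext x
  simp only [triangle, mem_setOf_eq, Fin.forall_fin_succ, trianglePolys,
    Matrix.cons_val_zero, Matrix.cons_val_succ, map_sub, MvPolynomial.aeval_X]
  have h3 : aeval x (3 : MvPolynomial (Fin 2) ℚ) = (3 : ℝ) := by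
    rw [show (3 : MvPolynomial (Fin 2) ℚ) = C 3 by simp [map_ofNat], MvPolynomial.aeval_C]; simp
  rw [h3]
  constructor
  · rintro ⟨h0, h1, h2⟩; exact ⟨h0, h1, by linarith, fun i => Fin.elim0 i⟩
  · rintro ⟨h0, h1, h2, -⟩; exact ⟨h0, h1, by linarith⟩

/-- The triangle is `ℚ`-semialgebraic. [folklore] -/
theorem isSemialgebraic_triangle : IsSemialgebraic ℚ triangle := by
  rw [triangle_eq]; exact isSemialgebraic_setOf_forall_aeval_pos _

/-- Measurability of the box. [folklore] -/
theorem measurableSet_box : MeasurableSet box :=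
  IsSemialgebraic.measurableSet_holds isSemialgebraic_box

/-- Measurability of the triangle. [folklore] -/
theorem measurableSet_triangle : MeasurableSet triangle :=
  IsSemialgebraic.measurableSet_holds isSemialgebraic_triangle

/-- The Mellin family of the box integrand. [folklore] -/
def boxPolys : Fin 4 → MvPolynomial (Fin 2) ℚ := ![X 0, 1 - X 0, X 1, 1 - X 1]

/-- The Mellin exponents of the box integrand. [folklore] -/
def boxExps (s : ℚ) : Fin 4 → ℚ := ![-2/3, s - 1, -1/3, s - 1]

/-- On the box the box integrand is the Euler–Mellin integrand of `(boxPolys, boxExps s, 1)`. [folklore] -/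
theorem boxFun_eq_mellinIntegrand (s : ℚ) {x : Fin 2 → ℝ} :
    boxFun s x = mellinIntegrand boxPolys (boxExps s) 1 x := by
  simp only [boxFun, mellinIntegrand, Fin.prod_univ_four, boxPolys, boxExps, Matrix.cons_val_zero,
    Matrix.cons_val_one, Matrix.cons_val_two, Matrix.cons_val_three, Matrix.head_cons,
    Matrix.tail_cons, map_sub, map_one, MvPolynomial.aeval_X, Rat.cast_one, one_mul, Rat.cast_sub, Rat.cast_div,
    Rat.cast_neg, Rat.cast_ofNat]

/-- The box integrand is `ℚ`-semialgebraic on the box (rational exponents). [folklore] -/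
theorem isSemialgebraicFunOn_boxFun (s : ℚ) : IsSemialgebraicFunOn ℚ box (boxFun s) := by
  refine (isSemialgebraicFunOn_mellinIntegrand isSemialgebraic_box boxPolys (boxExps s) 1
    ?_).congr fun x _ => (boxFun_eq_mellinIntegrand s).symm
  intro x hx k
  have h0 := hx 0
  have h1 := hx 1
  fin_cases k <;> simp [boxPolys, h0.1, h1.1, h0.2, h1.2]

/-- The Mellin family of the simplex integrand. [folklore] -/
def simplexPolys : Fin 1 → MvPolynomial (Fin 2) ℚ := ![X 0 * X 1 * (3 - X 0 - X 1)]

/-- On the triangle the simplex integrand is the Euler–Mellin integrand of `(simplexPolys, s-1, 1)`. [folklore] -/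
theorem simplexFun_eq_mellinIntegrand (s : ℚ) {x : Fin 2 → ℝ} :
    simplexFun s x = mellinIntegrand simplexPolys ![s - 1] 1 x := by
  have h3 : aeval x (3 : MvPolynomial (Fin 2) ℚ) = (3 : ℝ) := by
    rw [show (3 : MvPolynomial (Fin 2) ℚ) = C 3 by simp [map_ofNat], MvPolynomial.aeval_C]; simp
  simp only [simplexFun, mellinIntegrand, Fin.prod_univ_one, simplexPolys, Matrix.cons_val_zero,
    map_sub, map_mul, MvPolynomial.aeval_X, h3, Rat.cast_one, one_mul, Rat.cast_sub]

/-- The simplex integrand is `ℚ`-semialgebraic on the triangle. [folklore] -/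
theorem isSemialgebraicFunOn_simplexFun (s : ℚ) : IsSemialgebraicFunOn ℚ triangle (simplexFun s) := by
  refine (isSemialgebraicFunOn_mellinIntegrand isSemialgebraic_triangle simplexPolys ![s - 1] 1
    ?_).congr fun x _ => (simplexFun_eq_mellinIntegrand s).symm
  intro x hx k
  have h3 : aeval x (3 : MvPolynomial (Fin 2) ℚ) = (3 : ℝ) := by
    rw [show (3 : MvPolynomial (Fin 2) ℚ) = C 3 by simp [map_ofNat], MvPolynomial.aeval_C]; simp
  fin_cases k
  simp only [simplexPolys, Fin.zero_eta, Matrix.cons_val_zero, map_mul, map_sub, MvPolynomial.aeval_X, h3]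
  obtain ⟨h0, h1, h2⟩ := hx
  exact mul_pos (mul_pos h0 h1) (by linarith)

/-! ### Integrability and the box representation -/

/-- Lebesgue measure restricted to the box is the product of the restricted measures. [folklore] -/
theorem volume_restrict_box :
    (volume : Measure (Fin 2 → ℝ)).restrict box =
      Measure.pi fun _ : Fin 2 => (volume : Measure ℝ).restrict (Ioo (0:ℝ) 1) := by
  rw [box_eq_pi, volume_pi, Measure.restrict_pi_pi]

/-- Euler's Beta kernel `t^{a-1}(1-t)^{b-1}` is integrable on `(0,1)` for `a, b > 0` (tree lemma,
exponent form). [folklore] -/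
theorem integrableOn_beta {a b : ℝ} (ha : 0 < a) (hb : 0 < b) :
    IntegrableOn (fun t : ℝ => t ^ (a - 1) * (1 - t) ^ (b - 1)) (Ioo 0 1) :=
  (Literature.Analysis.SpecialFunctions.Selberg.integrableOn_Ioo_rpow_mul_one_sub_rpow_and_integral_eq
    ha hb).1

/-- The one-variable factors of the box integrand. [folklore] -/
def boxFactor (s : ℚ) : Fin 2 → ℝ → ℝ :=
  ![fun t => t ^ (-(2:ℝ)/3) * (1 - t) ^ ((s:ℝ) - 1), fun t => t ^ (-(1:ℝ)/3) * (1 - t) ^ ((s:ℝ) - 1)]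

/-- The box integrand is the product of its factors. [folklore] -/
theorem boxFun_eq_prod (s : ℚ) (x : Fin 2 → ℝ) : boxFun s x = ∏ i, boxFactor s i (x i) := by
  simp only [boxFun, boxFactor, Fin.prod_univ_two, Matrix.cons_val_zero, Matrix.cons_val_one]
  ring

/-- Each factor is Beta-integrable for `s > 0`. [folklore] -/
theorem integrable_boxFactor {s : ℚ} (hs : 0 < s) (i : Fin 2) :
    Integrable (boxFactor s i) ((volume : Measure ℝ).restrict (Ioo (0:ℝ) 1)) := by
  have hsR : (0:ℝ) < s := by exact_mod_cast hs
  fin_cases i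
  · have h := integrableOn_beta (a := 1/3) (b := s) (by norm_num) hsR
    refine (h.congr_fun (fun t _ => ?_) measurableSet_Ioo)
    simp only [boxFactor]; norm_num
  · have h := integrableOn_beta (a := 2/3) (b := s) (by norm_num) hsR
    refine (h.congr_fun (fun t _ => ?_) measurableSet_Ioo)
    simp only [boxFactor]; norm_num

/-- The box integrand is absolutely integrable on the box for every rational `s > 0`. [folklore] -/
theorem integrableOn_boxFun {s : ℚ} (hs : 0 < s) : IntegrableOn (boxFun s) box := by
  rw [IntegrableOn, volume_restrict_box]
  have h := Integrable.fintype_prod (f := boxFactor s)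
    (μ := fun _ : Fin 2 => (volume : Measure ℝ).restrict (Ioo (0:ℝ) 1)) (integrable_boxFactor hs)
  exact h.congr (ae_of_all _ fun x => (boxFun_eq_prod s x).symm)

/-- **The pinned box representation** `[ (0,1)², v₁^{-2/3}(1-v₁)^{s-1}v₂^{-1/3}(1-v₂)^{s-1} ]`
for rational `s > 0`: the hypotheses `hr`, `hri` of the crux are satisfiable. [folklore] -/
def boxRep (s : ℚ) (hs : 0 < s) : IntegralRep 2 where
  domain := box
  integrand := boxFun s
  isSemialgebraic_domain := isSemialgebraic_box
  isSemialgebraicFunOn_integrand := isSemialgebraicFunOn_boxFun s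
  integrableOn := integrableOn_boxFun hs


/-! ### The chart `Φ(u,v) = (3u, 3(1-u)v)` of the triangle by the box (affine in each fibre) -/

/-- The chart `Φ(u, v) = (3u, 3(1 - u)v)`: a polynomial bijection of the open box onto the open
triangle, with Jacobian determinant `9(1 - u)`. [folklore] -/
def Φ (x : Fin 2 → ℝ) : Fin 2 → ℝ := ![3 * x 0, 3 * (1 - x 0) * x 1]

/-- First component of the chart. [folklore] -/
@[simp] theorem Φ_apply_zero (x : Fin 2 → ℝ) : Φ x 0 = 3 * x 0 := rfl

/-- Second component of the chart. [folklore] -/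
@[simp] theorem Φ_apply_one (x : Fin 2 → ℝ) : Φ x 1 = 3 * (1 - x 0) * x 1 := rfl

/-- The Jacobian matrix of the chart. [folklore] -/
def jac (x : Fin 2 → ℝ) : Matrix (Fin 2) (Fin 2) ℝ := !![3, 0; -(3 * x 1), 3 * (1 - x 0)]

/-- The derivative of the chart as a continuous linear map. [folklore] -/
def Φ' (x : Fin 2 → ℝ) : (Fin 2 → ℝ) →L[ℝ] (Fin 2 → ℝ) :=
  LinearMap.toContinuousLinearMap (Matrix.toLin' (jac x))

/-- The derivative applied to a vector, first component. [folklore] -/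
@[simp] theorem Φ'_apply_zero (x v : Fin 2 → ℝ) : Φ' x v 0 = 3 * v 0 := by
  change Matrix.toLin' (jac x) v 0 = _
  rw [Matrix.toLin'_apply]
  simp [jac, Matrix.mulVec, dotProduct, Fin.sum_univ_two]

/-- The derivative applied to a vector, second component. [folklore] -/
@[simp] theorem Φ'_apply_one (x v : Fin 2 → ℝ) :
    Φ' x v 1 = -(3 * x 1) * v 0 + 3 * (1 - x 0) * v 1 := by
  change Matrix.toLin' (jac x) v 1 = _
  rw [Matrix.toLin'_apply]
  simp [jac, Matrix.mulVec, dotProduct, Fin.sum_univ_two]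

/-- `det DΦ(u,v) = 9(1 - u)`. [folklore] -/
theorem det_Φ' (x : Fin 2 → ℝ) : (Φ' x).det = 9 * (1 - x 0) := by
  change LinearMap.det (Matrix.toLin' (jac x)) = _
  rw [LinearMap.det_toLin', Matrix.det_fin_two]
  simp [jac]
  ring

/-- The chart is differentiable with derivative `Φ'`. [folklore] -/
theorem hasFDerivAt_Φ (x : Fin 2 → ℝ) : HasFDerivAt Φ (Φ' x) x := by
  have h0 : HasFDerivAt (fun y : Fin 2 → ℝ => y 0)
      (ContinuousLinearMap.proj (R := ℝ) (φ := fun _ : Fin 2 => ℝ) 0) x :=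
    hasFDerivAt_apply 0 x
  have h1 : HasFDerivAt (fun y : Fin 2 → ℝ => y 1)
      (ContinuousLinearMap.proj (R := ℝ) (φ := fun _ : Fin 2 => ℝ) 1) x :=
    hasFDerivAt_apply 1 x
  rw [hasFDerivAt_pi']
  refine Fin.forall_fin_two.mpr ⟨?_, ?_⟩
  · have hf : (fun y : Fin 2 → ℝ => Φ y 0) = fun y => 3 * y 0 := funext fun y => rfl
    rw [hf]
    refine (h0.const_mul (3:ℝ)).congr_fderiv (ContinuousLinearMap.ext fun v => ?_)
    simp
  · have hf : (fun y : Fin 2 → ℝ => Φ y 1) = fun y => 3 * (1 - y 0) * y 1 := funext fun y => rfl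
    rw [hf]
    refine (((h0.const_sub 1).const_mul (3:ℝ)).mul h1).congr_fderiv
      (ContinuousLinearMap.ext fun v => ?_)
    simp
    ring

/-- The chart is injective on the box. [folklore] -/
theorem injOn_Φ : InjOn Φ box := by
  intro x hx y hy hxy
  have h0 : x 0 = y 0 := by
    have := congrFun hxy 0
    simp only [Φ_apply_zero] at this
    linarith
  have h1 : x 1 = y 1 := by
    have := congrFun hxy 1
    simp only [Φ_apply_one, h0] at this
    have hne : (3 : ℝ) * (1 - y 0) ≠ 0 := by have := (hy 0).2; positivity
    exact mul_left_cancel₀ hne this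
  funext i
  fin_cases i
  · exact h0
  · exact h1

/-- The chart maps the box ONTO the triangle. [folklore] -/
theorem image_Φ_box : Φ '' box = triangle := by
  ext y
  constructor
  · rintro ⟨x, hx, rfl⟩
    have h0 := hx 0
    have h1 := hx 1
    refine ⟨by simp; exact h0.1, by simp; exact mul_pos (by linarith [h0.2]) h1.1, ?_⟩
    simp only [Φ_apply_zero, Φ_apply_one]
    nlinarith [h0.1, h0.2, h1.1, h1.2, mul_pos (sub_pos.2 h0.2) (sub_pos.2 h1.2)]
  · rintro ⟨hy0, hy1, hy2⟩
    have h3 : 0 < 3 - y 0 := by linarith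
    refine ⟨![y 0 / 3, y 1 / (3 - y 0)], Fin.forall_fin_two.mpr ⟨?_, ?_⟩, ?_⟩
    · change y 0 / 3 ∈ Ioo (0:ℝ) 1
      exact ⟨by positivity, by rw [div_lt_one (by norm_num)]; linarith⟩
    · change y 1 / (3 - y 0) ∈ Ioo (0:ℝ) 1
      exact ⟨div_pos hy1 h3, by rw [div_lt_one h3]; linarith⟩
    · funext i
      fin_cases i
      · change 3 * (y 0 / 3) = y 0
        ring
      · change 3 * (1 - y 0 / 3) * (y 1 / (3 - y 0)) = y 1
        field_simp

/-- `|det DΦ| = 9(1 - u) > 0` on the box. [folklore] -/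
theorem abs_det_Φ' {x : Fin 2 → ℝ} (hx : x ∈ box) : |(Φ' x).det| = 9 * (1 - x 0) := by
  rw [det_Φ', abs_of_pos]
  have := (hx 0).2
  linarith

/-- The pulled-back factors: the box integrand of `9·27^{s-1}·B(s,2s)B(s,s)`. [folklore] -/
def pullFactor (s : ℚ) : Fin 2 → ℝ → ℝ :=
  ![fun t => t ^ ((s:ℝ) - 1) * (1 - t) ^ (2 * (s:ℝ) - 1), fun t => t ^ ((s:ℝ) - 1) * (1 - t) ^ ((s:ℝ) - 1)]

/-- The constant `9 · 27^{s-1}` of the pull-back. [folklore] -/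
def pullConst (s : ℚ) : ℝ := 9 * (27:ℝ) ^ ((s:ℝ) - 1)

/-- **The pull-back identity**: on the box,
`|det DΦ| · (σ₁σ₂(3-σ₁-σ₂))^{s-1} ∘ Φ = 9·27^{s-1} · u^{s-1}(1-u)^{2s-1} · v^{s-1}(1-v)^{s-1}`
(the fibre of `Φ` over `σ₁ = 3u` is the segment `σ₂ ∈ (0, 3(1-u))`, and
`3 - 3u - 3(1-u)v = 3(1-u)(1-v)`). [folklore] -/
theorem pullback_eq {s : ℚ} {x : Fin 2 → ℝ} (hx : x ∈ box) :
    |(Φ' x).det| * simplexFun s (Φ x) = pullConst s * ∏ i, pullFactor s i (x i) := by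
  have hu0 : 0 < x 0 := (hx 0).1
  have hu1 : 0 < 1 - x 0 := sub_pos.2 (hx 0).2
  have hv0 : 0 < x 1 := (hx 1).1
  have hv1 : 0 < 1 - x 1 := sub_pos.2 (hx 1).2
  rw [abs_det_Φ' hx]
  simp only [simplexFun, Φ_apply_zero, Φ_apply_one, pullConst, pullFactor, Fin.prod_univ_two,
    Matrix.cons_val_zero, Matrix.cons_val_one]
  have hbase : 3 * x 0 * (3 * (1 - x 0) * x 1) * (3 - 3 * x 0 - 3 * (1 - x 0) * x 1) =
      27 * (x 0 * ((1 - x 0) ^ (2:ℝ) * (x 1 * (1 - x 1)))) := by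
    rw [Real.rpow_two]; ring
  rw [hbase, Real.mul_rpow (by norm_num) (by positivity), Real.mul_rpow hu0.le (by positivity),
    Real.mul_rpow (by positivity) (by positivity), Real.mul_rpow hv0.le hv1.le,
    ← Real.rpow_mul hu1.le]
  have h2 : (1 - x 0) ^ (2 * ((s:ℝ) - 1)) * (1 - x 0) = (1 - x 0) ^ (2 * (s:ℝ) - 1) := by
    rw [← Real.rpow_add_one hu1.ne']
    ring_nf
  rw [← h2]
  ring

/-- Each pulled-back factor is Beta-integrable for `s > 0`. [folklore] -/
theorem integrable_pullFactor {s : ℚ} (hs : 0 < s) (i : Fin 2) :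
    Integrable (pullFactor s i) ((volume : Measure ℝ).restrict (Ioo (0:ℝ) 1)) := by
  have hsR : (0:ℝ) < s := by exact_mod_cast hs
  fin_cases i
  · have h := integrableOn_beta (a := s) (b := 2 * s) hsR (by positivity)
    refine (h.congr_fun (fun t _ => ?_) measurableSet_Ioo)
    simp only [pullFactor]
    norm_num
  · exact integrableOn_beta (a := s) (b := s) hsR hsR

/-- The pulled-back integrand is integrable on the box. [folklore] -/
theorem integrableOn_pullback {s : ℚ} (hs : 0 < s) :
    IntegrableOn (fun x => pullConst s * ∏ i, pullFactor s i (x i)) box := by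
  rw [IntegrableOn, volume_restrict_box]
  exact (Integrable.fintype_prod (f := pullFactor s)
    (μ := fun _ : Fin 2 => (volume : Measure ℝ).restrict (Ioo (0:ℝ) 1))
    (integrable_pullFactor hs)).const_mul _

/-- **The simplex integrand is absolutely integrable on the triangle** for every rational `s > 0`
(Dirichlet's integral, here by the chart `Φ` and Mathlib's Jacobian criterion
`integrableOn_image_iff_integrableOn_abs_det_fderiv_smul`). [folklore] -/
theorem integrableOn_simplexFun {s : ℚ} (hs : 0 < s) : IntegrableOn (simplexFun s) triangle := by
  rw [← image_Φ_box]
  rw [integrableOn_image_iff_integrableOn_abs_det_fderiv_smul volume measurableSet_box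
    (fun x _ => (hasFDerivAt_Φ x).hasFDerivWithinAt) injOn_Φ]
  refine (integrableOn_pullback hs).congr_fun (fun x hx => ?_) measurableSet_box
  rw [smul_eq_mul, pullback_eq hx]

/-- **The pinned simplex representation** `[ triangle, (σ₁σ₂(3-σ₁-σ₂))^{s-1} ]` for rational
`s > 0`: the hypotheses `hr'`, `hri'` of the crux are satisfiable. [folklore] -/
def simplexRep (s : ℚ) (hs : 0 < s) : IntegralRep 2 where
  domain := triangle
  integrand := simplexFun s
  isSemialgebraic_domain := isSemialgebraic_triangle
  isSemialgebraicFunOn_integrand := isSemialgebraicFunOn_simplexFun s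
  integrableOn := integrableOn_simplexFun hs

/-- **Non-vacuity and reduction to one pair.** The crux is equivalent to its instance on the two
pinned representations: any two representations satisfying the four pinning hypotheses differ from
`boxRep s`, `simplexRep s` by integrand additivity with a zero representation
(`KZ.of_sub_of_mem_relations_of_eqOn`). A prover may fix `r := boxRep s hs`, `r' := simplexRep s hs`.
[folklore] -/
theorem multiplicationThree_iff_pinned :
    MultiplicationThree ↔ ∀ (s : ℚ) (hs : 0 < s), Equivalent (boxRep s hs) (simplexRep s hs) := by
  constructor
  · intro h s hs
    exact h s hs (boxRep s hs) (simplexRep s hs) rfl (fun _ _ => rfl) rfl (fun _ _ => rfl)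
  · intro h s hs r r' hr hri hr' hri'
    have h1 : of r - of (boxRep s hs) ∈ relations :=
      of_sub_of_mem_relations_of_eqOn (by rw [hr]; rfl) hri
    have h2 : of (simplexRep s hs) - of r' ∈ relations :=
      of_sub_of_mem_relations_of_eqOn (by rw [hr']; rfl) fun x hx => (hri' (by rw [hr']; exact hx)).symm
    have : of r - of r' = (of r - of (boxRep s hs)) + (of (boxRep s hs) - of (simplexRep s hs)) +
        (of (simplexRep s hs) - of r') := by abel
    show of r - of r' ∈ relations
    rw [this]
    exact relations.add_mem (relations.add_mem h1 (h s hs)) h2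


/-! ## §2 No evaluation kill: the two values agree (Euler–Gauss multiplication at `n = 3`) -/

/-- Euler's Beta integral on `(0,1)` (tree lemma, exponent form). [folklore] -/
theorem integral_beta {a b : ℝ} (ha : 0 < a) (hb : 0 < b) :
    ∫ t in Ioo (0:ℝ) 1, t ^ (a - 1) * (1 - t) ^ (b - 1) = Gamma a * Gamma b / Gamma (a + b) :=
  (Literature.Analysis.SpecialFunctions.Selberg.integrableOn_Ioo_rpow_mul_one_sub_rpow_and_integral_eq
    ha hb).2

/-- **Value of the box side**: `∫_{(0,1)²} v₁^{-2/3}(1-v₁)^{s-1}v₂^{-1/3}(1-v₂)^{s-1}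
= B(1/3, s) · B(2/3, s)` (Fubini on the product box). [folklore] -/
theorem integral_box_boxFun {s : ℚ} (hs : 0 < s) :
    ∫ x in box, boxFun s x =
      (Gamma (1/3) * Gamma s / Gamma (1/3 + s)) * (Gamma (2/3) * Gamma s / Gamma (2/3 + s)) := by
  have hsR : (0:ℝ) < s := by exact_mod_cast hs
  simp_rw [boxFun_eq_prod]
  rw [volume_restrict_box, integral_fintype_prod_eq_prod (𝕜 := ℝ) (fun i => boxFactor s i),
    Fin.prod_univ_two]
  have e0 : boxFactor s 0 = fun t => t ^ ((1/3:ℝ) - 1) * (1 - t) ^ ((s:ℝ) - 1) := by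
    funext t; simp only [boxFactor, Matrix.cons_val_zero]; norm_num
  have e1 : boxFactor s 1 = fun t => t ^ ((2/3:ℝ) - 1) * (1 - t) ^ ((s:ℝ) - 1) := by
    funext t; simp only [boxFactor, Matrix.cons_val_one, Matrix.cons_val_zero]; norm_num
  rw [e0, e1, integral_beta (by norm_num) hsR, integral_beta (by norm_num) hsR]

/-- **Value of the simplex side**: `∫_{triangle} (σ₁σ₂(3-σ₁-σ₂))^{s-1} = 9·27^{s-1}·B(s,2s)·B(s,s)`
(change of variables along `Φ`, then Fubini). [folklore] -/
theorem integral_triangle_simplexFun {s : ℚ} (hs : 0 < s) :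
    ∫ x in triangle, simplexFun s x =
      pullConst s * ((Gamma s * Gamma (2 * s) / Gamma (s + 2 * s)) *
        (Gamma s * Gamma s / Gamma (s + s))) := by
  have hsR : (0:ℝ) < s := by exact_mod_cast hs
  rw [← image_Φ_box, integral_image_eq_integral_abs_det_fderiv_smul volume measurableSet_box
    (fun x _ => (hasFDerivAt_Φ x).hasFDerivWithinAt) injOn_Φ]
  rw [setIntegral_congr_fun measurableSet_box (fun x hx => by rw [smul_eq_mul, pullback_eq hx]),
    integral_const_mul, volume_restrict_box,
    integral_fintype_prod_eq_prod (𝕜 := ℝ) (fun i => pullFactor s i), Fin.prod_univ_two]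
  have e0 : pullFactor s 0 = fun t => t ^ ((s:ℝ) - 1) * (1 - t) ^ (2 * (s:ℝ) - 1) := rfl
  have e1 : pullFactor s 1 = fun t => t ^ ((s:ℝ) - 1) * (1 - t) ^ ((s:ℝ) - 1) := rfl
  rw [e0, e1, integral_beta hsR (by positivity), integral_beta hsR hsR]

/-- Gauss's multiplication formula at `n = 3`, real form (tree theorem
`Literature.Analysis.SpecialFunctions.GaussMultiplication.real_formula`):
`Γ(x)Γ(x+1/3)Γ(x+2/3)·3^{3x} = Γ(3x)·√3·2π` for `x > 0`. [cite: AndrewsAskeyRoy1999, Thm 1.5.2] -/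
theorem gauss_three {x : ℝ} (hx : 0 < x) :
    Gamma x * Gamma (x + 1/3) * Gamma (x + 2/3) * (3:ℝ) ^ ((3:ℝ) * x) =
      Gamma (3 * x) * (Real.sqrt 3 * (2 * π)) := by
  have h := Literature.Analysis.SpecialFunctions.GaussMultiplication.real_formula (n := 3)
    (by norm_num) hx
  simp only [Literature.Analysis.SpecialFunctions.GaussMultiplication.prodGamma,
    Finset.prod_range_succ, Finset.prod_range_zero, one_mul, Nat.cast_zero, zero_div, add_zero,
    Nat.cast_one, Nat.cast_ofNat] at h
  have h2 : (2 * π : ℝ) ^ (((3:ℝ) - 1) / 2) = 2 * π := by norm_num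
  rw [h2] at h
  linear_combination h

/-- `Γ(1/3)Γ(2/3) = 2π/√3`, i.e. `3·Γ(1/3)Γ(2/3) = √3·2π` (`gauss_three` at `x = 1/3`; this is
also Euler's reflection at `1/3`). [cite: AndrewsAskeyRoy1999, Thm 1.5.2] -/
theorem gamma_third_mul_gamma_two_thirds :
    Gamma (1/3) * Gamma (2/3) * 3 = Real.sqrt 3 * (2 * π) := by
  have h := gauss_three (x := 1/3) (by norm_num)
  have e1 : (1/3 : ℝ) + 1/3 = 2/3 := by norm_num
  have e2 : (1/3 : ℝ) + 2/3 = 1 := by norm_num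
  have e3 : (3:ℝ) * (1/3) = 1 := by norm_num
  rw [e1, e2, e3, Real.rpow_one, Gamma_one, mul_one, one_mul] at h
  exact h

/-- `27^{s-1} · 27 = 3^{3s}`. [folklore] -/
theorem pullConst_mul (s : ℚ) : pullConst s * 3 = (3:ℝ) ^ ((3:ℝ) * s) := by
  unfold pullConst
  rw [Real.rpow_sub_one (by norm_num), Real.rpow_mul (by norm_num)]
  have : (3:ℝ) ^ (3:ℝ) = 27 := by norm_num
  rw [this]
  ring

/-- **The two values agree**: `B(1/3,s)B(2/3,s) = 9·27^{s-1}·B(s,2s)B(s,s)`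
(`= 3^{3s-1}Γ(s)³/Γ(3s)`), by Gauss multiplication at `n = 3`. So the only PROVED invariant of
`KZ.relations`, evaluation, cannot separate the pair. [cite: AndrewsAskeyRoy1999, Thm 1.5.2] -/
theorem boxValue_eq_simplexValue {s : ℚ} (hs : 0 < s) :
    (Gamma (1/3) * Gamma s / Gamma (1/3 + s)) * (Gamma (2/3) * Gamma s / Gamma (2/3 + s)) =
      pullConst s * ((Gamma s * Gamma (2 * s) / Gamma (s + 2 * s)) *
        (Gamma s * Gamma s / Gamma (s + s))) := by
  have hsR : (0:ℝ) < s := by exact_mod_cast hs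
  have F1 := gauss_three hsR
  have F2 := gamma_third_mul_gamma_two_thirds
  have F3 := pullConst_mul s
  have hG : 0 < Gamma (s:ℝ) := Gamma_pos_of_pos hsR
  have hG1 : 0 < Gamma ((s:ℝ) + 1/3) := Gamma_pos_of_pos (by positivity)
  have hG2 : 0 < Gamma ((s:ℝ) + 2/3) := Gamma_pos_of_pos (by positivity)
  have hG3 : 0 < Gamma (3 * (s:ℝ)) := Gamma_pos_of_pos (by positivity)
  have hG2s : 0 < Gamma (2 * (s:ℝ)) := Gamma_pos_of_pos (by positivity)
  have hT : 0 < (3:ℝ) ^ ((3:ℝ) * s) := Real.rpow_pos_of_pos (by norm_num) _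
  have e1 : (1/3 : ℝ) + s = s + 1/3 := add_comm _ _
  have e2 : (2/3 : ℝ) + s = s + 2/3 := add_comm _ _
  have e3 : (s : ℝ) + 2 * s = 3 * s := by ring
  have e4 : (s : ℝ) + s = 2 * s := by ring
  rw [e1, e2, e3, e4]
  have nG : Gamma (s:ℝ) ≠ 0 := hG.ne'
  have nG1 : Gamma ((s:ℝ) + 1/3) ≠ 0 := hG1.ne'
  have nG2 : Gamma ((s:ℝ) + 2/3) ≠ 0 := hG2.ne'
  have nG3 : Gamma (3 * (s:ℝ)) ≠ 0 := hG3.ne'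
  have nG2s : Gamma (2 * (s:ℝ)) ≠ 0 := hG2s.ne'
  have hP : pullConst s = (3:ℝ) ^ ((3:ℝ) * s) / 3 := by rw [← F3]; ring
  rw [hP]
  field_simp
  have e5 : (3 * (s:ℝ) + 1) / 3 = s + 1/3 := by ring
  have e6 : (3 * (s:ℝ) + 2) / 3 = s + 2/3 := by ring
  rw [e5, e6]
  linear_combination Gamma (3 * (s:ℝ)) * F2 - F1


/-- Value of the pinned box representation. [folklore] -/
theorem boxRep_value {s : ℚ} (hs : 0 < s) :
    (boxRep s hs).value =
      (Gamma (1/3) * Gamma s / Gamma (1/3 + s)) * (Gamma (2/3) * Gamma s / Gamma (2/3 + s)) :=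
  integral_box_boxFun hs

/-- Value of the pinned simplex representation. [folklore] -/
theorem simplexRep_value {s : ℚ} (hs : 0 < s) :
    (simplexRep s hs).value =
      pullConst s * ((Gamma s * Gamma (2 * s) / Gamma (s + 2 * s)) *
        (Gamma s * Gamma s / Gamma (s + s))) :=
  integral_triangle_simplexFun hs

/-- **NO EVALUATION KILL.** Any two representations satisfying the four pinning hypotheses of the
crux have the SAME value (`B(1/3,s)B(2/3,s) = 3^{3s-1}Γ(s)³/Γ(3s)` = the Dirichlet integral over
the triangle of side 3). Since `KZ.relations ≤ ker eval` (`KZ.relations_le_ker_eval_holds`) is the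
only separation tool proved in the tree, no refutation by value exists, for any `s`.
[cite: AndrewsAskeyRoy1999, Thm 1.5.2] -/
theorem value_eq {s : ℚ} (hs : 0 < s) (r r' : IntegralRep 2) (hr : r.domain = box)
    (hri : EqOn r.integrand (boxFun s) r.domain) (hr' : r'.domain = triangle)
    (hri' : EqOn r'.integrand (simplexFun s) r'.domain) : r.value = r'.value := by
  simp only [IntegralRep.value]
  rw [hr] at hri ⊢
  rw [hr'] at hri' ⊢
  rw [setIntegral_congr_fun measurableSet_box hri, setIntegral_congr_fun measurableSet_triangle hri',
    integral_box_boxFun hs, integral_triangle_simplexFun hs, boxValue_eq_simplexValue hs]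

/-- **The crux is an instance of the summit** (so refuting it refutes Conjecture 1 as formalised):
Conjecture 1 for KZ-rational representations (`KontsevichZagierPeriods`) implies it for all
`ℚ`-semialgebraic ones (`kzPeriodConjecture'_iff_isRational`, via the PROVED
`KZ.exists_isRational_equivalent_holds` + soundness), and the two pinned representations have equal
values (`value_eq`). [cite: KontsevichZagier2001, §1.2 Conjecture 1] -/
theorem multiplicationThree_of_summit (h : _root_.KontsevichZagierPeriods) : MultiplicationThree := by
  have h' : Literature.NumberTheory.Transcendental.KZPeriodConjecture' :=
    kzPeriodConjecture'_iff_isRational.mpr (KontsevichZagierPeriods_iff.mp h)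
  intro s hs r r' hr hri hr' hri'
  exact h' r r' (value_eq hs r r' hr hri hr' hri')


/-! ## §4 Refuted strengthening: additivity moves alone never suffice

The pair `[r] − [r']` has coefficient sum `0`, so the augmentation `KZ.coeffSum` (which kills the
subgroup of moves (2)+(3)) says nothing. But the restricted evaluation `KZ.restrictedEval` over the
window `W = (1,2) × (1/4,1/2)` — inside the triangle, outside the unit box — kills every additivity
move and does NOT vanish on the pair: so **every derivation of the crux uses a change of variables
or a Newton–Leibniz move** (the two domains are not even rearrangements of each other in situ). -/

/-- Lower corners of the separating windows (dimension-uniform family, only `n = 2` matters). [folklore] -/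
def winLo (n : ℕ) (i : Fin n) : ℝ := if (i : ℕ) = 0 then 1 else 1/4

/-- Upper corners of the separating windows. [folklore] -/
def winHi (n : ℕ) (i : Fin n) : ℝ := if (i : ℕ) = 0 then 2 else 1/2

/-- The separating windows: in dimension 2, `W = (1,2) × (1/4,1/2)`. [folklore] -/
def window (n : ℕ) : Set (Fin n → ℝ) := Set.pi Set.univ fun i => Ioo (winLo n i) (winHi n i)

/-- The windows are measurable. [folklore] -/
theorem measurableSet_window (n : ℕ) : MeasurableSet (window n) :=
  MeasurableSet.univ_pi fun _ => measurableSet_Ioo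

/-- Membership in the dimension-2 window. [folklore] -/
theorem mem_window_two {x : Fin 2 → ℝ} :
    x ∈ window 2 ↔ (1 < x 0 ∧ x 0 < 2) ∧ (1/4 < x 1 ∧ x 1 < 1/2) := by
  simp only [window, winLo, winHi, mem_pi, mem_univ, true_implies, Fin.forall_fin_two,
    Fin.val_zero, Fin.val_one, if_true, mem_Ioo]
  norm_num

/-- The window misses the unit box. [folklore] -/
theorem box_inter_window : box ∩ window 2 = ∅ := by
  ext x
  simp only [mem_inter_iff, mem_window_two, mem_empty_iff_false, iff_false, not_and]
  intro hx hw
  have := (hx 0).2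
  linarith [hw.1]

/-- The window lies inside the triangle. [folklore] -/
theorem window_subset_triangle : window 2 ⊆ triangle := by
  intro x hx
  rw [mem_window_two] at hx
  obtain ⟨⟨h0, h0'⟩, h1, h1'⟩ := hx
  exact ⟨by linarith, by linarith, by linarith⟩

/-- The window has positive volume (`1 · 1/4`). [folklore] -/
theorem volume_window_pos : 0 < volume (window 2) := by
  rw [window, Real.volume_pi_Ioo, Fin.prod_univ_two]
  simp only [winLo, winHi, Fin.val_zero, Fin.val_one, if_true]
  norm_num

/-- The simplex integrand is positive on the window. [folklore] -/
theorem simplexFun_pos_of_mem_window (s : ℚ) {x : Fin 2 → ℝ} (hx : x ∈ window 2) :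
    0 < simplexFun s x := by
  rw [mem_window_two] at hx
  obtain ⟨⟨h0, h0'⟩, h1, h1'⟩ := hx
  exact Real.rpow_pos_of_pos (mul_pos (mul_pos (by linarith) (by linarith)) (by linarith)) _

/-- The simplex integrand has positive integral over the window. [folklore] -/
theorem integral_window_simplexFun_pos {s : ℚ} (hs : 0 < s) :
    0 < ∫ x in window 2, simplexFun s x := by
  have hint : IntegrableOn (simplexFun s) (window 2) :=
    (integrableOn_simplexFun hs).mono_set window_subset_triangle
  rw [setIntegral_pos_iff_support_of_nonneg_ae ?_ hint]
  · refine volume_window_pos.trans_le (measure_mono fun x hx => ⟨?_, hx⟩)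
    exact (simplexFun_pos_of_mem_window s hx).ne'
  · exact ae_restrict_of_forall_mem (measurableSet_window 2) fun x hx =>
      (simplexFun_pos_of_mem_window s hx).le

/-- **Restricted evaluation of the pair** over the window family: `−∫_W (σ₁σ₂(3−σ₁−σ₂))^{s−1}`. [folklore] -/
theorem restrictedEval_window_pair {s : ℚ} (r r' : IntegralRep 2) (hr : r.domain = box)
    (hr' : r'.domain = triangle) (hri' : EqOn r'.integrand (simplexFun s) r'.domain) :
    restrictedEval window (of r - of r') = -∫ x in window 2, simplexFun s x := by
  simp only [map_sub, restrictedEval_of]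
  rw [hr, box_inter_window, setIntegral_empty, zero_sub, hr',
    inter_eq_right.mpr window_subset_triangle]
  congr 1
  refine setIntegral_congr_fun (measurableSet_window 2) fun x hx => hri' ?_
  rw [hr']
  exact window_subset_triangle hx

/-- **Additivity alone never suffices** (refuted strengthening `MultiplicationThreeByAdditivity`):
for every rational `s > 0` and ALL representations satisfying the pinning hypotheses of the crux,
`[r] − [r']` is NOT in the subgroup generated by the additivity moves (1a)+(1b). Witness: the
restricted evaluation over `W = (1,2) × (1/4,1/2)` (`KZ.closure_add_le_ker_restrictedEval`).
Hence any proof of the crux uses rule (2) or rule (3). [cite: KontsevichZagier2001, §1.2] -/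
theorem not_mem_closure_additivity {s : ℚ} (hs : 0 < s) (r r' : IntegralRep 2)
    (hr : r.domain = box) (hr' : r'.domain = triangle)
    (hri' : EqOn r'.integrand (simplexFun s) r'.domain) :
    of r - of r' ∉ AddSubgroup.closure (domainAddRel ∪ integrandAddRel) := by
  intro h
  have hk := closure_add_le_ker_restrictedEval window measurableSet_window h
  rw [AddMonoidHom.mem_ker, restrictedEval_window_pair r r' hr hr' hri'] at hk
  linarith [integral_window_simplexFun_pos hs]

/-- The strengthening "the pair is a pure dissection/re-summation identity". -/
def MultiplicationThreeByAdditivity : Prop :=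
  ∀ s : ℚ, 0 < s → ∀ (r r' : IntegralRep 2), r.domain = box →
    EqOn r.integrand (boxFun s) r.domain → r'.domain = triangle →
    EqOn r'.integrand (simplexFun s) r'.domain →
    of r - of r' ∈ AddSubgroup.closure (domainAddRel ∪ integrandAddRel)

/-- `MultiplicationThreeByAdditivity` is false (instance `s = 1`, pinned representations). [folklore] -/
theorem not_multiplicationThreeByAdditivity : ¬ MultiplicationThreeByAdditivity := fun h =>
  not_mem_closure_additivity one_pos (boxRep 1 one_pos) (simplexRep 1 one_pos) rfl rfl
    (fun _ _ => rfl) (h 1 one_pos _ _ rfl (fun _ _ => rfl) rfl (fun _ _ => rfl))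


/-! ## §3 Load-bearing analysis of the hypotheses

The crux has five hypotheses: `hs : 0 < s` and the four pinning clauses `hr`, `hri`, `hr'`, `hri'`.
The four pinning clauses are each load-bearing (dropping any one is refuted by EVALUATION, below);
`hs` is NOT load-bearing: for `s ≤ 0` no absolutely convergent representation satisfies `hr ∧ hri`
(§3b), so the guard only discards vacuous instances. -/

/-- A representation with empty domain (value `0`), integrand arbitrary. [folklore] -/
def emptyRep (f : (Fin 2 → ℝ) → ℝ) : IntegralRep 2 where
  domain := ∅
  integrand := f
  isSemialgebraic_domain := Literature.ModelTheory.ExponentialFields.isSemialgebraic_empty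
  isSemialgebraicFunOn_integrand :=
    (isSemialgebraicFunOn_aeval Literature.ModelTheory.ExponentialFields.isSemialgebraic_empty
      (0 : MvPolynomial (Fin 2) ℚ)).congr fun _ hx => hx.elim
  integrableOn := integrableOn_empty

/-- The empty representation has value `0`. [folklore] -/
theorem emptyRep_value (f : (Fin 2 → ℝ) → ℝ) : (emptyRep f).value = 0 := by
  simp [IntegralRep.value, emptyRep]

/-- The zero representation on a `ℚ`-semialgebraic set (value `0`). [folklore] -/
def zeroRep (σ : Set (Fin 2 → ℝ)) (hσ : IsSemialgebraic ℚ σ) : IntegralRep 2 where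
  domain := σ
  integrand := 0
  isSemialgebraic_domain := hσ
  isSemialgebraicFunOn_integrand := (isSemialgebraicFunOn_aeval hσ 0).congr fun x _ => by simp
  integrableOn := integrableOn_zero

/-- The zero representation has value `0`. [folklore] -/
theorem zeroRep_value (σ : Set (Fin 2 → ℝ)) (hσ : IsSemialgebraic ℚ σ) : (zeroRep σ hσ).value = 0 := by
  simp [IntegralRep.value, zeroRep]

/-- The unit box has volume `1`. [folklore] -/
theorem volume_box : volume box = 1 := by
  rw [box_eq_pi, Real.volume_pi_Ioo]
  simp

/-- The box integrand is positive on the box. [folklore] -/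
theorem boxFun_pos (s : ℚ) {x : Fin 2 → ℝ} (hx : x ∈ box) : 0 < boxFun s x := by
  have h0 := hx 0
  have h1 := hx 1
  unfold boxFun
  exact mul_pos (mul_pos (mul_pos (Real.rpow_pos_of_pos h0.1 _)
    (Real.rpow_pos_of_pos (sub_pos.2 h0.2) _)) (Real.rpow_pos_of_pos h1.1 _))
    (Real.rpow_pos_of_pos (sub_pos.2 h1.2) _)

/-- **The box side has positive value.** [folklore] -/
theorem boxRep_value_pos {s : ℚ} (hs : 0 < s) : 0 < (boxRep s hs).value := by
  show 0 < ∫ x in box, boxFun s x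
  rw [setIntegral_pos_iff_support_of_nonneg_ae ?_ (integrableOn_boxFun hs)]
  · have : box ⊆ Function.support (boxFun s) ∩ box := fun x hx => ⟨(boxFun_pos s hx).ne', hx⟩
    refine lt_of_lt_of_le ?_ (measure_mono this)
    rw [volume_box]; exact one_pos
  · exact ae_restrict_of_forall_mem measurableSet_box fun x hx => (boxFun_pos s hx).le

/-- The simplex integrand is positive on the triangle. [folklore] -/
theorem simplexFun_pos (s : ℚ) {x : Fin 2 → ℝ} (hx : x ∈ triangle) : 0 < simplexFun s x := by
  obtain ⟨h0, h1, h2⟩ := hx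
  exact Real.rpow_pos_of_pos (mul_pos (mul_pos h0 h1) (by linarith)) _

/-- **The simplex side has positive value.** [folklore] -/
theorem simplexRep_value_pos {s : ℚ} (hs : 0 < s) : 0 < (simplexRep s hs).value := by
  show 0 < ∫ x in triangle, simplexFun s x
  rw [setIntegral_pos_iff_support_of_nonneg_ae ?_ (integrableOn_simplexFun hs)]
  · have : window 2 ⊆ Function.support (simplexFun s) ∩ triangle := fun x hx =>
      ⟨(simplexFun_pos s (window_subset_triangle hx)).ne', window_subset_triangle hx⟩
    exact volume_window_pos.trans_le (measure_mono this)
  · exact ae_restrict_of_forall_mem measurableSet_triangle fun x hx => (simplexFun_pos s hx).le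

/-! ### §3a The four pinning hypotheses are load-bearing -/

/-- The crux with `hr : r.domain = box` dropped. -/
def MultiplicationThreeWithout_hr : Prop :=
  ∀ s : ℚ, 0 < s → ∀ (r r' : IntegralRep 2),
    EqOn r.integrand (boxFun s) r.domain → r'.domain = triangle →
    EqOn r'.integrand (simplexFun s) r'.domain → Equivalent r r'

/-- The crux with `hri : EqOn r.integrand (boxFun s) r.domain` dropped. -/
def MultiplicationThreeWithout_hri : Prop :=
  ∀ s : ℚ, 0 < s → ∀ (r r' : IntegralRep 2), r.domain = box → r'.domain = triangle →
    EqOn r'.integrand (simplexFun s) r'.domain → Equivalent r r'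

/-- The crux with `hr' : r'.domain = triangle` dropped. -/
def MultiplicationThreeWithout_hr' : Prop :=
  ∀ s : ℚ, 0 < s → ∀ (r r' : IntegralRep 2), r.domain = box →
    EqOn r.integrand (boxFun s) r.domain →
    EqOn r'.integrand (simplexFun s) r'.domain → Equivalent r r'

/-- The crux with `hri' : EqOn r'.integrand (simplexFun s) r'.domain` dropped. -/
def MultiplicationThreeWithout_hri' : Prop :=
  ∀ s : ℚ, 0 < s → ∀ (r r' : IntegralRep 2), r.domain = box →
    EqOn r.integrand (boxFun s) r.domain → r'.domain = triangle → Equivalent r r'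

/-- Dropping `hr` is refuted by evaluation: `r = [∅, boxFun 1]` (value 0) against the simplex side
(value `> 0`). [folklore] -/
theorem multiplicationThree_false_without_hr : ¬ MultiplicationThreeWithout_hr := by
  intro h
  have he := h 1 one_pos (emptyRep (boxFun 1)) (simplexRep 1 one_pos) (fun _ _ => rfl) rfl
    (fun _ _ => rfl)
  have hv := Equivalent.value_eq_holds he
  rw [emptyRep_value] at hv
  linarith [simplexRep_value_pos (s := 1) one_pos]

/-- Dropping `hri` is refuted by evaluation: `r = [box, 0]` against the simplex side. [folklore] -/
theorem multiplicationThree_false_without_hri : ¬ MultiplicationThreeWithout_hri := by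
  intro h
  have he := h 1 one_pos (zeroRep box isSemialgebraic_box) (simplexRep 1 one_pos) rfl rfl
    (fun _ _ => rfl)
  have hv := Equivalent.value_eq_holds he
  rw [zeroRep_value] at hv
  linarith [simplexRep_value_pos (s := 1) one_pos]

/-- Dropping `hr'` is refuted by evaluation: the box side against `r' = [∅, simplexFun 1]`. [folklore] -/
theorem multiplicationThree_false_without_hr' : ¬ MultiplicationThreeWithout_hr' := by
  intro h
  have he := h 1 one_pos (boxRep 1 one_pos) (emptyRep (simplexFun 1)) rfl (fun _ _ => rfl)
    (fun _ _ => rfl)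
  have hv := Equivalent.value_eq_holds he
  rw [emptyRep_value] at hv
  linarith [boxRep_value_pos (s := 1) one_pos]

/-- Dropping `hri'` is refuted by evaluation: the box side against `r' = [triangle, 0]`. [folklore] -/
theorem multiplicationThree_false_without_hri' : ¬ MultiplicationThreeWithout_hri' := by
  intro h
  have he := h 1 one_pos (boxRep 1 one_pos) (zeroRep triangle isSemialgebraic_triangle) rfl
    (fun _ _ => rfl) rfl
  have hv := Equivalent.value_eq_holds he
  rw [zeroRep_value] at hv
  linarith [boxRep_value_pos (s := 1) one_pos]


/-! ### §3b The guard `0 < s` is not load-bearing: for `s ≤ 0` the box side does not exist -/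

/-- For `s ≤ 0` the Beta factor `t^{-1/3}(1-t)^{s-1}` is NOT integrable on `(0,1)`: on `(1/2,1)`
it dominates `(1-t)^{s-1}`, whose reflection `u^{s-1}` is integrable at `0⁺` iff `s > 0`
(`intervalIntegral.integrableOn_Ioo_rpow_iff`). [folklore] -/
theorem not_integrableOn_boxFactor_one {s : ℚ} (hs : s ≤ 0) :
    ¬ IntegrableOn (boxFactor s 1) (Ioo (0:ℝ) 1) := by
  intro h
  have hsR : (s:ℝ) ≤ 0 := by exact_mod_cast hs
  -- Step 1: `(1-t)^(s-1)` is integrable on `(1/2, 1)`.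
  have h1 : IntegrableOn (fun t : ℝ => (1 - t) ^ ((s:ℝ) - 1)) (Ioo (1/2 : ℝ) 1) := by
    have hm : AEStronglyMeasurable (fun t : ℝ => (1 - t) ^ ((s:ℝ) - 1))
        (volume.restrict (Ioo (1/2 : ℝ) 1)) :=
      (ContinuousOn.rpow_const (by fun_prop) (fun t ht => Or.inl (by
        have : t < 1 := ht.2; exact (sub_pos.2 this).ne'))).aestronglyMeasurable measurableSet_Ioo
    refine (h.mono_set (Ioo_subset_Ioo (by norm_num) le_rfl)).mono' hm ?_
    filter_upwards [ae_restrict_mem measurableSet_Ioo] with t ht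
    have ht0 : 0 < t := by linarith [ht.1]
    have ht1 : 0 < 1 - t := sub_pos.2 ht.2
    have hk : 0 ≤ (1 - t) ^ ((s:ℝ) - 1) := (Real.rpow_pos_of_pos ht1 _).le
    rw [Real.norm_eq_abs, abs_of_nonneg hk]
    have hge : 1 ≤ t ^ (-(1:ℝ)/3) :=
      Real.one_le_rpow_of_pos_of_le_one_of_nonpos ht0 ht.2.le (by norm_num)
    simp only [boxFactor, Matrix.cons_val_one, Matrix.cons_val_zero]
    nlinarith
  -- Step 2: reflect `t ↦ 1 - t`: `u^(s-1)` is integrable on `(0, 1/2)`.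
  have h2 : IntegrableOn (fun u : ℝ => u ^ ((s:ℝ) - 1)) (Ioo (0:ℝ) (1/2)) := by
    have hI : IntervalIntegrable (fun t : ℝ => (1 - t) ^ ((s:ℝ) - 1)) volume (1/2) 1 :=
      (intervalIntegrable_iff_integrableOn_Ioo_of_le (by norm_num)).2 h1
    have hI' := hI.comp_sub_left 1
    have e : (fun x : ℝ => (1 - (1 - x)) ^ ((s:ℝ) - 1)) = fun u => u ^ ((s:ℝ) - 1) := by
      funext x; ring_nf
    rw [e, show (1:ℝ) - 1/2 = 1/2 by norm_num, sub_self] at hI'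
    exact (intervalIntegrable_iff_integrableOn_Ioo_of_le (by norm_num)).1 hI'.symm
  -- Step 3: contradiction with the integrability criterion at `0⁺`.
  have := (intervalIntegral.integrableOn_Ioo_rpow_iff (by norm_num : (0:ℝ) < 1/2)).1 h2
  linarith

/-- If the box integrand is integrable on the box then its second factor is integrable on `(0,1)`
(Tonelli through `Fin 2 → ℝ ≃ ℝ × ℝ`; the first factor is positive). [folklore] -/
theorem integrableOn_boxFactor_one_of_boxFun {s : ℚ} (h : IntegrableOn (boxFun s) box) :
    IntegrableOn (boxFactor s 1) (Ioo (0:ℝ) 1) := by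
  rw [IntegrableOn, volume_restrict_box] at h
  set ρ : Measure ℝ := (volume : Measure ℝ).restrict (Ioo (0:ℝ) 1) with hρ
  have hmp : MeasurePreserving (MeasurableEquiv.finTwoArrow (α := ℝ)).symm (ρ.prod ρ)
      (Measure.pi fun _ : Fin 2 => ρ) := (measurePreserving_finTwoArrow ρ).symm _
  have h' : Integrable (fun p : ℝ × ℝ => boxFactor s 0 p.1 * boxFactor s 1 p.2) (ρ.prod ρ) := by
    have := (hmp.integrable_comp_emb (MeasurableEquiv.measurableEmbedding _)).2 h
    refine this.congr (ae_of_all _ fun p => ?_)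
    simp [boxFun_eq_prod, Fin.prod_univ_two]
  have hae := h'.prod_right_ae
  have hρ0 : ρ ≠ 0 := by
    intro h0
    have : ρ univ = 0 := by rw [h0]; rfl
    rw [hρ, Measure.restrict_apply MeasurableSet.univ, univ_inter, Real.volume_Ioo] at this
    norm_num at this
  haveI : (ae ρ).NeBot := ae_neBot.2 hρ0
  obtain ⟨a, ha, hamem⟩ := (hae.and (ae_restrict_mem measurableSet_Ioo)).exists
  have hbox : (![a, a] : Fin 2 → ℝ) ∈ box := Fin.forall_fin_two.mpr ⟨hamem, hamem⟩
  have hpos : 0 < boxFactor s 0 a := by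
    simp only [boxFactor, Matrix.cons_val_zero]
    exact mul_pos (Real.rpow_pos_of_pos hamem.1 _) (Real.rpow_pos_of_pos (sub_pos.2 hamem.2) _)
  have := ha.const_mul (boxFactor s 0 a)⁻¹
  refine this.congr (ae_of_all _ fun t => ?_)
  simp only
  rw [← mul_assoc, inv_mul_cancel₀ hpos.ne', one_mul]

/-- **For `s ≤ 0` no representation satisfies the box pinning** `hr ∧ hri`: the integrand is not
absolutely integrable, but `integrableOn` is a field of `KZ.IntegralRep`. [folklore] -/
theorem no_boxRep_of_nonpos {s : ℚ} (hs : s ≤ 0) (r : IntegralRep 2) (hr : r.domain = box)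
    (hri : EqOn r.integrand (boxFun s) r.domain) : False := by
  have h : IntegrableOn (boxFun s) box := by
    have := r.integrableOn
    rw [hr] at this hri
    exact this.congr_fun hri measurableSet_box
  exact not_integrableOn_boxFactor_one hs (integrableOn_boxFactor_one_of_boxFun h)

/-- The crux with the guard `0 < s` dropped. -/
def MultiplicationThreeWithout_pos : Prop :=
  ∀ s : ℚ, ∀ (r r' : IntegralRep 2), r.domain = box →
    EqOn r.integrand (boxFun s) r.domain → r'.domain = triangle →
    EqOn r'.integrand (simplexFun s) r'.domain → Equivalent r r'

/-- **`0 < s` is not load-bearing**: the guard-free statement is EQUIVALENT to the crux, because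
its extra instances (`s ≤ 0`) are vacuous (`no_boxRep_of_nonpos`). A proof of the crux may use
`0 < s` only to know that the data exist. [folklore] -/
theorem multiplicationThreeWithout_pos_iff : MultiplicationThreeWithout_pos ↔ MultiplicationThree := by
  constructor
  · exact fun h s _ r r' hr hri hr' hri' => h s r r' hr hri hr' hri'
  · intro h s r r' hr hri hr' hri'
    rcases lt_or_ge 0 s with hs | hs
    · exact h s hs r r' hr hri hr' hri'
    · exact (no_boxRep_of_nonpos hs r hr hri).elim


/-! ## §5 Reformulation: one change of variables turns the crux into a relation between two
box-Mellin members of dimension 2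

The chart `Φ` is itself ONE rule-(2) move: `[triangle, (σ₁σ₂(3−σ₁−σ₂))^{s−1}] ~ [box, 9·(27uv(1−v))^{s−1}(1−u)^{2s−1}]`
(`pullbackRep`), a box-Mellin member with RATIONAL constant `κ = 9`, family `(27·X₀X₁(1−X₁), 1−X₀)`
and exponents `(s−1, 2s−1)`. So the crux is EQUIVALENT to a relation between two members of the
dimension-2 Mellin box family on the SAME box (`multiplicationThree_iff_boxToBox`):
`[box, u^{-2/3}(1-u)^{s-1}v^{-1/3}(1-v)^{s-1}] ~ [box, 9(27uv(1-v))^{s-1}(1-u)^{2s-1}]`, i.e.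
`B(1/3,s)B(2/3,s) = 9·27^{s-1}B(s,2s)B(s,s)` as box representations — the form in which
MellinCoarea-type (fibre/coset) arguments and the route's Beta bookkeeping apply directly. -/

/-- The pulled-back integrand `9·(27uv(1−v))^{s−1}(1−u)^{2s−1}` on the box. [folklore] -/
def pullbackFun (s : ℚ) : (Fin 2 → ℝ) → ℝ := fun x =>
  9 * (27 * x 0 * x 1 * (1 - x 1)) ^ ((s:ℝ) - 1) * (1 - x 0) ^ (2 * (s:ℝ) - 1)

/-- The Mellin family of the pulled-back integrand. [folklore] -/
def pullbackPolys : Fin 2 → MvPolynomial (Fin 2) ℚ := ![27 * X 0 * X 1 * (1 - X 1), 1 - X 0]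

/-- The Mellin exponents of the pulled-back integrand. [folklore] -/
def pullbackExps (s : ℚ) : Fin 2 → ℚ := ![s - 1, 2 * s - 1]

/-- On the box the pulled-back integrand is the Euler–Mellin integrand of
`(pullbackPolys, pullbackExps s, 9)` — constant `κ = 9 ∈ ℚ`. [folklore] -/
theorem pullbackFun_eq_mellinIntegrand (s : ℚ) {x : Fin 2 → ℝ} :
    pullbackFun s x = mellinIntegrand pullbackPolys (pullbackExps s) 9 x := by
  have h27 : aeval x (27 : MvPolynomial (Fin 2) ℚ) = (27 : ℝ) := by
    rw [show (27 : MvPolynomial (Fin 2) ℚ) = C 27 by simp [map_ofNat], MvPolynomial.aeval_C]; simp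
  simp only [pullbackFun, mellinIntegrand, Fin.prod_univ_two, pullbackPolys, pullbackExps,
    Matrix.cons_val_zero, Matrix.cons_val_one, map_sub, map_one, map_mul, MvPolynomial.aeval_X,
    h27, Rat.cast_sub, Rat.cast_mul, Rat.cast_one, Rat.cast_ofNat]
  ring

/-- The pulled-back integrand is `ℚ`-semialgebraic on the box. [folklore] -/
theorem isSemialgebraicFunOn_pullbackFun (s : ℚ) : IsSemialgebraicFunOn ℚ box (pullbackFun s) := by
  refine (isSemialgebraicFunOn_mellinIntegrand isSemialgebraic_box pullbackPolys (pullbackExps s) 9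
    ?_).congr fun x _ => (pullbackFun_eq_mellinIntegrand s).symm
  intro x hx k
  have h0 := hx 0
  have h1 := hx 1
  have h27 : aeval x (27 : MvPolynomial (Fin 2) ℚ) = (27 : ℝ) := by
    rw [show (27 : MvPolynomial (Fin 2) ℚ) = C 27 by simp [map_ofNat], MvPolynomial.aeval_C]; simp
  fin_cases k
  · simp only [pullbackPolys, Fin.zero_eta, Matrix.cons_val_zero, map_mul, map_sub, map_one,
      MvPolynomial.aeval_X, h27]
    exact mul_pos (mul_pos (mul_pos (by norm_num) h0.1) h1.1) (sub_pos.2 h1.2)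
  · simp only [pullbackPolys, Fin.mk_one, Matrix.cons_val_one, Matrix.cons_val_zero, map_sub,
      map_one, MvPolynomial.aeval_X]
    exact sub_pos.2 h0.2

/-- On the box, the pulled-back integrand is `9·27^{s−1}·u^{s−1}(1−u)^{2s−1}·v^{s−1}(1−v)^{s−1}`. [folklore] -/
theorem pullbackFun_eq_prod {s : ℚ} {x : Fin 2 → ℝ} (hx : x ∈ box) :
    pullbackFun s x = pullConst s * ∏ i, pullFactor s i (x i) := by
  have hu0 : 0 < x 0 := (hx 0).1
  have hv0 : 0 < x 1 := (hx 1).1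
  have hv1 : 0 < 1 - x 1 := sub_pos.2 (hx 1).2
  simp only [pullbackFun, pullConst, pullFactor, Fin.prod_univ_two, Matrix.cons_val_zero,
    Matrix.cons_val_one]
  rw [Real.mul_rpow (by positivity) hv1.le, Real.mul_rpow (by positivity) hv0.le,
    Real.mul_rpow (by norm_num) hu0.le]
  ring

/-- On the box, the pulled-back integrand is `(simplexFun s ∘ Φ) · |det DΦ|`. [folklore] -/
theorem pullbackFun_eq_jacobian {s : ℚ} {x : Fin 2 → ℝ} (hx : x ∈ box) :
    pullbackFun s x = simplexFun s (Φ x) * |(Φ' x).det| := by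
  rw [pullbackFun_eq_prod hx, ← pullback_eq hx, mul_comm]

/-- The pulled-back integrand is integrable on the box. [folklore] -/
theorem integrableOn_pullbackFun {s : ℚ} (hs : 0 < s) : IntegrableOn (pullbackFun s) box :=
  (integrableOn_pullback hs).congr_fun (fun _ hx => (pullbackFun_eq_prod hx).symm) measurableSet_box

/-- **The pulled-back box representation** `[box, 9·(27uv(1−v))^{s−1}(1−u)^{2s−1}]`. [folklore] -/
def pullbackRep (s : ℚ) (hs : 0 < s) : IntegralRep 2 where
  domain := box
  integrand := pullbackFun s
  isSemialgebraic_domain := isSemialgebraic_box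
  isSemialgebraicFunOn_integrand := isSemialgebraicFunOn_pullbackFun s
  integrableOn := integrableOn_pullbackFun hs

/-- The substitution polynomials of the chart `Φ`. [folklore] -/
def chartSubst : Fin 2 → MvPolynomial (Fin 2) ℚ := ![3 * X 0, 3 * (1 - X 0) * X 1]

/-- Evaluating the substitution is the chart. [folklore] -/
theorem aeval_chartSubst (x : Fin 2 → ℝ) : (fun i => aeval x (chartSubst i)) = Φ x := by
  have h3 : aeval x (3 : MvPolynomial (Fin 2) ℚ) = (3 : ℝ) := by
    rw [show (3 : MvPolynomial (Fin 2) ℚ) = C 3 by simp [map_ofNat], MvPolynomial.aeval_C]; simp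
  funext i
  fin_cases i
  · simp [chartSubst, h3]
  · simp [chartSubst, h3]

/-- The chart is a `ℚ`-semialgebraic map on the box (a polynomial map). [folklore] -/
theorem isSemialgebraicMapOn_Φ : IsSemialgebraicMapOn ℚ box Φ := by
  convert isSemialgebraicMapOn_aeval isSemialgebraic_box chartSubst using 2 with z
  exact (aeval_chartSubst z).symm

/-- **The chart is ONE rule-(2) move**: `[pullbackRep] − [simplexRep] ∈ changeOfVariablesRel`. [cite: KontsevichZagier2001, §1.2 rule (2)] -/
theorem pullbackRep_sub_simplexRep_mem_changeOfVariablesRel {s : ℚ} (hs : 0 < s) :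
    of (pullbackRep s hs) - of (simplexRep s hs) ∈ changeOfVariablesRel :=
  ⟨2, pullbackRep s hs, simplexRep s hs, Φ, Φ', isSemialgebraicMapOn_Φ,
    fun x _ => (hasFDerivAt_Φ x).hasFDerivWithinAt, injOn_Φ, image_Φ_box.symm,
    fun _ hx => pullbackFun_eq_jacobian hx, rfl⟩

/-- The pulled-back box representation is equivalent to the simplex representation. [folklore] -/
theorem pullbackRep_equivalent_simplexRep {s : ℚ} (hs : 0 < s) :
    Equivalent (pullbackRep s hs) (simplexRep s hs) :=
  changeOfVariablesRel_subset_relations (pullbackRep_sub_simplexRep_mem_changeOfVariablesRel hs)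

/-- **Box-to-box form of the crux**: `MultiplicationThree` ⇔ for every rational `s > 0`,
`[box, u^{-2/3}(1-u)^{s-1}v^{-1/3}(1-v)^{s-1}] ~ [box, 9·(27uv(1−v))^{s−1}(1−u)^{2s−1}]` — two
box-Mellin members of dimension 2 on the same box (`B(1/3,s)B(2/3,s) = 9·27^{s-1}B(s,2s)B(s,s)`).
[folklore] -/
theorem multiplicationThree_iff_boxToBox :
    MultiplicationThree ↔ ∀ (s : ℚ) (hs : 0 < s), Equivalent (boxRep s hs) (pullbackRep s hs) := by
  rw [multiplicationThree_iff_pinned]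
  refine forall_congr' fun s => forall_congr' fun hs => ?_
  exact ⟨fun h => h.trans (pullbackRep_equivalent_simplexRep hs).symm,
    fun h => h.trans (pullbackRep_equivalent_simplexRep hs)⟩

/-- The pulled-back representation is a presented box-Mellin member with rational constant `9`
(vocabulary of `KZMellinFibres`; its Mellin box is the whole box). [folklore] -/
theorem isMellinMemberWith_pullbackRep {s : ℚ} (hs : 0 < s) :
    IsMellinMemberWith pullbackPolys (pullbackExps s) 9 (pullbackRep s hs) := by
  refine ⟨?_, fun x _ => pullbackFun_eq_mellinIntegrand s⟩
  ext x
  simp only [mem_mellinBox]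
  constructor
  · intro hx
    refine ⟨hx, fun k => ?_⟩
    have h0 := hx 0
    have h1 := hx 1
    have h27 : aeval x (27 : MvPolynomial (Fin 2) ℚ) = (27 : ℝ) := by
      rw [show (27 : MvPolynomial (Fin 2) ℚ) = C 27 by simp [map_ofNat], MvPolynomial.aeval_C]; simp
    fin_cases k
    · simp only [pullbackPolys, Fin.zero_eta, Matrix.cons_val_zero, map_mul, map_sub, map_one,
        MvPolynomial.aeval_X, h27]
      exact mul_pos (mul_pos (mul_pos (by norm_num) h0.1) h1.1) (sub_pos.2 h1.2)
    · simp only [pullbackPolys, Fin.mk_one, Matrix.cons_val_one, Matrix.cons_val_zero, map_sub,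
        map_one, MvPolynomial.aeval_X]
      exact sub_pos.2 h0.2
  · exact fun h => h.1

/-- The box representation is a presented box-Mellin member with constant `1`. [folklore] -/
theorem isMellinMemberWith_boxRep {s : ℚ} (hs : 0 < s) :
    IsMellinMemberWith boxPolys (boxExps s) 1 (boxRep s hs) := by
  refine ⟨?_, fun x _ => boxFun_eq_mellinIntegrand s⟩
  ext x
  simp only [mem_mellinBox]
  constructor
  · intro hx
    refine ⟨hx, fun k => ?_⟩
    have h0 := hx 0
    have h1 := hx 1
    fin_cases k <;> simp [boxPolys, h0.1, h1.1, h0.2, h1.2]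
  · exact fun h => h.1

/-! ## §6 Calibration: the instance `s = 1` is TWO rule-(2) moves

At `s = 1` the pair is `[box, u^{-2/3}v^{-1/3}] ~ [triangle, 1]` (both of value `9/2`). The Kummer
map `K(u,v) = (u^{1/3}, v^{2/3})` (Jacobian `(2/9)u^{-2/3}v^{-1/3}`) gives `[box, u^{-2/3}v^{-1/3}] ~
[box, 9/2]`, and the shear `M(u,v) = (3(1-√(1-u)), 3√(1-u)·v)` (CONSTANT Jacobian `9/2`, a
semialgebraic bijection box → triangle) gives `[box, 9/2] ~ [triangle, 1]`. Consequence for any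
would-be kill: a separating additive invariant of `KZ.relations` must vanish on the pair at `s = 1`
(and, by the same device plus Newton–Leibniz with polynomial primitives, at every `s ∈ ℕ`), i.e. it
must be genuinely `s`-dependent. -/

/-- The constant representation `[box, q]`, `q ∈ ℚ`. [folklore] -/
def constRep (q : ℚ) : IntegralRep 2 where
  domain := box
  integrand := fun _ => (q : ℝ)
  isSemialgebraic_domain := isSemialgebraic_box
  isSemialgebraicFunOn_integrand :=
    (isSemialgebraicFunOn_aeval isSemialgebraic_box (C q : MvPolynomial (Fin 2) ℚ)).congr
      fun x _ => by simp
  integrableOn := integrableOn_const (by rw [box_eq_pi, Real.volume_pi_Ioo]; simp)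

/-! ### The Kummer map `K(u,v) = (u^{1/3}, v^{2/3})` -/

/-- The Kummer map. [folklore] -/
def K (x : Fin 2 → ℝ) : Fin 2 → ℝ := ![x 0 ^ ((1:ℝ)/3), x 1 ^ ((2:ℝ)/3)]

/-- First component. [folklore] -/
@[simp] theorem K_apply_zero (x : Fin 2 → ℝ) : K x 0 = x 0 ^ ((1:ℝ)/3) := rfl

/-- Second component. [folklore] -/
@[simp] theorem K_apply_one (x : Fin 2 → ℝ) : K x 1 = x 1 ^ ((2:ℝ)/3) := rfl

/-- The diagonal entries of `DK`. [folklore] -/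
def kDiag (x : Fin 2 → ℝ) : Fin 2 → ℝ :=
  ![(1:ℝ)/3 * x 0 ^ ((1:ℝ)/3 - 1), (2:ℝ)/3 * x 1 ^ ((2:ℝ)/3 - 1)]

/-- The derivative of the Kummer map (diagonal). [folklore] -/
def K' (x : Fin 2 → ℝ) : (Fin 2 → ℝ) →L[ℝ] (Fin 2 → ℝ) :=
  LinearMap.toContinuousLinearMap (Matrix.toLin' (Matrix.diagonal (kDiag x)))

/-- `DK` applied to a vector. [folklore] -/
theorem K'_apply (x v : Fin 2 → ℝ) (i : Fin 2) : K' x v i = kDiag x i * v i := by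
  change Matrix.toLin' (Matrix.diagonal (kDiag x)) v i = _
  rw [Matrix.toLin'_apply, Matrix.mulVec_diagonal]

/-- `det DK = (1/3)u^{-2/3} · (2/3)v^{-1/3}`. [folklore] -/
theorem det_K' (x : Fin 2 → ℝ) :
    (K' x).det = ((1:ℝ)/3 * x 0 ^ ((1:ℝ)/3 - 1)) * ((2:ℝ)/3 * x 1 ^ ((2:ℝ)/3 - 1)) := by
  change LinearMap.det (Matrix.toLin' (Matrix.diagonal (kDiag x))) = _
  rw [LinearMap.det_toLin', Matrix.det_diagonal, Fin.prod_univ_two]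
  rfl

/-- The Kummer map is differentiable on the open box with derivative `K'`. [folklore] -/
theorem hasFDerivAt_K {x : Fin 2 → ℝ} (hx : x ∈ box) : HasFDerivAt K (K' x) x := by
  have h0 : HasFDerivAt (fun y : Fin 2 → ℝ => y 0)
      (ContinuousLinearMap.proj (R := ℝ) (φ := fun _ : Fin 2 => ℝ) 0) x := hasFDerivAt_apply 0 x
  have h1 : HasFDerivAt (fun y : Fin 2 → ℝ => y 1)
      (ContinuousLinearMap.proj (R := ℝ) (φ := fun _ : Fin 2 => ℝ) 1) x := hasFDerivAt_apply 1 x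
  have hx0 : x 0 ≠ 0 := (hx 0).1.ne'
  have hx1 : x 1 ≠ 0 := (hx 1).1.ne'
  rw [hasFDerivAt_pi']
  refine Fin.forall_fin_two.mpr ⟨?_, ?_⟩
  · have hf : (fun y : Fin 2 → ℝ => K y 0) = (fun t : ℝ => t ^ ((1:ℝ)/3)) ∘ fun y => y 0 :=
      funext fun y => rfl
    rw [hf]
    refine ((Real.hasDerivAt_rpow_const (Or.inl hx0)).hasFDerivAt.comp x h0).congr_fderiv
      (ContinuousLinearMap.ext fun v => ?_)
    simp [K'_apply, kDiag]
    ring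
  · have hf : (fun y : Fin 2 → ℝ => K y 1) = (fun t : ℝ => t ^ ((2:ℝ)/3)) ∘ fun y => y 1 :=
      funext fun y => rfl
    rw [hf]
    refine ((Real.hasDerivAt_rpow_const (Or.inl hx1)).hasFDerivAt.comp x h1).congr_fderiv
      (ContinuousLinearMap.ext fun v => ?_)
    simp [K'_apply, kDiag]
    ring

/-- The Kummer map is injective on the box. [folklore] -/
theorem injOn_K : InjOn K box := by
  intro x hx y hy hxy
  have e0 := congrFun hxy 0
  have e1 := congrFun hxy 1
  simp only [K_apply_zero, K_apply_one] at e0 e1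
  have h0 : x 0 = y 0 :=
    Real.rpow_left_injOn (by norm_num : ((1:ℝ)/3) ≠ 0) (hx 0).1.le (hy 0).1.le e0
  have h1 : x 1 = y 1 :=
    Real.rpow_left_injOn (by norm_num : ((2:ℝ)/3) ≠ 0) (hx 1).1.le (hy 1).1.le e1
  funext i
  fin_cases i
  · exact h0
  · exact h1

/-- The Kummer map sends the box ONTO the box. [folklore] -/
theorem image_K_box : K '' box = box := by
  ext y
  constructor
  · rintro ⟨x, hx, rfl⟩
    refine Fin.forall_fin_two.mpr ⟨?_, ?_⟩
    · exact ⟨Real.rpow_pos_of_pos (hx 0).1 _, Real.rpow_lt_one (hx 0).1.le (hx 0).2 (by norm_num)⟩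
    · exact ⟨Real.rpow_pos_of_pos (hx 1).1 _, Real.rpow_lt_one (hx 1).1.le (hx 1).2 (by norm_num)⟩
  · intro hy
    have hy0 := hy 0
    have hy1 := hy 1
    refine ⟨![y 0 ^ (3:ℝ), y 1 ^ ((3:ℝ)/2)], Fin.forall_fin_two.mpr ⟨?_, ?_⟩, ?_⟩
    · exact ⟨Real.rpow_pos_of_pos hy0.1 _, Real.rpow_lt_one hy0.1.le hy0.2 (by norm_num)⟩
    · exact ⟨Real.rpow_pos_of_pos hy1.1 _, Real.rpow_lt_one hy1.1.le hy1.2 (by norm_num)⟩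
    · funext i
      fin_cases i
      · show (y 0 ^ (3:ℝ)) ^ ((1:ℝ)/3) = y 0
        rw [← Real.rpow_mul hy0.1.le]; norm_num
      · show (y 1 ^ ((3:ℝ)/2)) ^ ((2:ℝ)/3) = y 1
        rw [← Real.rpow_mul hy1.1.le]; norm_num

/-- A single rational power of one coordinate is `ℚ`-semialgebraic on the box. [folklore] -/
theorem isSemialgebraicFunOn_coord_rpow (j : Fin 2) (e : ℚ) :
    IsSemialgebraicFunOn ℚ box (fun x : Fin 2 → ℝ => x j ^ ((e:ℚ):ℝ)) := by
  refine (isSemialgebraicFunOn_mellinIntegrand isSemialgebraic_box ![(X j : MvPolynomial (Fin 2) ℚ)]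
    ![e] 1 fun x hx k => ?_).congr fun x _ => ?_
  · fin_cases k
    simpa using (hx j).1
  · simp [mellinIntegrand]

/-- The Kummer map is a `ℚ`-semialgebraic map on the box. [folklore] -/
theorem isSemialgebraicMapOn_K : IsSemialgebraicMapOn ℚ box K := by
  refine IsSemialgebraicMapOn.of_forall isSemialgebraic_box (Fin.forall_fin_two.mpr ⟨?_, ?_⟩)
  · have h := isSemialgebraicFunOn_coord_rpow 0 (1/3)
    refine h.congr fun x _ => ?_
    simp only [K_apply_zero]
    norm_num
  · have h := isSemialgebraicFunOn_coord_rpow 1 (2/3)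
    refine h.congr fun x _ => ?_
    simp only [K_apply_one]
    norm_num

/-- `|det DK| · (9/2) = u^{-2/3} v^{-1/3}` on the box: the box integrand at `s = 1`. [folklore] -/
theorem boxFun_one_eq {x : Fin 2 → ℝ} (hx : x ∈ box) :
    boxFun 1 x = (constRep (9/2)).integrand (K x) * |(K' x).det| := by
  have hx0 : 0 < x 0 := (hx 0).1
  have hx1 : 0 < x 1 := (hx 1).1
  have hd : 0 < (K' x).det := by
    rw [det_K']
    exact mul_pos (mul_pos (by norm_num) (Real.rpow_pos_of_pos hx0 _))
      (mul_pos (by norm_num) (Real.rpow_pos_of_pos hx1 _))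
  rw [abs_of_pos hd, det_K']
  simp only [boxFun, constRep, Rat.cast_div, Rat.cast_ofNat, Rat.cast_one, sub_self,
    Real.rpow_zero, mul_one]
  have e1 : (1:ℝ)/3 - 1 = -(2:ℝ)/3 := by norm_num
  have e2 : (2:ℝ)/3 - 1 = -(1:ℝ)/3 := by norm_num
  rw [e1, e2]
  ring

/-- **Move 1 (Kummer)**: `[box, u^{-2/3}v^{-1/3}] − [box, 9/2] ∈ changeOfVariablesRel`. [cite: KontsevichZagier2001, §1.2 rule (2)] -/
theorem boxRep_one_sub_constRep_mem :
    of (boxRep 1 one_pos) - of (constRep (9/2)) ∈ changeOfVariablesRel :=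
  ⟨2, boxRep 1 one_pos, constRep (9/2), K, K', isSemialgebraicMapOn_K,
    fun _ hx => (hasFDerivAt_K hx).hasFDerivWithinAt, injOn_K, image_K_box.symm,
    fun _ hx => boxFun_one_eq hx, rfl⟩


/-! ### The shear `M(u,v) = (3(1-√(1-u)), 3√(1-u)·v)`: constant Jacobian `9/2`, box → triangle -/

/-- The shear. [folklore] -/
def M (x : Fin 2 → ℝ) : Fin 2 → ℝ := ![3 * (1 - Real.sqrt (1 - x 0)), 3 * Real.sqrt (1 - x 0) * x 1]

/-- First component. [folklore] -/
@[simp] theorem M_apply_zero (x : Fin 2 → ℝ) : M x 0 = 3 * (1 - Real.sqrt (1 - x 0)) := rfl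

/-- Second component. [folklore] -/
@[simp] theorem M_apply_one (x : Fin 2 → ℝ) : M x 1 = 3 * Real.sqrt (1 - x 0) * x 1 := rfl

/-- The Jacobian matrix of the shear. [folklore] -/
def mJac (x : Fin 2 → ℝ) : Matrix (Fin 2) (Fin 2) ℝ :=
  !![3 / (2 * Real.sqrt (1 - x 0)), 0; -(3 * x 1) / (2 * Real.sqrt (1 - x 0)), 3 * Real.sqrt (1 - x 0)]

/-- The derivative of the shear. [folklore] -/
def M' (x : Fin 2 → ℝ) : (Fin 2 → ℝ) →L[ℝ] (Fin 2 → ℝ) :=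
  LinearMap.toContinuousLinearMap (Matrix.toLin' (mJac x))

/-- `DM` applied to a vector, first component. [folklore] -/
@[simp] theorem M'_apply_zero (x v : Fin 2 → ℝ) : M' x v 0 = 3 / (2 * Real.sqrt (1 - x 0)) * v 0 := by
  change Matrix.toLin' (mJac x) v 0 = _
  rw [Matrix.toLin'_apply]
  simp [mJac, Matrix.mulVec, dotProduct, Fin.sum_univ_two]

/-- `DM` applied to a vector, second component. [folklore] -/
@[simp] theorem M'_apply_one (x v : Fin 2 → ℝ) :
    M' x v 1 = -(3 * x 1) / (2 * Real.sqrt (1 - x 0)) * v 0 + 3 * Real.sqrt (1 - x 0) * v 1 := by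
  change Matrix.toLin' (mJac x) v 1 = _
  rw [Matrix.toLin'_apply]
  simp [mJac, Matrix.mulVec, dotProduct, Fin.sum_univ_two]

/-- **The Jacobian of the shear is the CONSTANT `9/2`** on `{u < 1}`. [folklore] -/
theorem det_M' {x : Fin 2 → ℝ} (hx : x 0 < 1) : (M' x).det = 9/2 := by
  change LinearMap.det (Matrix.toLin' (mJac x)) = _
  rw [LinearMap.det_toLin', Matrix.det_fin_two]
  have hs : Real.sqrt (1 - x 0) ≠ 0 := Real.sqrt_ne_zero'.2 (by linarith)
  simp [mJac]
  field_simp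
  ring

/-- The shear is differentiable on `{u < 1}` with derivative `M'`. [folklore] -/
theorem hasFDerivAt_M {x : Fin 2 → ℝ} (hx : x 0 < 1) : HasFDerivAt M (M' x) x := by
  have h0 : HasFDerivAt (fun y : Fin 2 → ℝ => y 0)
      (ContinuousLinearMap.proj (R := ℝ) (φ := fun _ : Fin 2 => ℝ) 0) x := hasFDerivAt_apply 0 x
  have h1 : HasFDerivAt (fun y : Fin 2 → ℝ => y 1)
      (ContinuousLinearMap.proj (R := ℝ) (φ := fun _ : Fin 2 => ℝ) 1) x := hasFDerivAt_apply 1 x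
  have hne : 1 - x 0 ≠ 0 := by linarith
  have hg : HasFDerivAt (fun y : Fin 2 → ℝ => Real.sqrt (1 - y 0))
      ((ContinuousLinearMap.smulRight (1 : ℝ →L[ℝ] ℝ) (1 / (2 * Real.sqrt (1 - x 0)))).comp
        (-(ContinuousLinearMap.proj (R := ℝ) (φ := fun _ : Fin 2 => ℝ) 0))) x :=
    (Real.hasDerivAt_sqrt hne).hasFDerivAt.comp x (h0.const_sub 1)
  rw [hasFDerivAt_pi']
  refine Fin.forall_fin_two.mpr ⟨?_, ?_⟩
  · have hf : (fun y : Fin 2 → ℝ => M y 0) = fun y => 3 * (1 - Real.sqrt (1 - y 0)) :=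
      funext fun y => rfl
    rw [hf]
    refine ((hg.const_sub 1).const_mul (3:ℝ)).congr_fderiv (ContinuousLinearMap.ext fun v => ?_)
    simp
    ring
  · have hf : (fun y : Fin 2 → ℝ => M y 1) = fun y => 3 * Real.sqrt (1 - y 0) * y 1 :=
      funext fun y => rfl
    rw [hf]
    refine ((hg.const_mul (3:ℝ)).mul h1).congr_fderiv (ContinuousLinearMap.ext fun v => ?_)
    simp
    ring

/-- The shear is injective on the box. [folklore] -/
theorem injOn_M : InjOn M box := by
  intro x hx y hy hxy
  have e0 := congrFun hxy 0
  have e1 := congrFun hxy 1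
  simp only [M_apply_zero, M_apply_one] at e0 e1
  have hsx : 0 < Real.sqrt (1 - x 0) := Real.sqrt_pos.2 (sub_pos.2 (hx 0).2)
  have hs : Real.sqrt (1 - x 0) = Real.sqrt (1 - y 0) := by linarith
  have h0 : x 0 = y 0 := by
    have := (Real.sqrt_inj (sub_pos.2 (hx 0).2).le (sub_pos.2 (hy 0).2).le).1 hs
    linarith
  have h1 : x 1 = y 1 := by
    rw [← hs] at e1
    have hne : (3 : ℝ) * Real.sqrt (1 - x 0) ≠ 0 := by positivity
    exact mul_left_cancel₀ hne e1
  funext i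
  fin_cases i
  · exact h0
  · exact h1

/-- The shear maps the box ONTO the triangle. [folklore] -/
theorem image_M_box : M '' box = triangle := by
  ext y
  constructor
  · rintro ⟨x, hx, rfl⟩
    have hu := hx 0
    have hv := hx 1
    have hw0 : 0 < Real.sqrt (1 - x 0) := Real.sqrt_pos.2 (sub_pos.2 hu.2)
    have hw1 : Real.sqrt (1 - x 0) < 1 := by
      rw [Real.sqrt_lt' one_pos]; linarith [hu.1]
    refine ⟨?_, ?_, ?_⟩
    · simp only [M_apply_zero]; nlinarith
    · simp only [M_apply_one]; exact mul_pos (by positivity) hv.1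
    · simp only [M_apply_zero, M_apply_one]
      nlinarith [mul_pos hw0 (sub_pos.2 hv.2)]
  · rintro ⟨hy0, hy1, hy2⟩
    have ha3 : 0 < 3 - y 0 := by linarith
    set w : ℝ := (3 - y 0) / 3 with hw
    have hw0 : 0 < w := by positivity
    have hw1 : w < 1 := by rw [hw, div_lt_one (by norm_num)]; linarith
    have hsq : Real.sqrt (1 - (1 - w ^ 2)) = w := by
      rw [show (1:ℝ) - (1 - w ^ 2) = w ^ 2 by ring, Real.sqrt_sq hw0.le]
    refine ⟨![1 - w ^ 2, y 1 / (3 - y 0)], Fin.forall_fin_two.mpr ⟨?_, ?_⟩, ?_⟩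
    · change 1 - w ^ 2 ∈ Ioo (0:ℝ) 1
      constructor <;> nlinarith
    · change y 1 / (3 - y 0) ∈ Ioo (0:ℝ) 1
      exact ⟨div_pos hy1 ha3, by rw [div_lt_one ha3]; linarith⟩
    · funext i
      fin_cases i
      · change 3 * (1 - Real.sqrt (1 - (1 - w ^ 2))) = y 0
        rw [hsq, hw]; ring
      · change 3 * Real.sqrt (1 - (1 - w ^ 2)) * (y 1 / (3 - y 0)) = y 1
        rw [hsq, hw]; field_simp

/-- The first component of the shear is `ℚ`-semialgebraic on the box: its graph is
`{0 < 3 - y, (3 - y)² = 9(1 - u)}` over the box. [folklore] -/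
theorem isSemialgebraicFunOn_M_zero : IsSemialgebraicFunOn ℚ box (fun x => M x 0) := by
  rw [isSemialgebraicFunOn_iff]
  have h3 : ∀ w : Fin 3 → ℝ, aeval w (3 : MvPolynomial (Fin 3) ℚ) = (3 : ℝ) := fun w => by
    rw [show (3 : MvPolynomial (Fin 3) ℚ) = C 3 by simp [map_ofNat], MvPolynomial.aeval_C]; simp
  have h9 : ∀ w : Fin 3 → ℝ, aeval w (9 : MvPolynomial (Fin 3) ℚ) = (9 : ℝ) := fun w => by
    rw [show (9 : MvPolynomial (Fin 3) ℚ) = C 9 by simp [map_ofNat], MvPolynomial.aeval_C]; simp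
  have hset : {w : Fin (2 + 1) → ℝ | Fin.init w ∈ box ∧ w (Fin.last 2) = M (Fin.init w) 0} =
      {w : Fin (2 + 1) → ℝ | Fin.init w ∈ box} ∩
        ({w | 0 < aeval w ((3 : MvPolynomial (Fin 3) ℚ) - X (Fin.last 2))} ∩
         {w | aeval w (((3 : MvPolynomial (Fin 3) ℚ) - X (Fin.last 2)) ^ 2 -
            9 * (1 - X (Fin.castSucc 0))) = 0}) := by
    ext w
    simp only [mem_setOf_eq, mem_inter_iff, map_sub, map_pow, map_mul, map_one,
      MvPolynomial.aeval_X, h3, h9, M_apply_zero, sub_eq_zero]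
    have hi0 : Fin.init w 0 = w (Fin.castSucc 0) := rfl
    constructor
    · rintro ⟨hb, hy⟩
      have hu : w (Fin.castSucc 0) < 1 := by have := (hb 0).2; rwa [hi0] at this
      have hs0 : 0 < Real.sqrt (1 - w (Fin.castSucc 0)) := Real.sqrt_pos.2 (by linarith)
      refine ⟨hb, ?_, ?_⟩
      · rw [hy, hi0]; linarith
      · rw [hy, hi0]
        have := Real.sq_sqrt (show (0:ℝ) ≤ 1 - w (Fin.castSucc 0) by linarith)
        nlinarith [this]
    · rintro ⟨hb, hpos, heq⟩
      refine ⟨hb, ?_⟩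
      have hu : w (Fin.castSucc 0) < 1 := by have := (hb 0).2; rwa [hi0] at this
      rw [hi0]
      have hsqrt : Real.sqrt (1 - w (Fin.castSucc 0)) = (3 - w (Fin.last 2)) / 3 := by
        rw [Real.sqrt_eq_iff_eq_sq (by linarith) (by linarith)]
        nlinarith [heq]
      rw [hsqrt]; ring
  rw [hset]
  exact isSemialgebraic_box.setOf_init_mem.inter
    ((Literature.ModelTheory.ExponentialFields.isSemialgebraic_setOf_eval_pos _).inter
      (Literature.ModelTheory.ExponentialFields.isSemialgebraic_setOf_eval_eq_zero _))

/-- The second component of the shear is `ℚ`-semialgebraic on the box: its graph is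
`{0 < y, y² = 9(1 - u)v²}` over the box. [folklore] -/
theorem isSemialgebraicFunOn_M_one : IsSemialgebraicFunOn ℚ box (fun x => M x 1) := by
  rw [isSemialgebraicFunOn_iff]
  have h9 : ∀ w : Fin 3 → ℝ, aeval w (9 : MvPolynomial (Fin 3) ℚ) = (9 : ℝ) := fun w => by
    rw [show (9 : MvPolynomial (Fin 3) ℚ) = C 9 by simp [map_ofNat], MvPolynomial.aeval_C]; simp
  have hset : {w : Fin (2 + 1) → ℝ | Fin.init w ∈ box ∧ w (Fin.last 2) = M (Fin.init w) 1} =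
      {w : Fin (2 + 1) → ℝ | Fin.init w ∈ box} ∩
        ({w | 0 < aeval w (X (Fin.last 2) : MvPolynomial (Fin 3) ℚ)} ∩
         {w | aeval w ((X (Fin.last 2) : MvPolynomial (Fin 3) ℚ) ^ 2 -
            9 * (1 - X (Fin.castSucc 0)) * X (Fin.castSucc 1) ^ 2) = 0}) := by
    ext w
    simp only [mem_setOf_eq, mem_inter_iff, map_sub, map_pow, map_mul, map_one,
      MvPolynomial.aeval_X, h9, M_apply_one, sub_eq_zero]
    have hi0 : Fin.init w 0 = w (Fin.castSucc 0) := rfl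
    have hi1 : Fin.init w 1 = w (Fin.castSucc 1) := rfl
    constructor
    · rintro ⟨hb, hy⟩
      have hu : w (Fin.castSucc 0) < 1 := by have := (hb 0).2; rwa [hi0] at this
      have hv : 0 < w (Fin.castSucc 1) := by have := (hb 1).1; rwa [hi1] at this
      have hs0 : 0 < Real.sqrt (1 - w (Fin.castSucc 0)) := Real.sqrt_pos.2 (by linarith)
      refine ⟨hb, ?_, ?_⟩
      · rw [hy, hi0, hi1]; positivity
      · rw [hy, hi0, hi1]
        have := Real.sq_sqrt (show (0:ℝ) ≤ 1 - w (Fin.castSucc 0) by linarith)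
        nlinarith [this]
    · rintro ⟨hb, hpos, heq⟩
      refine ⟨hb, ?_⟩
      have hu : w (Fin.castSucc 0) < 1 := by have := (hb 0).2; rwa [hi0] at this
      have hv : 0 < w (Fin.castSucc 1) := by have := (hb 1).1; rwa [hi1] at this
      rw [hi0, hi1]
      have hs0 : 0 < Real.sqrt (1 - w (Fin.castSucc 0)) := Real.sqrt_pos.2 (by linarith)
      -- both sides positive with equal squares
      have hsq : (3 * Real.sqrt (1 - w (Fin.castSucc 0)) * w (Fin.castSucc 1)) ^ 2 =
          w (Fin.last 2) ^ 2 := by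
        rw [mul_pow, mul_pow, Real.sq_sqrt (show (0:ℝ) ≤ 1 - w (Fin.castSucc 0) by linarith)]
        linarith [heq]
      have hp : 0 < 3 * Real.sqrt (1 - w (Fin.castSucc 0)) * w (Fin.castSucc 1) := by positivity
      nlinarith [hsq, hp, hpos, sq_nonneg (3 * Real.sqrt (1 - w (Fin.castSucc 0)) * w (Fin.castSucc 1) - w (Fin.last 2)),
        sq_nonneg (3 * Real.sqrt (1 - w (Fin.castSucc 0)) * w (Fin.castSucc 1) + w (Fin.last 2))]
  rw [hset]
  exact isSemialgebraic_box.setOf_init_mem.inter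
    ((Literature.ModelTheory.ExponentialFields.isSemialgebraic_setOf_eval_pos _).inter
      (Literature.ModelTheory.ExponentialFields.isSemialgebraic_setOf_eval_eq_zero _))

/-- The shear is a `ℚ`-semialgebraic map on the box. [folklore] -/
theorem isSemialgebraicMapOn_M : IsSemialgebraicMapOn ℚ box M :=
  IsSemialgebraicMapOn.of_forall isSemialgebraic_box
    (Fin.forall_fin_two.mpr ⟨isSemialgebraicFunOn_M_zero, isSemialgebraicFunOn_M_one⟩)

/-- **Move 2 (shear)**: `[box, 9/2] − [triangle, 1] ∈ changeOfVariablesRel` (`1 = (σ₁σ₂(3−σ₁−σ₂))⁰`). [cite: KontsevichZagier2001, §1.2 rule (2)] -/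
theorem constRep_sub_simplexRep_one_mem :
    of (constRep (9/2)) - of (simplexRep 1 one_pos) ∈ changeOfVariablesRel := by
  refine ⟨2, constRep (9/2), simplexRep 1 one_pos, M, M', isSemialgebraicMapOn_M,
    fun x hx => (hasFDerivAt_M (hx 0).2).hasFDerivWithinAt, injOn_M, image_M_box.symm,
    fun x hx => ?_, rfl⟩
  show ((9/2 : ℚ) : ℝ) = simplexFun 1 (M x) * |(M' x).det|
  rw [det_M' (hx 0).2]
  simp only [simplexFun, Rat.cast_one, sub_self, Real.rpow_zero, one_mul, Rat.cast_div,
    Rat.cast_ofNat]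
  norm_num

/-- **The crux holds at `s = 1`, by two rule-(2) moves.** [folklore] -/
theorem boxRep_one_equivalent_simplexRep_one :
    Equivalent (boxRep 1 one_pos) (simplexRep 1 one_pos) := by
  have h1 : Equivalent (boxRep 1 one_pos) (constRep (9/2)) :=
    changeOfVariablesRel_subset_relations boxRep_one_sub_constRep_mem
  have h2 : Equivalent (constRep (9/2)) (simplexRep 1 one_pos) :=
    changeOfVariablesRel_subset_relations constRep_sub_simplexRep_one_mem
  exact h1.trans h2

/-- **Calibration at `s = 1`**: every pair of representations satisfying the pinning hypotheses of the
crux at `s = 1` is KZ-equivalent (two changes of variables, plus integrand additivity with zero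
representations to move between choices of integrand off the pinned values). Any separating
invariant used in a refutation must therefore vanish here. [folklore] -/
theorem multiplicationThree_at_one (r r' : IntegralRep 2) (hr : r.domain = box)
    (hri : EqOn r.integrand (boxFun 1) r.domain) (hr' : r'.domain = triangle)
    (hri' : EqOn r'.integrand (simplexFun 1) r'.domain) : Equivalent r r' := by
  have h1 : of r - of (boxRep 1 one_pos) ∈ relations :=
    of_sub_of_mem_relations_of_eqOn (by rw [hr]; rfl) hri
  have h2 : of (simplexRep 1 one_pos) - of r' ∈ relations :=
    of_sub_of_mem_relations_of_eqOn (by rw [hr']; rfl) fun x hx => (hri' (by rw [hr']; exact hx)).symm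
  have : of r - of r' = (of r - of (boxRep 1 one_pos)) +
      (of (boxRep 1 one_pos) - of (simplexRep 1 one_pos)) + (of (simplexRep 1 one_pos) - of r') := by
    abel
  show of r - of r' ∈ relations
  rw [this]
  exact relations.add_mem (relations.add_mem h1 boxRep_one_equivalent_simplexRep_one) h2

/-! ## §7 (cycle 2) The route's falsifier (2) does NOT bite: Terasoma's Betti transposition at
`n = 3` is INTEGRAL, with an explicit group-ring element `Θ₃`; what fails is only the LITERAL
single-sheet reading of the crux text

Notation (route dossier; OtsuboYamazaki2026 §7.2, Terasoma1995). `s = a/d` (`a, d ≥ 1`), affine curve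
`C° : x^d + y³ = 1`, `H = μ_d × μ_3` acting by `(i,j)·(x,y) = (ζ_d^i x, ζ_3^j y)`, the real arc
`γ = {y ∈ (0,1), x = (1−y³)^{1/d} > 0}`, cusps `F = {xy = 0} = {y = 0} ∪ {x = 0}` (`d + 3` points),
`A = F × C° ∪ C° × F ⊂ (C°)²`. Terasoma's map `q : (C°)² → T = {t^d = σ₀σ₁σ₂} → S = {Σσ_j = 3}`,
`σ_j = (1 − ζ^j y₁)(1 − ζ^j y₂) = 1 − ζ^j e₁ + ζ^{2j} e₂` (`e = (y₁+y₂, y₁y₂)`: `q` is DFT ∘ Vieta),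
`t = x₁x₂`; `deg q = 2d` (orderings × the antidiagonal `x`-phases). `Z₀ ⊂ T` = positive sheet over
the open simplex `Δ`; `η = t^a dσ₁∧dσ₂/(σ₀σ₁σ₂)` restricts on `Z₀` to the simplex integrand, and
`q^*η = (ζ−ζ²)(x₁x₂)^{a−d}(y₁−y₂)dy₁∧dy₂ = (ζ−ζ²)(ω_{a−d,1} ⊠ ω_{a−d,0} − ω_{a−d,0} ⊠ ω_{a−d,1})`,
`ω_{α,β} := x^α y^β dy` (Jacobian: `jacobian_dft_vieta` below; `c₃ = ζ − ζ² = i√3`, `c₃² = −3`).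

**Paper Theorem 7.1 (integrality; no Lean homology available — proof complete on paper).**
(i) `H₁(C°, F; ℤ)` is a FREE `ℤ[H]`-module of rank one on `[γ]`. Proof: `β = y³ : C̄ → P¹` is the
quotient by `H` (Galois, degree `3d = |H|`), with critical values `{0, 1, ∞}` only; the dessin
`β⁻¹[0,1]` is a graph with vertex set `β⁻¹{0,1} = F` and edge set `β⁻¹(0,1)` = the `3d` translates
`hγ` (H acts simply transitively on an unramified fibre), and `C̄ ∖ β⁻¹[0,1]` = `gcd(d,3)` open discs
around the points at infinity. Removing those points, `(C°, F)` deformation-retracts onto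
(graph, vertices), whose relative `H₁` is the free group on the edges. ∎
(ii) Hence `H₂((C°)², A; ℤ) = H₁(C°,F) ⊗ H₁(C°,F)` (relative Künneth, everything free) is free of
rank one over `ℤ[H²]` on `[γ × γ]`.
(iii) The TRANSFER `q^!Z̄₀ := q⁻¹(Z̄₀)` (all `2d` sheets, orientation pulled back from `Δ`) is a compact
semialgebraic relative 2-cycle of `((C°)², A)`: its boundary lies over `∂Δ`, where some `σ_j = 0`
forces `x₁ = 0` or `x₂ = 0`; `y` stays bounded over `Δ̄`, so no point at infinity is approached, for
EVERY `s > 0` (poles of `ω_{a−d,β}` at `y = ∞` for `s ≥ 1/3` are irrelevant; at `x = 0` the forms are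
regular: local parameter `x`, `dy ∼ x^{d−1}dx`, `x^{a−d}dy ∼ x^{a−1}dx`).
Therefore `[q^!Z̄₀] = Θ₃·[γ×γ] + ∂W₃ + (chains in A)` for a UNIQUE `Θ₃ ∈ ℤ[H²]` and a compact
(semialgebraic) 3-chain `W₃ ⊂ (C°)²`; the holomorphic 2-forms `ω⊠ω'` restrict to zero on `A`.
**No torsion, no `N·Z₀`, no passage through `y = ∞` — for every rational `s > 0` and, verbatim
(`β = yⁿ`, `H = μ_d × μ_n`, `(C°)^{n−1}`), for every `n`: the "why it might fail" clauses of this crux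
AND of MultiplicationAccessible (stmt-12305: "cyclicity … may hold only rationally (torsion)") are void.**

**Θ₃ explicitly.** Pairing with the `9d²` closed relative 2-forms `ω_{α,β}⊠ω_{α',β'}`
(`α < d`, `β ≤ 2`; characters `χ_{α,β}(i,j) = ζ_d^{iα}ζ_3^{j(β+1)}`, all distinct, `∫_γ ω_{α,β} =
B((β+1)/3, α/d+1)/3 ≠ 0`, so they form a dual basis of `H₂ ⊗ ℂ = ℂ[H²]`): the `x`-phase sum kills
`α ≠ α'`; for `α = α'` the ordering sum turns `1/(y₁−y₂)` into the polynomials `−1, −e₁, −e₂`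
(`(β,β') = (0,1),(0,2),(1,2)`); `∫_Δ (σ₀σ₁σ₂)^{α/d} e_k dσ = 0` (`S₃`-symmetry and `1+ζ+ζ² = 0`), and
`∫_Δ (σ₀σ₁σ₂)^{α/d} dσ = B(1/3, 1+α/d)·B(2/3, 1+α/d)` (Dirichlet + Gauss at `s' = 1 + α/d`, a theorem).
Result: `⟨q^!Z̄₀, ω_{α,0}⊠ω_{α,1}⟩ = 3d(ζ−ζ²)·∫_γω_{α,0}∫_γω_{α,1}`, its negative for `(1,0)`, zero
otherwise; inverse character transform (`(ζ−ζ²)² = −3`):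

  `Θ₃ = Σ_{i mod d} Σ_{j mod 3} ( [(i,j) | (−i, j+2)] − [(i,j) | (−i, j+1)] ) ∈ ℤ[H × H]`,

`6d` terms, coefficients `±1`: the norm element of `K = {((ζ_d^i,ζ_3^j),(ζ_d^{−i},ζ_3^j))} ≅ H`
times `(g₂² − g₂)`, `g₂ = ζ_3` on `y₂`. Checks: swap-invariance (`Θ₃(g,g') = −Θ₃(g',g)` with the
sign of `γ×γ ↦ −γ×γ`), and the value identity `∫_{q^!Z̄₀} q^*η = −6d(ζ−ζ²)²·B(1/3,s)B(2/3,s)/9 =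
2d·B(1/3,s)B(2/3,s) = deg q · I_simplex`; an independent RELATIVE-STOKES test passes exactly for all
`α`: `⟨q^!Z̄₀, ω_{α,1}⊠d(x^α y(1−y³))⟩ = 0`, i.e. `D_α = (4 + 3α/d)(D_α − E_α/3)` with
`D_α = ∫_Δ(σσσ)^{α/d}`, `E_α = ∫_Δ(σσσ)^{α/d}(σ₀σ₁+σ₀σ₂+σ₁σ₂)`, `E_α/D_α = 9(1+α/d)/(3α/d+4)`.
Numerical certificate (brute force: explicit roots, all `2d` sheets, 2-D Gauss quadrature, no use
of the simplifications above): kit job j010553 (`num/theta3_certificate.py`, d ∈ {2,3,4,5,9}); the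
in-session smoke run at `d = 2` already returns `Θ` integral to `1.5e−8`, equal to the closed form
(12 terms), pairing matrix within `1.8e−8` of the prediction, Stokes and value checks passed.

**Paper Theorem 7.2 (an UNCORRECTED single-sheet lift is never enough).** Let `Z'` be a sum of
single-sheet lifts of the pieces of a finite semialgebraic decomposition of `Δ̄` (so `q_*Z' = Z̄₀`).
Then there are NO `Θ ∈ ℤ[H²]`, 3-chain `W` and 2-chain `E` supported in a finite union of complex
curves with `Z' − Θ·γ² − E = ∂W`. Proof: the only point of `Δ̄` over which the two inverse roots
coincide is the barycentre `b = (1,1,1)` (`ramification_only_at_barycentre`), over which the fibre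
of Vieta is the double point `y₁ = y₂ = 0` (`sym_fibre_barycentre`): `q` is simply ramified over the
interior point `b`, with local monodromy a transposition `τ ∈ ⟨swap, antidiagonal μ_d⟩`. Hence the
sheet choices of `Z'` jump across a locus `J` joining `b` to `∂Δ`, and walking once around `∂Δ̄` the
net jump is conjugate to `τ`, which acts without fixed points on every fibre over `∂Δ̄` (edge fibres
have `2d` points, vertex fibres the two points `(0,ζ^{∓1},0,ζ^{±1})`, swapped). So
`∂Z' = (chains in A) + B` with `∂B = Σ ±(p_k − τ_k p_k) ≠ 0` (distinct points in distinct fibres do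
not cancel). But `∂` of the identity gives `B = ∂E_V` for the part `E_V` of `E` outside `A` (a
1-chain supported in `A ∩ (curves) =` finite set is zero), whence `∂B = 0` — contradiction. (Real
surfaces on which `(y₁−y₂)dy₁∧dy₂` restricts to zero are contained in complex curves: an isotropic
real 2-plane of `dy₁∧dy₂` is a complex line.) ∎
TWO REPAIRS, both torsion-free. (R1) The TRANSFER `q^!Z̄₀` with the integrand `η/deg q = η/(2d)`:
the factor is absorbed INSIDE rule (1b) — `[Z₀, η] = Σ_cells Σ_sheets [cell, η/(2d)] =
[q^!Z̄₀, q^*η/(2d)]` by (1a), (1b), (2) on injectivity cells — the formal lemma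
`of_sub_nsmul_of_constMul_inv_mem_relations` below (`[r] ≡ k•[r/k]`); O–Y's division by `(n−1)!` is
exactly this and costs nothing in the calculus. (R2) A CORRECTED degree-one cycle: the ramification
point `r_b = (x_b, 0, x_b⁻¹, 0)` over `b` and the end points `p, τp` of the two lifts `e', τe'` of
the jump arc all lie in `A` (`y = 0`, resp. `x_i = 0`); choose a path `ρ ⊂ A` from `r_b` to the end
of `e'` with `ρ − e'` null-homologous in `(C°)²` (possible: `H₁(A) → H₁((C°)²)` is onto) and a 2-chain
`c` with `∂c = ρ − e'`; then `Z'' := Z' + (τc − c)` satisfies `q_*Z'' = Z̄₀`, `∂Z'' ⊂ A` (`A` is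
`τ`-stable), so `[Z''] = Θ''·[γ×γ] + ∂W + (chains in A)` for an integral `Θ''` (now depending on `c`),
and at the level of representations `c` and `τc` are the SAME representation (`τ^*q^*η = q^*η`), so
the correction is free. Either way Q2 (torsion) is CLOSED for the Betti-transposition line (it remains
open only as a question about OTHER lines); (R1) is the canonical choice (`Θ₃` unique and explicit).

**What is left for a prover of the crux (unchanged by §7, now sharply delimited):** an explicit (or
abstractly existing) compact semialgebraic `W₃ ⊂ ℝ⁸` with `∂W₃ = q^!Z̄₀ − Θ₃·γ² − E`, `E ⊂ A`;
"Stokes on a semialgebraic 3-cell for the closed algebraic 2-form `q^*η/(2d)` = three Newton–Leibniz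
moves"; `(Re, Im)` splitting of the `6d` box-type terms (constants in `ℚ(ζ_{3d})`, recombined by (1b)
and `u = y³`). The idea cards sector-convex-cobordism / conifold-annulus-green / rank-one-period-
injectivity work on the quotient by `⟨swap, antidiagonal μ_d⟩` (the `e`-plane), where `Θ₃` descends to
`d·N_{μ₃}·(g₂² − g₂)`-type elements of `ℤ[μ₃²]`; rank-one's caveat "p^m·(pair) for N = p^k, needs
TorsionFree" is an artefact of locally-finite twisted homology downstairs and is NOT needed upstairs. -/

/-- **Degree absorption** (`[r] ≡ k • [r/k]` modulo the moves, `k ≥ 1`): the transfer of a chain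
through a finite map of degree `k` costs nothing in the calculus — O–Y's division by `(n−1)!`, here
`deg q = 2d`, is integrand additivity read backwards. Immediate from the tree's
`KZ.IntegralRep.of_constMul_nat_sub_nsmul_mem_relations`. [folklore] -/
theorem of_sub_nsmul_of_constMul_inv_mem_relations {n : ℕ} (r : IntegralRep n) {k : ℕ}
    (hk : k ≠ 0) :
    of r - k • of (r.constMul ((k : ℝ)⁻¹) (isAlgebraic_nat k).inv) ∈ relations := by
  set r' := r.constMul ((k : ℝ)⁻¹) (isAlgebraic_nat k).inv with hr'
  have h1 : of (r'.constMul (k : ℝ) (isAlgebraic_nat k)) - k • of r' ∈ relations :=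
    r'.of_constMul_nat_sub_nsmul_mem_relations k
  have h2 : of r - of (r'.constMul (k : ℝ) (isAlgebraic_nat k)) ∈ relations := by
    refine of_sub_of_mem_relations_of_eqOn rfl fun x _ => ?_
    have hk' : (k : ℝ) ≠ 0 := Nat.cast_ne_zero.mpr hk
    simp only [hr', IntegralRep.integrand_constMul]
    field_simp
  have : of r - k • of r' = (of r - of (r'.constMul (k : ℝ) (isAlgebraic_nat k))) +
      (of (r'.constMul (k : ℝ) (isAlgebraic_nat k)) - k • of r') := by abel
  rw [this]
  exact relations.add_mem h2 h1

/-- The crux's pinned simplex representation is `2d` times its `1/(2d)`-scaled copy modulo the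
moves (the instance of degree absorption used by the transfer `q^!Z̄₀`). [folklore] -/
theorem simplexRep_degree_absorption {s : ℚ} (hs : 0 < s) {d : ℕ} (hd : d ≠ 0) :
    of (simplexRep s hs) - (2 * d) • of ((simplexRep s hs).constMul (((2 * d : ℕ) : ℝ)⁻¹)
      (isAlgebraic_nat (2 * d)).inv) ∈ relations :=
  of_sub_nsmul_of_constMul_inv_mem_relations _ (by omega)

open MvPolynomial in
/-- **`c₃ = ζ − ζ²` (`= i√3`): the Jacobian of DFT ∘ Vieta.** For `ζ² + ζ + 1 = 0` and
`σ_j = (1 − ζ^j y₁)(1 − ζ^j y₂)`, `∂(σ₁,σ₂)/∂(y₁,y₂) = (ζ − ζ²)(y₁ − y₂)` as polynomials: the map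
ramifies exactly along the diagonal `y₁ = y₂`, and `dσ₁∧dσ₂ = (ζ−ζ²)(y₁−y₂)dy₁∧dy₂`, so
`q^*η = (ζ−ζ²)(x₁x₂)^{a−d}(y₁−y₂)dy₁∧dy₂` (route dossier; OtsuboYamazaki2026 p. 20). [folklore] -/
theorem jacobian_dft_vieta {R : Type*} [CommRing R] (ζ : R) (hζ : ζ ^ 2 + ζ + 1 = 0) :
    pderiv 0 ((1 - C ζ * X 0) * (1 - C ζ * X 1) : MvPolynomial (Fin 2) R) *
        pderiv 1 ((1 - C (ζ ^ 2) * X 0) * (1 - C (ζ ^ 2) * X 1)) -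
      pderiv 1 ((1 - C ζ * X 0) * (1 - C ζ * X 1)) *
        pderiv 0 ((1 - C (ζ ^ 2) * X 0) * (1 - C (ζ ^ 2) * X 1)) =
      C (ζ - ζ ^ 2) * (X 0 - X 1) := by
  have hζ3 : ζ ^ 3 = 1 := by linear_combination (ζ - 1) * hζ
  have h01 : (0 : Fin 2) ≠ 1 := by decide
  have h10 : (1 : Fin 2) ≠ 0 := by decide
  simp only [Derivation.leibniz, Derivation.map_one_eq_zero, map_sub, pderiv_C,
    pderiv_X_self, pderiv_X_of_ne h01, pderiv_X_of_ne h10, smul_eq_mul, mul_zero, sub_zero,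
    mul_one, zero_sub, add_zero, zero_add]
  simp only [map_pow]
  have hC3 : (C ζ : MvPolynomial (Fin 2) R) ^ 3 = 1 := by rw [← C_pow, hζ3, C_1]
  linear_combination (C ζ - C ζ ^ 2) * (X 0 - X 1 : MvPolynomial (Fin 2) R) * hC3

/-- `c₃² = −3`: the square of the Jacobian constant; this is why the inverse character transform
`(1/3)(ζ−ζ²)(ζ^δ − ζ^{−δ})` of `Θ̂₃` takes the INTEGER values `0, −1, +1` (`δ = 0, 1, 2`). [folklore] -/
theorem c3_sq {R : Type*} [CommRing R] (ζ : R) (hζ : ζ ^ 2 + ζ + 1 = 0) :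
    (ζ - ζ ^ 2) ^ 2 = -3 ∧ (ζ - ζ ^ 2) * (ζ ^ 2 - ζ) = 3 := by
  constructor
  · linear_combination (ζ ^ 2 - 3 * ζ + 3) * hζ
  · linear_combination -(ζ ^ 2 - 3 * ζ + 3) * hζ

/-- **The fibre of Vieta over the barycentre is the double point `y₁ = y₂ = 0`** (any field of
characteristic `≠ 3` with a primitive cube root `ζ`): `σ₀ = σ₁ = σ₂ = 1` iff `y₁ = y₂ = 0`. So `q`
is (simply) ramified over the INTERIOR point `b = (1,1,1)` of `Z₀`: the local monodromy is a
transposition, the source of O–Y's `(n−1)! = 2` and of Paper Theorem 7.2. (Two of the three equations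
suffice.) [folklore] -/
theorem sym_fibre_barycentre {K : Type*} [Field K] (ζ : K) (hζ : ζ ^ 2 + ζ + 1 = 0)
    (h3 : (3 : K) ≠ 0) (y₁ y₂ : K) :
    ((1 - y₁) * (1 - y₂) = 1 ∧ (1 - ζ * y₁) * (1 - ζ * y₂) = 1 ∧
      (1 - ζ ^ 2 * y₁) * (1 - ζ ^ 2 * y₂) = 1) ↔ (y₁ = 0 ∧ y₂ = 0) := by
  constructor
  · rintro ⟨h0, h1, -⟩
    have key : (ζ ^ 2 - ζ) * (y₁ + y₂) = 0 := by linear_combination h1 - ζ ^ 2 * h0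
    have hsq : (ζ ^ 2 - ζ) ^ 2 = -3 := by linear_combination (ζ ^ 2 - 3 * ζ + 3) * hζ
    have hne : ζ ^ 2 - ζ ≠ 0 := by
      intro h
      rw [h] at hsq
      exact h3 (by linear_combination hsq)
    have hsum : y₁ + y₂ = 0 := (mul_eq_zero.mp key).resolve_left hne
    have hprod : y₁ * y₂ = 0 := by linear_combination h0 + hsum
    have hy2 : y₂ = -y₁ := by linear_combination hsum
    have hy1 : y₁ ^ 2 = 0 := by rw [hy2] at hprod; linear_combination -hprod
    have : y₁ = 0 := pow_eq_zero_iff (n := 2) (by norm_num) |>.mp hy1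
    exact ⟨this, by rw [hy2, this, neg_zero]⟩
  · rintro ⟨rfl, rfl⟩
    refine ⟨by ring, by ring, by ring⟩

/-- **`b` is the only ramification point of Vieta over the CLOSED simplex.** Real points of `S` are
`e₂ = −ē₁`; writing `e₁ = u + iv`, `σ₀ = 1 − 2u`, `σ₁ = 1 + u + √3 v`, `σ₂ = 1 + u − √3 v`, and the
discriminant of `y² − e₁y + e₂` is `e₁² + 4ē₁ = (u² − v² + 4u) + i(2uv − 4v)`. On `Δ̄ = {σ_j ≥ 0}`
it vanishes only at `u = v = 0`, i.e. at `σ = (1,1,1)` (the other zeros `e₁ = −4, 4e^{±iπ/3}` have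
a negative `σ_j`; the hypothesis `σ₂ ≥ 0` is not even needed). Hence `q⁻¹(Δ̄ ∖ {b}) → Δ̄ ∖ {b}` is
unramified in the `y`-variables and the only interior monodromy of `q` over `Z₀` is the transposition
at `b`. [folklore] -/
theorem ramification_only_at_barycentre (u v : ℝ) (h₀ : 0 ≤ 1 - 2 * u)
    (h₁ : 0 ≤ 1 + u + Real.sqrt 3 * v)
    (hre : u ^ 2 - v ^ 2 + 4 * u = 0) (him : v * (2 * u - 4) = 0) : u = 0 ∧ v = 0 := by
  rcases mul_eq_zero.mp him with hv | hu
  · subst hv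
    have hu : u * (u + 4) = 0 := by linear_combination hre
    rcases mul_eq_zero.mp hu with hu | hu
    · exact ⟨hu, rfl⟩
    · exfalso
      have : u = -4 := by linear_combination hu
      rw [this] at h₁
      norm_num at h₁
  · exfalso
    have : u = 2 := by linear_combination hu / 2
    rw [this] at h₀
    norm_num at h₀


/-! ## §8 (cycle 2) Attack on the cheapest line FAILED: the bolza identities are EXACT

The idea card `bolza-involution-real-quotient` (Cruxes/MultiplicationThree/Ideas) claims the crux by
rules (1a)+(1b)+(2) ONLY, in dimension 2, uniformly in `s`: after MellinCoarea's coarea shears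
(`(v₁,v₂) ↦ (u,v) = ((1−v₁)(1−v₂), v₁)`, Jacobian `1−v₁`, box `↦ [Σ_box, u^{s−1}ψ]`,
`Σ_box = {0<u<1, 0<v<1−u}`; `(σ₁,σ₂) ↦ (c,a) = (σ₁σ₂σ₃, σ₁)` on the two cells `σ₂ ≶ σ₃`, Jacobian
`√Q(a,c)`, simplex `↦ [Σ_simp, 2u^{s−1}/√Q]`), (i) the involution `ι_u` averages `ψ` with `ψ̄`,
(ii) the chart `a = −(z−1)²/z`, `z³ = v(1−v)/(1−u−v)`, on the two cells `v ≶ 1−√u` lands on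
`[Σ_neg, 3u^{s−1}/√Q]`, `Σ_neg = {a < 0}`, because `|∂a/∂v|/√Q(a,u) = (ψ+ψ̄)/3` IDENTICALLY, and
(iii) translations by the rational 3-torsion (flexes at infinity) and 2-torsion points of `E_u`
give `3[Σ_neg,f] ~ 2[Σ_neg,f] + 2[Σ_pos,f] ~ [Σ_simp, 2f]` with integer bookkeeping only. The card's
evidence for (i)–(ii) was numerical (kit j005071, 25 points). ADVERSARIAL RESULT: (i) and (ii) are
THEOREMS (`bolza_involution_density`, `bolza_lever` below — exact `rpow` identities, the core being
the polynomial identity `((1−v)²−u(1−2v))² = ((1−v)²−u)² + 4uv(1−v)(1−u−v)`), the chart is strictly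
monotone on each cell (`D² = Q·((ψ+ψ̄)/3)² > 0`) with image `(−∞,0)` twice, and the torsion input of
(iii) is the classical level-3 structure (`hesse_pencil_flex`, `quartic_to_cubic`; ratios
`2/3 : 1 : 1/3` re-checked numerically in-session, `num/bolza_check.py`). The adversary finds NO
obstruction on this line: every map is `ℚ`-semialgebraic (real cube roots, `√Q`, roots of the
translation polynomials), injective on the stated cells, with the stated Jacobians, and every
intermediate integrand is absolutely integrable (`3u^{s−1}/a²` at `a → −∞`).

**Assessment after cycle 2 (for the lead / triage):** the crux is, in the adversary's judgement,
TRUE and PROVABLE NOW along bolza with ~12–15 move instances of rules (1a),(1b),(2) in dimension 2,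
uniformly in `s > 0` — which also disposes of the third recorded fear ("a chain uniform in `s` may
not exist", TerasomaCovering/MellinCoarea) and answers (Q1) positively. Terasoma's Betti line (§7) is
sound and integral but needs 3-chains, Stokes-as-moves and `(Re, Im)` bookkeeping; it is the right
tool for MultiplicationAccessible (all `n`), not the cheapest for `n = 3`. -/

/-- **(β) exact — algebra of the involution.** `ι_u(v) = (1−u−v)/(1−v)` satisfies
`1 − ι = u/(1−v)`, `1 − u − ι = uv/(1−v)` and `ι'(v) = −u/(1−v)²`. [folklore] -/
theorem bolza_involution_algebra (u v : ℝ) (hv : v ≠ 1) :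
    1 - (1 - u - v) / (1 - v) = u / (1 - v) ∧
      1 - u - (1 - u - v) / (1 - v) = u * v / (1 - v) ∧
      HasDerivAt (fun t : ℝ => (1 - u - t) / (1 - t)) (-u / (1 - v) ^ 2) v := by
  have hv' : (1 - v) ≠ 0 := sub_ne_zero.mpr (Ne.symm hv)
  refine ⟨?_, ?_, ?_⟩
  · field_simp; ring
  · field_simp; ring
  · have hnum : HasDerivAt (fun t : ℝ => 1 - u - t) (-1) v := by
      simpa using (hasDerivAt_id v).const_sub (1 - u)
    have hden : HasDerivAt (fun t : ℝ => 1 - t) (-1) v := by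
      simpa using (hasDerivAt_id v).const_sub 1
    refine (hnum.div hden hv').congr_deriv ?_
    ring

/-- **(β) exact — the involution swaps the two box densities**: `ψ(ι v)·|ι'(v)| = ψ̄(v)` on
`0 < u`, `0 < v < 1 − u`, where `ψ = v^{−2/3}(1−v)^{−2/3}(1−u−v)^{−1/3}` and
`ψ̄ = v^{−1/3}(1−v)^{−1/3}(1−u−v)^{−2/3}` (card bolza-involution-real-quotient, step (i): one rule-(2)
move `[Σ_box, u^{s−1}ψ] ~ [Σ_box, u^{s−1}ψ̄]`). Proof: cube both sides. [folklore] -/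
theorem bolza_involution_density {u v : ℝ} (hu : 0 < u) (hv : 0 < v) (huv : v < 1 - u) :
    ((1 - u - v) / (1 - v)) ^ (-(2:ℝ)/3) * (u / (1 - v)) ^ (-(2:ℝ)/3) *
        (u * v / (1 - v)) ^ (-(1:ℝ)/3) * (u / (1 - v) ^ 2) =
      v ^ (-(1:ℝ)/3) * (1 - v) ^ (-(1:ℝ)/3) * (1 - u - v) ^ (-(2:ℝ)/3) := by
  have h1v : 0 < 1 - v := by linarith
  have hN : 0 < 1 - u - v := by linarith
  apply (Odd.strictMono_pow (R := ℝ) (n := 3) (by decide)).injective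
  simp only
  rw [mul_pow, mul_pow, mul_pow, mul_pow, mul_pow,
    ← rpow_mul_natCast (div_pos hN h1v).le, ← rpow_mul_natCast (div_pos hu h1v).le,
    ← rpow_mul_natCast (div_pos (mul_pos hu hv) h1v).le, ← rpow_mul_natCast hv.le,
    ← rpow_mul_natCast h1v.le, ← rpow_mul_natCast hN.le]
  norm_num
  simp only [Real.rpow_neg_one]
  field_simp

/-- **The simplex pencil in the cube-root coordinate**: with `a = −(z−1)²/z`,
`Q(a,u) = a²(3−a)² − 4ua = (z−1)²((z³−1)² + 4uz³)/z⁴` (the card's "`w² = (z−1)²[(z³−1)² + 4uz³]/z⁴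
= a²(3−a)² − 4ua`", an identity of rational functions). [folklore] -/
theorem bolza_Q_in_z (u z : ℝ) (hz : z ≠ 0) :
    (-(z - 1) ^ 2 / z) ^ 2 * (3 - -(z - 1) ^ 2 / z) ^ 2 - 4 * u * (-(z - 1) ^ 2 / z) =
      (z - 1) ^ 2 * ((z ^ 3 - 1) ^ 2 + 4 * u * z ^ 3) / z ^ 4 := by
  field_simp
  ring

/-- **(γ) exact — algebraic core of the card's key identity.** If `z³(1−u−v) = v(1−v)` (the
cube-root chart) then, with `a_z = −(z−1)(z+1)/z² = da/dz` and
`z_v = ((1−v)² − u(1−2v))/(3z²(1−u−v)²) = ∂z/∂v` (implicit differentiation, `hasDerivAt_bolza_chart`),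
`(a_z·z_v)² = Q(a,u)·((1+z)/(3z²(1−u−v)))²`; and `(1+z)/(z²(1−u−v)) = ψ + ψ̄`
(`bolza_psi_identities`). The card verified this numerically at 25 points (kit j005071); it is a
polynomial identity: `((1−v)² − u(1−2v))² = ((1−v)² − u)² + 4uv(1−v)(1−u−v)`. [folklore] -/
theorem bolza_key_identity_exact (u v z : ℝ) (huv : 1 - u - v ≠ 0) (hz : z ≠ 0)
    (hz3 : z ^ 3 * (1 - u - v) = v * (1 - v)) :
    ((-(z - 1) * (z + 1) / z ^ 2) *
        (((1 - v) ^ 2 - u * (1 - 2 * v)) / (3 * z ^ 2 * (1 - u - v) ^ 2))) ^ 2 =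
      ((-(z - 1) ^ 2 / z) ^ 2 * (3 - -(z - 1) ^ 2 / z) ^ 2 - 4 * u * (-(z - 1) ^ 2 / z)) *
        ((1 + z) / (3 * z ^ 2 * (1 - u - v))) ^ 2 := by
  rw [bolza_Q_in_z u z hz]
  have key : ((1 - v) ^ 2 - u * (1 - 2 * v)) ^ 2 =
      ((z ^ 3 - 1) ^ 2 + 4 * u * z ^ 3) * (1 - u - v) ^ 2 := by
    have h1 : (z ^ 3 - 1) * (1 - u - v) = v * (1 - v) - (1 - u - v) := by
      linear_combination hz3
    calc ((1 - v) ^ 2 - u * (1 - 2 * v)) ^ 2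
        = (v * (1 - v) - (1 - u - v)) ^ 2 + 4 * u * (v * (1 - v)) * (1 - u - v) := by ring
      _ = ((z ^ 3 - 1) * (1 - u - v)) ^ 2 + 4 * u * (z ^ 3 * (1 - u - v)) * (1 - u - v) := by
          rw [h1, hz3]
      _ = ((z ^ 3 - 1) ^ 2 + 4 * u * z ^ 3) * (1 - u - v) ^ 2 := by ring
  have hrepl : (z ^ 3 - 1) ^ 2 + 4 * u * z ^ 3 =
      ((1 - v) ^ 2 - u * (1 - 2 * v)) ^ 2 / (1 - u - v) ^ 2 := by
    rw [key]; field_simp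
  rw [hrepl]
  field_simp
  ring

/-- **(δ) — the points at infinity of the simplex pencil are flexes.** On the cubic model
`η² = ξ³ + 9ξ² + 24uξ + 16u²` (`ξ = −4u/a`, `quartic_to_cubic`), the tangent `η = 3ξ + 4u` at
`(0, 4u)` meets the curve only at `ξ = 0` (triply): `(0, ±4u)` — the two points `a = ∞` — are flexes,
hence the rational 3-torsion points for the flex origin `ξ = ∞` (`a = 0`); translation by them
permutes the three arcs of the unbounded real component (the card's `2/3 : 1 : 1/3`). [folklore] -/
theorem hesse_pencil_flex (u ξ : ℝ) :
    (3 * ξ + 4 * u) ^ 2 - (ξ ^ 3 + 9 * ξ ^ 2 + 24 * u * ξ + 16 * u ^ 2) = -ξ ^ 3 := by ring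

/-- **(δ) — quartic-to-cubic.** `w² = a²(3−a)² − 4ua` iff `(4uw/a²)² = ξ³ + 9ξ² + 24uξ + 16u²` with
`ξ = −4u/a` (`a, u ≠ 0`): the simplex pencil `E_u` is the card's level-3 cubic. [folklore] -/
theorem quartic_to_cubic (u a w : ℝ) (ha : a ≠ 0) (hu : u ≠ 0) :
    w ^ 2 = a ^ 2 * (3 - a) ^ 2 - 4 * u * a ↔
      (4 * u * w / a ^ 2) ^ 2 = (-4 * u / a) ^ 3 + 9 * (-4 * u / a) ^ 2 + 24 * u * (-4 * u / a) +
        16 * u ^ 2 := by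
  constructor
  · intro h
    rw [div_pow, show (4 * u * w) ^ 2 = 16 * u ^ 2 * w ^ 2 by ring, h]
    field_simp
    ring
  · intro h
    field_simp at h
    linear_combination h / 16


/-- **(γ) — the cube-root chart is differentiable with the implicit derivative**:
`d/dv (v(1−v)/(1−u−v))^{1/3} = ((1−v)² − u(1−2v))/(3z²(1−u−v)²)`, `z` the chart. [folklore] -/
theorem hasDerivAt_bolza_chart {u v : ℝ} (hu : 0 < u) (hv : 0 < v) (huv : v < 1 - u) :
    HasDerivAt (fun t : ℝ => (t * (1 - t) / (1 - u - t)) ^ ((1:ℝ)/3))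
      (((1 - v) ^ 2 - u * (1 - 2 * v)) /
        (3 * ((v * (1 - v) / (1 - u - v)) ^ ((1:ℝ)/3)) ^ 2 * (1 - u - v) ^ 2)) v := by
  have hN : 0 < 1 - u - v := by linarith
  have h1v : 0 < 1 - v := by linarith
  have hg_pos : 0 < v * (1 - v) / (1 - u - v) := div_pos (mul_pos hv h1v) hN
  have hg : HasDerivAt (fun t : ℝ => t * (1 - t) / (1 - u - t))
      (((1 * (1 - v) + v * -1) * (1 - u - v) - v * (1 - v) * -1) / (1 - u - v) ^ 2) v := by
    have h1 : HasDerivAt (fun t : ℝ => t * (1 - t)) (1 * (1 - v) + v * -1) v :=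
      (hasDerivAt_id' v).mul ((hasDerivAt_id' v).const_sub 1)
    have h2 : HasDerivAt (fun t : ℝ => 1 - u - t) (-1) v := by
      simpa using (hasDerivAt_id v).const_sub (1 - u)
    exact h1.div h2 hN.ne'
  have hd := hg.rpow_const (p := (1:ℝ)/3) (Or.inl hg_pos.ne')
  refine hd.congr_deriv ?_
  have hexp : (v * (1 - v) / (1 - u - v)) ^ ((1:ℝ)/3 - 1) =
      (((v * (1 - v) / (1 - u - v)) ^ ((1:ℝ)/3)) ^ 2)⁻¹ := by
    rw [show (1:ℝ)/3 - 1 = -((1:ℝ)/3 * 2) by norm_num, rpow_neg hg_pos.le, rpow_mul hg_pos.le,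
      rpow_two]
  rw [hexp]
  have hz : ((v * (1 - v) / (1 - u - v)) ^ ((1:ℝ)/3)) ^ 2 ≠ 0 :=
    pow_ne_zero _ (rpow_pos_of_pos hg_pos _).ne'
  field_simp
  ring

/-- **(γ) — the two box densities in the chart**: `ψ̄ = z·ψ` and `ψ·z²·(1−u−v) = 1`, so
`ψ + ψ̄ = (1+z)/(z²(1−u−v))`. Proof: cube both sides. [folklore] -/
theorem bolza_psi_identities {u v : ℝ} (hu : 0 < u) (hv : 0 < v) (huv : v < 1 - u) :
    v ^ (-(1:ℝ)/3) * (1 - v) ^ (-(1:ℝ)/3) * (1 - u - v) ^ (-(2:ℝ)/3) =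
        (v * (1 - v) / (1 - u - v)) ^ ((1:ℝ)/3) *
          (v ^ (-(2:ℝ)/3) * (1 - v) ^ (-(2:ℝ)/3) * (1 - u - v) ^ (-(1:ℝ)/3)) ∧
      v ^ (-(2:ℝ)/3) * (1 - v) ^ (-(2:ℝ)/3) * (1 - u - v) ^ (-(1:ℝ)/3) *
          ((v * (1 - v) / (1 - u - v)) ^ ((1:ℝ)/3)) ^ 2 * (1 - u - v) = 1 := by
  have hN : 0 < 1 - u - v := by linarith
  have h1v : 0 < 1 - v := by linarith
  have hg_pos : 0 < v * (1 - v) / (1 - u - v) := div_pos (mul_pos hv h1v) hN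
  have inj := (Odd.strictMono_pow (R := ℝ) (n := 3) (by decide)).injective
  constructor
  · apply inj
    simp only
    rw [mul_pow, mul_pow, mul_pow, mul_pow, mul_pow, ← rpow_mul_natCast hv.le,
      ← rpow_mul_natCast h1v.le, ← rpow_mul_natCast hN.le, ← rpow_mul_natCast hg_pos.le,
      ← rpow_mul_natCast hv.le, ← rpow_mul_natCast h1v.le, ← rpow_mul_natCast hN.le]
    norm_num
    simp only [Real.rpow_neg_one]
    field_simp
  · apply inj
    simp only
    rw [one_pow, mul_pow, mul_pow, mul_pow, mul_pow, ← rpow_mul_natCast hv.le,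
      ← rpow_mul_natCast h1v.le, ← rpow_mul_natCast hN.le, ← pow_mul,
      ← rpow_mul_natCast hg_pos.le]
    norm_num
    simp only [Real.rpow_neg_one]
    field_simp

/-- **THE BOLZA LEVER IS EXACT (assembled).** For `0 < u`, `0 < v < 1 − u` the chart
`a(u,v) = −(z−1)²/z`, `z = (v(1−v)/(1−u−v))^{1/3}`, is differentiable in `v` with derivative `D`
satisfying `D² = Q(a(u,v),u)·((ψ+ψ̄)(u,v)/3)²` EXACTLY, i.e. `|∂a/∂v|/√Q = (ψ+ψ̄)/3` wherever
`Q > 0` (which holds on the image `a < 0`): the rule-(2) integrand relation of the card's step (ii),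
`[cell, u^{s−1}(ψ+ψ̄)/2] ~ [Σ_neg, (3/2)u^{s−1}/√Q]`, with no `u`-dependent constant. [folklore] -/
theorem bolza_lever {u v : ℝ} (hu : 0 < u) (hv : 0 < v) (huv : v < 1 - u) :
    ∃ D : ℝ,
      HasDerivAt (fun t : ℝ => -((t * (1 - t) / (1 - u - t)) ^ ((1:ℝ)/3) - 1) ^ 2 /
          (t * (1 - t) / (1 - u - t)) ^ ((1:ℝ)/3)) D v ∧
      D ^ 2 =
        ((-((v * (1 - v) / (1 - u - v)) ^ ((1:ℝ)/3) - 1) ^ 2 /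
              (v * (1 - v) / (1 - u - v)) ^ ((1:ℝ)/3)) ^ 2 *
            (3 - -((v * (1 - v) / (1 - u - v)) ^ ((1:ℝ)/3) - 1) ^ 2 /
              (v * (1 - v) / (1 - u - v)) ^ ((1:ℝ)/3)) ^ 2 -
          4 * u * (-((v * (1 - v) / (1 - u - v)) ^ ((1:ℝ)/3) - 1) ^ 2 /
              (v * (1 - v) / (1 - u - v)) ^ ((1:ℝ)/3))) *
        ((v ^ (-(2:ℝ)/3) * (1 - v) ^ (-(2:ℝ)/3) * (1 - u - v) ^ (-(1:ℝ)/3) +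
            v ^ (-(1:ℝ)/3) * (1 - v) ^ (-(1:ℝ)/3) * (1 - u - v) ^ (-(2:ℝ)/3)) / 3) ^ 2 := by
  have hN : 0 < 1 - u - v := by linarith
  have h1v : 0 < 1 - v := by linarith
  have hg_pos : 0 < v * (1 - v) / (1 - u - v) := div_pos (mul_pos hv h1v) hN
  set z := (v * (1 - v) / (1 - u - v)) ^ ((1:ℝ)/3) with hzdef
  have hz0 : 0 < z := rpow_pos_of_pos hg_pos _
  set ψ := v ^ (-(2:ℝ)/3) * (1 - v) ^ (-(2:ℝ)/3) * (1 - u - v) ^ (-(1:ℝ)/3) with hψ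
  set ψ' := v ^ (-(1:ℝ)/3) * (1 - v) ^ (-(1:ℝ)/3) * (1 - u - v) ^ (-(2:ℝ)/3) with hψ'
  -- chain rule
  have hchart := hasDerivAt_bolza_chart hu hv huv
  rw [← hzdef] at hchart
  have ha : HasDerivAt (fun y : ℝ => -(y - 1) ^ 2 / y) (-(z - 1) * (z + 1) / z ^ 2) z := by
    have h1 : HasDerivAt (fun y : ℝ => -(y - 1) ^ 2) (-(↑(2:ℕ) * (z - 1) ^ (2 - 1) * 1)) z :=
      (((hasDerivAt_id' z).sub_const 1).pow 2).neg
    have h2 := h1.div (hasDerivAt_id' z) hz0.ne'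
    refine h2.congr_deriv ?_
    have h21 : (2:ℕ) - 1 = 1 := rfl
    simp only [h21, pow_one, mul_one, Nat.cast_ofNat]
    field_simp
    ring
  have hcomp := ha.comp v hchart
  refine ⟨_, hcomp, ?_⟩
  have hz3 : z ^ 3 * (1 - u - v) = v * (1 - v) := by
    rw [hzdef, ← rpow_natCast, ← rpow_mul hg_pos.le]
    norm_num
    field_simp
  have key := bolza_key_identity_exact u v z hN.ne' hz0.ne' hz3
  obtain ⟨h1, h2⟩ := bolza_psi_identities hu hv huv
  rw [← hzdef, ← hψ, ← hψ'] at h1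
  rw [← hzdef, ← hψ] at h2
  rw [key, h1]
  congr 1
  have hψz : ψ = 1 / (z ^ 2 * (1 - u - v)) := by
    rw [eq_div_iff (by positivity)]; linear_combination h2
  rw [hψz]
  field_simp

/-- **The `ι`-fixed point.** The chart value `z = (v(1−v)/(1−u−v))^{1/3}` equals `1` (i.e. `a = 0`)
iff `(1−v)² = u`, i.e. `v = 1 − √u` on `Σ_box`: the cut point between the card's two injectivity
cells. [folklore] -/
theorem bolza_chart_eq_one_iff {u v : ℝ} (hu : 0 < u) (hv : 0 < v) (huv : v < 1 - u) :
    (v * (1 - v) / (1 - u - v)) ^ ((1:ℝ)/3) = 1 ↔ (1 - v) ^ 2 = u := by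
  have hN : 0 < 1 - u - v := by linarith
  have h1v : 0 < 1 - v := by linarith
  have hg_pos : 0 < v * (1 - v) / (1 - u - v) := div_pos (mul_pos hv h1v) hN
  have key : v * (1 - v) / (1 - u - v) = 1 ↔ (1 - v) ^ 2 = u := by
    rw [div_eq_one_iff_eq hN.ne']
    constructor <;> intro h <;> nlinarith [h]
  rw [← key]
  constructor
  · intro h
    have h3 := congrArg (fun x : ℝ => x ^ (3:ℕ)) h
    simp only [one_pow] at h3
    rwa [← rpow_natCast, ← rpow_mul hg_pos.le, show (1:ℝ)/3 * ((3:ℕ):ℝ) = 1 by norm_num,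
      rpow_one] at h3
  · intro h
    rw [h, one_rpow]

/-- **The chart is non-degenerate off the cut**: for `(1−v)² ≠ u` every `v`-derivative `D` of
`a(u,·)` at `v` is non-zero (`D² = Q·((ψ+ψ̄)/3)²`, `Q(a,u) > 0` because `a < 0` strictly, and
`ψ + ψ̄ > 0`). Hence `a(u,·)` is strictly monotone on each cell `v ≶ 1 − √u` (injectivity of the
card's rule-(2) maps `(u,v) ↦ (u, a(u,v))`), with image `(−∞, 0)` on each. [folklore] -/
theorem bolza_chart_deriv_ne_zero {u v D : ℝ} (hu : 0 < u) (hv : 0 < v) (huv : v < 1 - u)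
    (hfix : (1 - v) ^ 2 ≠ u)
    (hD : HasDerivAt (fun t : ℝ => -((t * (1 - t) / (1 - u - t)) ^ ((1:ℝ)/3) - 1) ^ 2 /
          (t * (1 - t) / (1 - u - t)) ^ ((1:ℝ)/3)) D v) : D ≠ 0 := by
  have hN : 0 < 1 - u - v := by linarith
  have h1v : 0 < 1 - v := by linarith
  have hg_pos : 0 < v * (1 - v) / (1 - u - v) := div_pos (mul_pos hv h1v) hN
  obtain ⟨D₀, hD₀, hsq⟩ := bolza_lever hu hv huv
  have hDD : D = D₀ := hD.unique hD₀
  subst hDD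
  set z := (v * (1 - v) / (1 - u - v)) ^ ((1:ℝ)/3) with hz
  have hz0 : 0 < z := rpow_pos_of_pos hg_pos _
  have hz1 : z ≠ 1 := fun h => hfix ((bolza_chart_eq_one_iff hu hv huv).mp h)
  have ha : -(z - 1) ^ 2 / z < 0 := by
    apply div_neg_of_neg_of_pos _ hz0
    have : 0 < (z - 1) ^ 2 := by
      have : z - 1 ≠ 0 := sub_ne_zero.mpr hz1
      positivity
    linarith
  have hQ : 0 < (-(z - 1) ^ 2 / z) ^ 2 * (3 - -(z - 1) ^ 2 / z) ^ 2 -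
      4 * u * (-(z - 1) ^ 2 / z) := by
    have h1 : 0 ≤ (-(z - 1) ^ 2 / z) ^ 2 * (3 - -(z - 1) ^ 2 / z) ^ 2 := by positivity
    nlinarith [mul_pos hu (neg_pos.mpr ha)]
  have hψ : 0 < (v ^ (-(2:ℝ)/3) * (1 - v) ^ (-(2:ℝ)/3) * (1 - u - v) ^ (-(1:ℝ)/3) +
      v ^ (-(1:ℝ)/3) * (1 - v) ^ (-(1:ℝ)/3) * (1 - u - v) ^ (-(2:ℝ)/3)) / 3 := by positivity
  have hpos : 0 < D ^ 2 := by
    rw [hsq]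
    exact mul_pos hQ (pow_pos hψ 2)
  intro hD0
  rw [hD0] at hpos
  norm_num at hpos

/-- **`z_v > 0`**: the cube-root chart `z` is strictly increasing in `v` on `Σ_box` (`0 < u < 1`):
`(1−v)² − u(1−2v) = (v − (1−u))² + u(1−u) > 0`. [folklore] -/
theorem bolza_chart_zv_pos {u v : ℝ} (hu : 0 < u) (hu1 : u < 1) (hv : 0 < v) (huv : v < 1 - u) :
    0 < ((1 - v) ^ 2 - u * (1 - 2 * v)) /
      (3 * ((v * (1 - v) / (1 - u - v)) ^ ((1:ℝ)/3)) ^ 2 * (1 - u - v) ^ 2) := by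
  have hN : 0 < 1 - u - v := by linarith
  have h1v : 0 < 1 - v := by linarith
  have hz : 0 < (v * (1 - v) / (1 - u - v)) ^ ((1:ℝ)/3) :=
    rpow_pos_of_pos (div_pos (mul_pos hv h1v) hN) _
  apply div_pos
  · nlinarith [sq_nonneg (v - (1 - u)), mul_pos hu (sub_pos.mpr hu1)]
  · positivity

/-- **Which side of the cut**: `z < 1 ↔ u < (1−v)²` (i.e. `v < 1 − √u`). [folklore] -/
theorem bolza_chart_lt_one_iff {u v : ℝ} (hu : 0 < u) (hv : 0 < v) (huv : v < 1 - u) :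
    (v * (1 - v) / (1 - u - v)) ^ ((1:ℝ)/3) < 1 ↔ u < (1 - v) ^ 2 := by
  have hN : 0 < 1 - u - v := by linarith
  have h1v : 0 < 1 - v := by linarith
  have hg : 0 < v * (1 - v) / (1 - u - v) := div_pos (mul_pos hv h1v) hN
  have key : v * (1 - v) / (1 - u - v) < 1 ↔ u < (1 - v) ^ 2 := by
    rw [div_lt_one hN]
    constructor <;> intro h <;> nlinarith [h]
  rw [Real.rpow_lt_one_iff_of_pos hg, key]
  constructor
  · rintro (⟨-, h⟩ | ⟨h, -⟩)
    · norm_num at h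
    · exact h
  · intro h
    exact Or.inr ⟨h, by norm_num⟩

/-- **Sign of the chart's derivative**: every `v`-derivative `D` of `a(u,·)` is POSITIVE below the cut
(`u < (1−v)²`, i.e. `v < 1 − √u`, where `a` increases from `−∞` to `0`) and NEGATIVE above it (where
`a` decreases from `0` to `−∞`): with continuity this is the strict monotonicity, hence injectivity,
of the card's two rule-(2) cells, and both cells have image `(−∞, 0)`. [folklore] -/
theorem bolza_chart_deriv_sign {u v D : ℝ} (hu : 0 < u) (hu1 : u < 1) (hv : 0 < v) (huv : v < 1 - u)
    (hD : HasDerivAt (fun t : ℝ => -((t * (1 - t) / (1 - u - t)) ^ ((1:ℝ)/3) - 1) ^ 2 /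
          (t * (1 - t) / (1 - u - t)) ^ ((1:ℝ)/3)) D v) :
    (u < (1 - v) ^ 2 → 0 < D) ∧ ((1 - v) ^ 2 < u → D < 0) := by
  have hN : 0 < 1 - u - v := by linarith
  have h1v : 0 < 1 - v := by linarith
  have hg : 0 < v * (1 - v) / (1 - u - v) := div_pos (mul_pos hv h1v) hN
  set z := (v * (1 - v) / (1 - u - v)) ^ ((1:ℝ)/3) with hz
  have hz0 : 0 < z := rpow_pos_of_pos hg _
  -- the derivative is a_z * z_v (chain rule, uniqueness)
  have hchart := hasDerivAt_bolza_chart hu hv huv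
  rw [← hz] at hchart
  have ha : HasDerivAt (fun y : ℝ => -(y - 1) ^ 2 / y) (-(z - 1) * (z + 1) / z ^ 2) z := by
    have h1 : HasDerivAt (fun y : ℝ => -(y - 1) ^ 2) (-(↑(2:ℕ) * (z - 1) ^ (2 - 1) * 1)) z :=
      (((hasDerivAt_id' z).sub_const 1).pow 2).neg
    have h2 := h1.div (hasDerivAt_id' z) hz0.ne'
    refine h2.congr_deriv ?_
    have h21 : (2:ℕ) - 1 = 1 := rfl
    simp only [h21, pow_one, mul_one, Nat.cast_ofNat]
    field_simp
    ring
  have hcomp := ha.comp v hchart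
  have hDD : D = -(z - 1) * (z + 1) / z ^ 2 *
      (((1 - v) ^ 2 - u * (1 - 2 * v)) / (3 * z ^ 2 * (1 - u - v) ^ 2)) :=
    hD.unique hcomp
  have hzv : 0 < ((1 - v) ^ 2 - u * (1 - 2 * v)) / (3 * z ^ 2 * (1 - u - v) ^ 2) := by
    have := bolza_chart_zv_pos hu hu1 hv huv; rwa [← hz] at this
  have hiff := bolza_chart_lt_one_iff hu hv huv
  rw [← hz] at hiff
  constructor
  · intro h
    have hz1 : z < 1 := hiff.mpr h
    rw [hDD]
    apply mul_pos _ hzv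
    apply div_pos _ (by positivity)
    nlinarith
  · intro h
    have hz1 : 1 < z := by
      rcases lt_trichotomy z 1 with hlt | heq | hgt
      · exact absurd (hiff.mp hlt) (by linarith)
      · have : (1 - v) ^ 2 = u := (bolza_chart_eq_one_iff hu hv huv).mp heq
        linarith
      · exact hgt
    rw [hDD]
    apply mul_neg_of_neg_of_pos _ hzv
    apply div_neg_of_neg_of_pos _ (by positivity)
    nlinarith


/-! ## §9 (cycle 2) The first moves of the cheapest line are CERTIFIED inside the calculus

Steps 0 and (i) of the bolza chain as `KZ.changeOfVariablesRel` / `integrandAddRel` instances with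
every side condition of the tree's rule (2) discharged (`ℚ`-semialgebraic map, derivative within the
domain, injectivity, image, integrand relation with `|det|`): the coarea shear
`Ψ(v₁,v₂) = ((1−v₁)(1−v₂), v₁)` of the box onto `Σ_box = {0<u<1, 0<v<1−u}` (`box_shear_move`), the
existence of the sheared representations (integrability transported through `Ψ` and `ι`), the
involution move (`bolza_involution_move`, for any constant multiple), and the assembled
`boxRep_equivalent_sigmaBoxAvgRep : Equivalent (boxRep s hs) [Σ_box, u^{s−1}(ψ+ψ̄)/2]` for EVERY
rational `s > 0` — shear (2), halving (1b), involution on one half (2), re-addition (1b). The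
calculus as formalised accepts the line's moves; what remains for a prover is the simplex-side shear,
the cube-root chart on its two cells (§8: exact Jacobian identity, non-degenerate off the cut) and
the torsion translations. -/

/-- The sheared box `Σ_box = {0 < u < 1, 0 < v < 1 − u}` (`x 0 = u`, `x 1 = v`). [folklore] -/
def sigmaBox : Set (Fin 2 → ℝ) := {x | 0 < x 0 ∧ 0 < x 1 ∧ x 1 < 1 - x 0}

/-- Defining polynomials of `Σ_box`. [folklore] -/
def sigmaBoxPolys : Fin 3 → MvPolynomial (Fin 2) ℚ := ![X 0, X 1, 1 - X 0 - X 1]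

/-- `Σ_box` as a positivity set of its defining polynomials. [folklore] -/
theorem sigmaBox_eq : sigmaBox = {x | ∀ l, 0 < aeval x (sigmaBoxPolys l)} := by
  ext x
  simp only [sigmaBox, mem_setOf_eq, Fin.forall_fin_succ, sigmaBoxPolys,
    Matrix.cons_val_zero, Matrix.cons_val_succ, map_sub, map_one, MvPolynomial.aeval_X]
  constructor
  · rintro ⟨h0, h1, h2⟩; exact ⟨h0, h1, by linarith, fun i => Fin.elim0 i⟩
  · rintro ⟨h0, h1, h2, -⟩; exact ⟨h0, h1, by linarith⟩

/-- `Σ_box` is `ℚ`-semialgebraic. [folklore] -/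
theorem isSemialgebraic_sigmaBox : IsSemialgebraic ℚ sigmaBox := by
  rw [sigmaBox_eq]; exact isSemialgebraic_setOf_forall_aeval_pos _

/-- The involution `ι(u,v) = (u, (1−u−v)/(1−v))`. [folklore] -/
def ιΦ (x : Fin 2 → ℝ) : Fin 2 → ℝ := ![x 0, (1 - x 0 - x 1) / (1 - x 1)]

/-- First component of `ι`. [folklore] -/
@[simp] theorem ιΦ_apply_zero (x : Fin 2 → ℝ) : ιΦ x 0 = x 0 := rfl
/-- Second component of `ι`. [folklore] -/
@[simp] theorem ιΦ_apply_one (x : Fin 2 → ℝ) : ιΦ x 1 = (1 - x 0 - x 1) / (1 - x 1) := rfl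

/-- Jacobian matrix of `ι`. [folklore] -/
def ιjac (x : Fin 2 → ℝ) : Matrix (Fin 2) (Fin 2) ℝ :=
  !![1, 0; -1 / (1 - x 1), -(x 0) / (1 - x 1) ^ 2]

/-- The derivative of `ι` as a continuous linear map. [folklore] -/
def ιΦ' (x : Fin 2 → ℝ) : (Fin 2 → ℝ) →L[ℝ] (Fin 2 → ℝ) :=
  LinearMap.toContinuousLinearMap (Matrix.toLin' (ιjac x))

/-- The derivative of `ι` applied to a vector, first component. [folklore] -/
@[simp] theorem ιΦ'_apply_zero (x v : Fin 2 → ℝ) : ιΦ' x v 0 = v 0 := by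
  change Matrix.toLin' (ιjac x) v 0 = _
  rw [Matrix.toLin'_apply]
  simp [ιjac, Matrix.mulVec, dotProduct, Fin.sum_univ_two]

/-- The derivative of `ι` applied to a vector, second component. [folklore] -/
@[simp] theorem ιΦ'_apply_one (x v : Fin 2 → ℝ) :
    ιΦ' x v 1 = -1 / (1 - x 1) * v 0 + -(x 0) / (1 - x 1) ^ 2 * v 1 := by
  change Matrix.toLin' (ιjac x) v 1 = _
  rw [Matrix.toLin'_apply]
  simp [ιjac, Matrix.mulVec, dotProduct, Fin.sum_univ_two]

/-- `det Dι(u,v) = −u/(1−v)²`. [folklore] -/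
theorem det_ιΦ' (x : Fin 2 → ℝ) : (ιΦ' x).det = -(x 0) / (1 - x 1) ^ 2 := by
  change LinearMap.det (Matrix.toLin' (ιjac x)) = _
  rw [LinearMap.det_toLin', Matrix.det_fin_two]
  simp [ιjac]

/-- `ι` is differentiable off `v = 1` with derivative `ιΦ'`. [folklore] -/
theorem hasFDerivAt_ιΦ {x : Fin 2 → ℝ} (hx : x 1 ≠ 1) : HasFDerivAt ιΦ (ιΦ' x) x := by
  have h1x : 1 - x 1 ≠ 0 := sub_ne_zero.mpr (Ne.symm hx)
  have h0 : HasFDerivAt (fun y : Fin 2 → ℝ => y 0)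
      (ContinuousLinearMap.proj (R := ℝ) (φ := fun _ : Fin 2 => ℝ) 0) x :=
    hasFDerivAt_apply 0 x
  have h1 : HasFDerivAt (fun y : Fin 2 → ℝ => y 1)
      (ContinuousLinearMap.proj (R := ℝ) (φ := fun _ : Fin 2 => ℝ) 1) x :=
    hasFDerivAt_apply 1 x
  rw [hasFDerivAt_pi']
  refine Fin.forall_fin_two.mpr ⟨?_, ?_⟩
  · have hf : (fun y : Fin 2 → ℝ => ιΦ y 0) = fun y => y 0 := funext fun y => rfl
    rw [hf]
    refine h0.congr_fderiv (ContinuousLinearMap.ext fun v => ?_)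
    simp
  · have hf : (fun y : Fin 2 → ℝ => ιΦ y 1) = fun y => (1 - y 0 - y 1) * (1 - y 1)⁻¹ :=
      funext fun y => by simp [div_eq_mul_inv]
    rw [hf]
    have hnum : HasFDerivAt (fun y : Fin 2 → ℝ => 1 - y 0 - y 1)
        (-(ContinuousLinearMap.proj (R := ℝ) (φ := fun _ : Fin 2 => ℝ) 0) -
          ContinuousLinearMap.proj (R := ℝ) (φ := fun _ : Fin 2 => ℝ) 1) x := by
      have := (h0.const_sub 1).sub h1
      exact this
    have hden : HasFDerivAt (fun y : Fin 2 → ℝ => (1 - y 1)⁻¹)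
        ((ContinuousLinearMap.smulRight (1 : ℝ →L[ℝ] ℝ) (-((1 - x 1) ^ 2)⁻¹)).comp
          (-(ContinuousLinearMap.proj (R := ℝ) (φ := fun _ : Fin 2 => ℝ) 1))) x :=
      (hasFDerivAt_inv h1x).comp x (h1.const_sub 1)
    refine (hnum.mul hden).congr_fderiv (ContinuousLinearMap.ext fun v => ?_)
    simp
    field_simp
    ring

/-- `ι` is an involution of `Σ_box`. [folklore] -/
theorem ιΦ_ιΦ {x : Fin 2 → ℝ} (hx : x ∈ sigmaBox) : ιΦ (ιΦ x) = x := by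
  obtain ⟨h0, h1, h2⟩ := hx
  have h1x : 1 - x 1 ≠ 0 := by linarith
  funext i
  fin_cases i
  · rfl
  · change (1 - x 0 - (1 - x 0 - x 1) / (1 - x 1)) / (1 - (1 - x 0 - x 1) / (1 - x 1)) = x 1
    have hu : (1 - (1 - x 0 - x 1) / (1 - x 1)) = x 0 / (1 - x 1) := by field_simp; ring
    rw [hu]
    field_simp
    ring

/-- `ι` maps `Σ_box` into itself. [folklore] -/
theorem mapsTo_ιΦ : MapsTo ιΦ sigmaBox sigmaBox := by
  intro x hx
  obtain ⟨h0, h1, h2⟩ := hx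
  have h1x : 0 < 1 - x 1 := by linarith
  refine ⟨h0, ?_, ?_⟩
  · change 0 < (1 - x 0 - x 1) / (1 - x 1)
    exact div_pos (by linarith) h1x
  · change (1 - x 0 - x 1) / (1 - x 1) < 1 - x 0
    rw [div_lt_iff₀ h1x]
    nlinarith

/-- `ι` is injective on `Σ_box`. [folklore] -/
theorem injOn_ιΦ : InjOn ιΦ sigmaBox := fun x hx y hy hxy => by
  rw [← ιΦ_ιΦ hx, ← ιΦ_ιΦ hy, hxy]

/-- `ι` maps `Σ_box` ONTO itself. [folklore] -/
theorem image_ιΦ : ιΦ '' sigmaBox = sigmaBox := by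
  refine (mapsTo_ιΦ.image_subset).antisymm fun y hy => ⟨ιΦ y, mapsTo_ιΦ hy, ιΦ_ιΦ hy⟩

/-- `ι` is a `ℚ`-semialgebraic map on `Σ_box` (a rational map with non-vanishing denominator). [folklore] -/
theorem isSemialgebraicMapOn_ιΦ : IsSemialgebraicMapOn ℚ sigmaBox ιΦ := by
  refine IsSemialgebraicMapOn.of_forall isSemialgebraic_sigmaBox (Fin.forall_fin_two.mpr ⟨?_, ?_⟩)
  · exact (isSemialgebraicFunOn_aeval isSemialgebraic_sigmaBox (X 0)).congr fun x _ => by simp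
  · have hn := isSemialgebraicFunOn_aeval isSemialgebraic_sigmaBox (1 - X 0 - X 1 : MvPolynomial (Fin 2) ℚ)
    have hd := isSemialgebraicFunOn_aeval isSemialgebraic_sigmaBox (1 - X 1 : MvPolynomial (Fin 2) ℚ)
    refine (hn.div hd fun x hx => ?_).congr fun x _ => ?_
    · simp only [map_sub, map_one, MvPolynomial.aeval_X]
      obtain ⟨h0, -, h2⟩ := hx
      linarith
    · simp

/-- The sheared box density `u^{s−1}ψ`, `ψ = v^{−2/3}(1−v)^{−2/3}(1−u−v)^{−1/3}`. [folklore] -/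
def psiFun (s : ℚ) (x : Fin 2 → ℝ) : ℝ :=
  x 0 ^ ((s:ℝ) - 1) *
    (x 1 ^ (-(2:ℝ)/3) * (1 - x 1) ^ (-(2:ℝ)/3) * (1 - x 0 - x 1) ^ (-(1:ℝ)/3))

/-- The conjugate sheared box density `u^{s−1}ψ̄`, `ψ̄ = v^{−1/3}(1−v)^{−1/3}(1−u−v)^{−2/3}`. [folklore] -/
def psiBarFun (s : ℚ) (x : Fin 2 → ℝ) : ℝ :=
  x 0 ^ ((s:ℝ) - 1) *
    (x 1 ^ (-(1:ℝ)/3) * (1 - x 1) ^ (-(1:ℝ)/3) * (1 - x 0 - x 1) ^ (-(2:ℝ)/3))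

/-- The rule-(2) integrand relation for the involution move. [folklore] -/
theorem psiBarFun_eq_jacobian {s : ℚ} {x : Fin 2 → ℝ} (hx : x ∈ sigmaBox) :
    psiBarFun s x = psiFun s (ιΦ x) * |(ιΦ' x).det| := by
  obtain ⟨h0, h1, h2⟩ := hx
  have h1x : 0 < 1 - x 1 := by linarith
  have habs : |(ιΦ' x).det| = x 0 / (1 - x 1) ^ 2 := by
    rw [det_ιΦ', neg_div, abs_neg, abs_of_pos (div_pos h0 (by positivity))]
  rw [habs]
  simp only [psiFun, psiBarFun, ιΦ_apply_zero, ιΦ_apply_one]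
  have h1ι : 1 - (1 - x 0 - x 1) / (1 - x 1) = x 0 / (1 - x 1) := by field_simp; ring
  have h1uι : 1 - x 0 - (1 - x 0 - x 1) / (1 - x 1) = x 0 * x 1 / (1 - x 1) := by field_simp; ring
  rw [h1ι, h1uι, ← bolza_involution_density h0 h1 h2]
  ring

/-- **Move (i) of the bolza chain is ONE rule-(2) instance**: for any representations `R`, `R'` on
`Σ_box` with integrands `u^{s−1}ψ̄` resp. `u^{s−1}ψ`, `[R] − [R'] ∈ changeOfVariablesRel` along the
involution `ι`. [folklore] -/
theorem bolza_involution_move {s : ℚ} (c : ℝ) (R R' : IntegralRep 2) (hR : R.domain = sigmaBox)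
    (hRi : EqOn R.integrand (fun x => c * psiBarFun s x) R.domain) (hR' : R'.domain = sigmaBox)
    (hR'i : EqOn R'.integrand (fun x => c * psiFun s x) R'.domain) :
    of R - of R' ∈ changeOfVariablesRel := by
  refine ⟨2, R, R', ιΦ, ιΦ', ?_, fun x hx => ?_, ?_, ?_, fun x hx => ?_, rfl⟩
  · rw [hR]; exact isSemialgebraicMapOn_ιΦ
  · rw [hR] at hx
    have : x 1 ≠ 1 := by obtain ⟨h0, -, h2⟩ := hx; linarith
    exact (hasFDerivAt_ιΦ this).hasFDerivWithinAt
  · rw [hR]; exact injOn_ιΦ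
  · rw [hR', hR, image_ιΦ]
  · have hx' : x ∈ sigmaBox := hR ▸ hx
    have e1 : R.integrand x = c * psiBarFun s x := hRi hx
    have e2 : R'.integrand (ιΦ x) = c * psiFun s (ιΦ x) :=
      hR'i (by rw [hR']; exact mapsTo_ιΦ hx')
    rw [e1, e2, psiBarFun_eq_jacobian hx']
    ring


/-! ### Move 0: the coarea shear `Ψ(v₁,v₂) = ((1−v₁)(1−v₂), v₁)` of the box onto `Σ_box` -/

/-- The shear. [folklore] -/
def Ψ (x : Fin 2 → ℝ) : Fin 2 → ℝ := ![(1 - x 0) * (1 - x 1), x 0]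

/-- First component of the shear. [folklore] -/
@[simp] theorem Ψ_apply_zero (x : Fin 2 → ℝ) : Ψ x 0 = (1 - x 0) * (1 - x 1) := rfl
/-- Second component of the shear. [folklore] -/
@[simp] theorem Ψ_apply_one (x : Fin 2 → ℝ) : Ψ x 1 = x 0 := rfl

/-- Jacobian matrix of the shear. [folklore] -/
def Ψjac (x : Fin 2 → ℝ) : Matrix (Fin 2) (Fin 2) ℝ := !![-(1 - x 1), -(1 - x 0); 1, 0]

/-- Derivative of the shear. [folklore] -/
def Ψ' (x : Fin 2 → ℝ) : (Fin 2 → ℝ) →L[ℝ] (Fin 2 → ℝ) :=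
  LinearMap.toContinuousLinearMap (Matrix.toLin' (Ψjac x))

/-- Derivative of the shear applied to a vector, first component. [folklore] -/
@[simp] theorem Ψ'_apply_zero (x v : Fin 2 → ℝ) :
    Ψ' x v 0 = -(1 - x 1) * v 0 + -(1 - x 0) * v 1 := by
  change Matrix.toLin' (Ψjac x) v 0 = _
  rw [Matrix.toLin'_apply]
  simp [Ψjac, Matrix.mulVec, dotProduct, Fin.sum_univ_two]

/-- Derivative of the shear applied to a vector, second component. [folklore] -/
@[simp] theorem Ψ'_apply_one (x v : Fin 2 → ℝ) : Ψ' x v 1 = v 0 := by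
  change Matrix.toLin' (Ψjac x) v 1 = _
  rw [Matrix.toLin'_apply]
  simp [Ψjac, Matrix.mulVec, dotProduct, Fin.sum_univ_two]

/-- `det DΨ(v₁,v₂) = 1 − v₁`. [folklore] -/
theorem det_Ψ' (x : Fin 2 → ℝ) : (Ψ' x).det = 1 - x 0 := by
  change LinearMap.det (Matrix.toLin' (Ψjac x)) = _
  rw [LinearMap.det_toLin', Matrix.det_fin_two]
  simp [Ψjac]

/-- The shear is differentiable with derivative `Ψ'`. [folklore] -/
theorem hasFDerivAt_Ψ (x : Fin 2 → ℝ) : HasFDerivAt Ψ (Ψ' x) x := by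
  have h0 : HasFDerivAt (fun y : Fin 2 → ℝ => y 0)
      (ContinuousLinearMap.proj (R := ℝ) (φ := fun _ : Fin 2 => ℝ) 0) x :=
    hasFDerivAt_apply 0 x
  have h1 : HasFDerivAt (fun y : Fin 2 → ℝ => y 1)
      (ContinuousLinearMap.proj (R := ℝ) (φ := fun _ : Fin 2 => ℝ) 1) x :=
    hasFDerivAt_apply 1 x
  rw [hasFDerivAt_pi']
  refine Fin.forall_fin_two.mpr ⟨?_, ?_⟩
  · have hf : (fun y : Fin 2 → ℝ => Ψ y 0) = fun y => (1 - y 0) * (1 - y 1) := funext fun y => rfl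
    rw [hf]
    refine ((h0.const_sub 1).mul (h1.const_sub 1)).congr_fderiv
      (ContinuousLinearMap.ext fun v => ?_)
    simp
    ring
  · have hf : (fun y : Fin 2 → ℝ => Ψ y 1) = fun y => y 0 := funext fun y => rfl
    rw [hf]
    refine h0.congr_fderiv (ContinuousLinearMap.ext fun v => ?_)
    simp

/-- The shear is injective on the box. [folklore] -/
theorem injOn_Ψ : InjOn Ψ box := by
  intro x hx y hy hxy
  have h1 : x 0 = y 0 := by simpa using congrFun hxy 1
  have h0 : x 1 = y 1 := by
    have := congrFun hxy 0
    simp only [Ψ_apply_zero, h1] at this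
    have hne : (1 - y 0) ≠ 0 := by have := (hy 0).2; linarith
    have := mul_left_cancel₀ hne this
    linarith
  funext i
  fin_cases i
  · exact h1
  · exact h0

/-- The shear maps the box ONTO `Σ_box`. [folklore] -/
theorem image_Ψ_box : Ψ '' box = sigmaBox := by
  ext y
  constructor
  · rintro ⟨x, hx, rfl⟩
    have h0 := hx 0
    have h1 := hx 1
    refine ⟨mul_pos (by linarith [h0.2]) (by linarith [h1.2]), by simpa using h0.1, ?_⟩
    simp only [Ψ_apply_zero, Ψ_apply_one]
    nlinarith [h0.1, h0.2, h1.1, h1.2, mul_pos (sub_pos.2 h0.2) h1.1]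
  · rintro ⟨hy0, hy1, hy2⟩
    have h1 : 0 < 1 - y 1 := by linarith
    refine ⟨![y 1, 1 - y 0 / (1 - y 1)], Fin.forall_fin_two.mpr ⟨?_, ?_⟩, ?_⟩
    · change y 1 ∈ Ioo (0:ℝ) 1
      exact ⟨hy1, by linarith⟩
    · change 1 - y 0 / (1 - y 1) ∈ Ioo (0:ℝ) 1
      refine ⟨?_, by have := div_pos hy0 h1; linarith⟩
      rw [sub_pos, div_lt_one h1]; linarith
    · funext i
      fin_cases i
      · change (1 - y 1) * (1 - (1 - y 0 / (1 - y 1))) = y 0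
        field_simp
        ring
      · rfl

/-- Substitution polynomials of the shear. [folklore] -/
def shearSubst : Fin 2 → MvPolynomial (Fin 2) ℚ := ![(1 - X 0) * (1 - X 1), X 0]

/-- Evaluating the substitution polynomials is the shear. [folklore] -/
theorem aeval_shearSubst (x : Fin 2 → ℝ) : (fun i => aeval x (shearSubst i)) = Ψ x := by
  funext i
  fin_cases i
  · simp [shearSubst]
  · simp [shearSubst]

/-- The shear is a `ℚ`-semialgebraic map (polynomial). [folklore] -/
theorem isSemialgebraicMapOn_Ψ : IsSemialgebraicMapOn ℚ box Ψ := by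
  convert isSemialgebraicMapOn_aeval isSemialgebraic_box shearSubst using 2 with z
  exact (aeval_shearSubst z).symm

/-- The rule-(2) integrand relation of the shear: `boxFun = (u^{s−1}ψ) ∘ Ψ · |det Ψ'|`. [folklore] -/
theorem boxFun_eq_shear_jacobian {s : ℚ} {x : Fin 2 → ℝ} (hx : x ∈ box) :
    boxFun s x = psiFun s (Ψ x) * |(Ψ' x).det| := by
  have h0 := hx 0
  have h1 := hx 1
  have hu : 0 < 1 - x 0 := sub_pos.2 h0.2
  have hv : 0 < 1 - x 1 := sub_pos.2 h1.2
  rw [det_Ψ', abs_of_pos hu]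
  simp only [boxFun, psiFun, Ψ_apply_zero, Ψ_apply_one]
  have hN : 1 - (1 - x 0) * (1 - x 1) - x 0 = (1 - x 0) * x 1 := by ring
  rw [hN, mul_rpow hu.le hv.le, mul_rpow hu.le h1.1.le]
  -- collect the powers of (1 - x 0): (s-1) + (-2/3) + (-1/3) + 1 = s - 1
  have hA : (1 - x 0) ^ ((s:ℝ) - 1) * (1 - x 0) ^ (-(2:ℝ)/3) * (1 - x 0) ^ (-(1:ℝ)/3) * (1 - x 0) =
      (1 - x 0) ^ ((s:ℝ) - 1) := by
    rw [← rpow_add hu, ← rpow_add hu, ← rpow_add_one hu.ne']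
    congr 1
    ring
  calc x 0 ^ (-(2:ℝ)/3) * (1 - x 0) ^ ((s:ℝ) - 1) * x 1 ^ (-(1:ℝ)/3) * (1 - x 1) ^ ((s:ℝ) - 1)
      = x 0 ^ (-(2:ℝ)/3) * x 1 ^ (-(1:ℝ)/3) * (1 - x 1) ^ ((s:ℝ) - 1) *
          ((1 - x 0) ^ ((s:ℝ) - 1) * (1 - x 0) ^ (-(2:ℝ)/3) * (1 - x 0) ^ (-(1:ℝ)/3) *
            (1 - x 0)) := by rw [hA]; ring
    _ = _ := by ring

/-- **Move 0 of the bolza chain is ONE rule-(2) instance**: the pinned box representation minus any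
representation of `u^{s−1}ψ` on `Σ_box` lies in `changeOfVariablesRel` (the coarea shear). [folklore] -/
theorem box_shear_move {s : ℚ} (hs : 0 < s) (R' : IntegralRep 2) (hR' : R'.domain = sigmaBox)
    (hR'i : EqOn R'.integrand (psiFun s) R'.domain) :
    of (boxRep s hs) - of R' ∈ changeOfVariablesRel := by
  refine ⟨2, boxRep s hs, R', Ψ, Ψ', isSemialgebraicMapOn_Ψ,
    fun x _ => (hasFDerivAt_Ψ x).hasFDerivWithinAt, injOn_Ψ, ?_, fun x hx => ?_, rfl⟩
  · rw [hR']; exact image_Ψ_box.symm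
  · have hx' : x ∈ box := hx
    change boxFun s x = _
    rw [boxFun_eq_shear_jacobian hx', hR'i (by rw [hR', ← image_Ψ_box]; exact ⟨x, hx', rfl⟩)]

/-! ### Existence of the sheared representations (integrability transported from the box) -/

/-- `u^{s−1}ψ` is integrable on `Σ_box` (transported from the box through the shear). [folklore] -/
theorem integrableOn_psiFun {s : ℚ} (hs : 0 < s) : IntegrableOn (psiFun s) sigmaBox := by
  have h := (integrableOn_image_iff_integrableOn_abs_det_fderiv_smul volume measurableSet_box
    (fun x hx => (hasFDerivAt_Ψ x).hasFDerivWithinAt) injOn_Ψ (psiFun s)).mpr ?_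
  · rwa [image_Ψ_box] at h
  · refine (integrableOn_boxFun hs).congr_fun (fun x hx => ?_) measurableSet_box
    rw [boxFun_eq_shear_jacobian hx, smul_eq_mul, mul_comm]

/-- `u^{s−1}ψ` is `ℚ`-semialgebraic on `Σ_box` (Euler–Mellin integrand). [folklore] -/
theorem isSemialgebraicFunOn_psiFun (s : ℚ) : IsSemialgebraicFunOn ℚ sigmaBox (psiFun s) := by
  have hmel := isSemialgebraicFunOn_mellinIntegrand isSemialgebraic_sigmaBox
    (![X 0, X 1, 1 - X 1, 1 - X 0 - X 1] : Fin 4 → MvPolynomial (Fin 2) ℚ)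
    (![s - 1, -2/3, -2/3, -1/3]) 1 ?_
  · refine hmel.congr fun x _ => ?_
    simp only [psiFun, mellinIntegrand, Fin.prod_univ_four, Matrix.cons_val_zero, Matrix.cons_val_one,
      Matrix.cons_val, map_sub, map_one, MvPolynomial.aeval_X, Rat.cast_sub,
      Rat.cast_one, Rat.cast_div, Rat.cast_neg, Rat.cast_ofNat, Rat.cast_one]
    ring_nf
  · intro x hx k
    obtain ⟨h0, h1, h2⟩ := hx
    fin_cases k <;> simp <;> linarith

/-- **The sheared box representation** `[Σ_box, u^{s−1}ψ]`. [folklore] -/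
def sigmaBoxRep (s : ℚ) (hs : 0 < s) : IntegralRep 2 where
  domain := sigmaBox
  integrand := psiFun s
  isSemialgebraic_domain := isSemialgebraic_sigmaBox
  isSemialgebraicFunOn_integrand := isSemialgebraicFunOn_psiFun s
  integrableOn := integrableOn_psiFun hs

/-- Box ~ sheared box: moves 0 of the bolza chain, certified. [folklore] -/
theorem boxRep_equivalent_sigmaBoxRep {s : ℚ} (hs : 0 < s) :
    Equivalent (boxRep s hs) (sigmaBoxRep s hs) :=
  changeOfVariablesRel_subset_relations (box_shear_move hs _ rfl fun _ _ => rfl)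


/-! ### Existence of the conjugate and averaged sheared representations; step (i) certified -/

/-- `u^{s−1}ψ̄` is integrable on `Σ_box` (transported through the involution). [folklore] -/
theorem integrableOn_psiBarFun {s : ℚ} (hs : 0 < s) : IntegrableOn (psiBarFun s) sigmaBox := by
  have hmeas : MeasurableSet sigmaBox := IsSemialgebraic.measurableSet_holds isSemialgebraic_sigmaBox
  have h := (integrableOn_image_iff_integrableOn_abs_det_fderiv_smul volume hmeas
    (fun x hx => (hasFDerivAt_ιΦ (by obtain ⟨h0, -, h2⟩ := hx; linarith)).hasFDerivWithinAt)
    injOn_ιΦ (psiFun s)).mp (by rw [image_ιΦ]; exact integrableOn_psiFun hs)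
  refine h.congr_fun (fun x hx => ?_) hmeas
  rw [psiBarFun_eq_jacobian hx]
  simp only [smul_eq_mul, mul_comm]

/-- `u^{s−1}ψ̄` is `ℚ`-semialgebraic on `Σ_box`. [folklore] -/
theorem isSemialgebraicFunOn_psiBarFun (s : ℚ) : IsSemialgebraicFunOn ℚ sigmaBox (psiBarFun s) := by
  have hmel := isSemialgebraicFunOn_mellinIntegrand isSemialgebraic_sigmaBox
    (![X 0, X 1, 1 - X 1, 1 - X 0 - X 1] : Fin 4 → MvPolynomial (Fin 2) ℚ)
    (![s - 1, -1/3, -1/3, -2/3]) 1 ?_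
  · refine hmel.congr fun x _ => ?_
    simp only [psiBarFun, mellinIntegrand, Fin.prod_univ_four, Matrix.cons_val_zero,
      Matrix.cons_val_one, Matrix.cons_val, map_sub, map_one, MvPolynomial.aeval_X, Rat.cast_sub,
      Rat.cast_one, Rat.cast_div, Rat.cast_neg, Rat.cast_ofNat, Rat.cast_one]
    ring_nf
  · intro x hx k
    obtain ⟨h0, h1, h2⟩ := hx
    fin_cases k <;> simp <;> linarith

/-- Scaled sheared representations `[Σ_box, c·u^{s−1}ψ]` and `[Σ_box, c·u^{s−1}ψ̄]` (`c ∈ ℚ`). [folklore] -/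
def sigmaBoxRepC (s : ℚ) (hs : 0 < s) (c : ℚ) : IntegralRep 2 :=
  (sigmaBoxRep s hs).constMul (c : ℝ) (isAlgebraic_algebraMap c)

/-- The scaled conjugate sheared representation `[Σ_box, c·u^{s−1}ψ̄]`. [folklore] -/
def sigmaBoxBarRepC (s : ℚ) (hs : 0 < s) (c : ℚ) : IntegralRep 2 :=
  (⟨sigmaBox, psiBarFun s, isSemialgebraic_sigmaBox, isSemialgebraicFunOn_psiBarFun s,
    integrableOn_psiBarFun hs⟩ : IntegralRep 2).constMul (c : ℝ) (isAlgebraic_algebraMap c)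

/-- The averaged sheared representation `[Σ_box, u^{s−1}(ψ + ψ̄)/2]`. [folklore] -/
def sigmaBoxAvgRep (s : ℚ) (hs : 0 < s) : IntegralRep 2 where
  domain := sigmaBox
  integrand x := (sigmaBoxRepC s hs (1/2)).integrand x + (sigmaBoxBarRepC s hs (1/2)).integrand x
  isSemialgebraic_domain := isSemialgebraic_sigmaBox
  isSemialgebraicFunOn_integrand :=
    IsSemialgebraicFunOn.add_holds (sigmaBoxRepC s hs (1/2)).isSemialgebraicFunOn_integrand
      (sigmaBoxBarRepC s hs (1/2)).isSemialgebraicFunOn_integrand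
  integrableOn := (sigmaBoxRepC s hs (1/2)).integrableOn.add (sigmaBoxBarRepC s hs (1/2)).integrableOn

/-- The averaged integrand is `u^{s−1}(ψ + ψ̄)/2`. [folklore] -/
theorem sigmaBoxAvgRep_integrand (s : ℚ) (hs : 0 < s) (x : Fin 2 → ℝ) :
    (sigmaBoxAvgRep s hs).integrand x = (psiFun s x + psiBarFun s x) / 2 := by
  simp only [sigmaBoxAvgRep, sigmaBoxRepC, sigmaBoxBarRepC, sigmaBoxRep,
    IntegralRep.integrand_constMul]
  push_cast
  ring

/-- **Step (i) of the bolza chain, certified**: `[box] ~ [Σ_box, u^{s−1}(ψ+ψ̄)/2]` by the shear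
(rule 2), halving (rule 1b), the involution on one half (rule 2) and re-addition (rule 1b). [folklore] -/
theorem boxRep_equivalent_sigmaBoxAvgRep {s : ℚ} (hs : 0 < s) :
    Equivalent (boxRep s hs) (sigmaBoxAvgRep s hs) := by
  -- [box] ~ [Σ, ψ]
  have h0 : of (boxRep s hs) - of (sigmaBoxRep s hs) ∈ relations :=
    boxRep_equivalent_sigmaBoxRep hs
  -- [Σ, ψ] = [Σ, ψ/2] + [Σ, ψ/2]
  have h1 : of (sigmaBoxRep s hs) - of (sigmaBoxRepC s hs (1/2)) - of (sigmaBoxRepC s hs (1/2)) ∈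
      relations :=
    integrandAddRel_subset_relations ⟨2, sigmaBoxRep s hs, sigmaBoxRepC s hs (1/2),
      sigmaBoxRepC s hs (1/2), rfl, rfl, fun x _ => by
        simp only [sigmaBoxRepC, sigmaBoxRep, IntegralRep.integrand_constMul, Pi.add_apply]
        push_cast
        ring, rfl⟩
  -- [Σ, ψ̄/2] ~ [Σ, ψ/2]  (the involution)
  have h2 : of (sigmaBoxBarRepC s hs (1/2)) - of (sigmaBoxRepC s hs (1/2)) ∈ relations :=
    changeOfVariablesRel_subset_relations (bolza_involution_move ((1/2 : ℚ) : ℝ) _ _ rfl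
      (fun x _ => rfl) rfl (fun x _ => rfl))
  -- [Σ, (ψ+ψ̄)/2] = [Σ, ψ/2] + [Σ, ψ̄/2]
  have h3 : of (sigmaBoxAvgRep s hs) - of (sigmaBoxRepC s hs (1/2)) -
      of (sigmaBoxBarRepC s hs (1/2)) ∈ relations :=
    integrandAddRel_subset_relations ⟨2, sigmaBoxAvgRep s hs, sigmaBoxRepC s hs (1/2),
      sigmaBoxBarRepC s hs (1/2), rfl, rfl, fun x _ => rfl, rfl⟩
  show of (boxRep s hs) - of (sigmaBoxAvgRep s hs) ∈ relations
  have key : of (boxRep s hs) - of (sigmaBoxAvgRep s hs) =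
      (of (boxRep s hs) - of (sigmaBoxRep s hs)) +
      (of (sigmaBoxRep s hs) - of (sigmaBoxRepC s hs (1/2)) - of (sigmaBoxRepC s hs (1/2))) -
      (of (sigmaBoxBarRepC s hs (1/2)) - of (sigmaBoxRepC s hs (1/2))) -
      (of (sigmaBoxAvgRep s hs) - of (sigmaBoxRepC s hs (1/2)) - of (sigmaBoxBarRepC s hs (1/2))) := by
    abel
  rw [key]
  exact relations.sub_mem (relations.sub_mem (relations.add_mem h0 h1) h2) h3


/-! ## §10 (cycle 2) The simplex side certified; the crux REDUCED to the sheared pair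

The simplex-side coarea shear `Θ(σ₀,σ₁) = (c,a) = (σ₀σ₁(3−σ₀−σ₁), σ₀)` on the two open cells
`σ₁ ≶ σ₂` of the triangle (cut line null, rule (1a)), each ONE rule-(2) instance onto
`Σ_oval = {0<a<3, 0<c, 4c<a(3−a)²}` with `|det DΘ| = σ₀|3−σ₀−2σ₁| = √Q(a,c)`
(`Q(a,c) = a²(3−a)² − 4ca`), giving `simplexRep_equivalent_ovalRep_two :
Equivalent (simplexRep s hs) [Σ_oval, 2·c^{s−1}/√Q]`. With §9:
`multiplicationThree_iff_sheared` — the crux is EQUIVALENT, by certified moves, to the single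
relation `[Σ_box, u^{s−1}(ψ+ψ̄)/2] ~ [Σ_oval, 2u^{s−1}/√Q(a,u)]` for every rational `s > 0`. -/

/-! ### The simplex-side coarea shear `Θ(σ₀,σ₁) = (σ₀σ₁(3−σ₀−σ₁), σ₀)` -/

/-- Lower open cell of the triangle: `σ₁ < σ₂`, i.e. `2σ₁ < 3 − σ₀`. [folklore] -/
def cellLo : Set (Fin 2 → ℝ) := {x | 0 < x 0 ∧ 0 < x 1 ∧ 2 * x 1 < 3 - x 0}

/-- Upper open cell of the triangle: `σ₁ > σ₂`. [folklore] -/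
def cellHi : Set (Fin 2 → ℝ) := {x | 0 < x 0 ∧ 0 < x 1 ∧ x 0 + x 1 < 3 ∧ 3 - x 0 < 2 * x 1}

/-- The oval domain `Σ_oval = {(c,a) : 0 < a < 3, 0 < c, 4c < a(3−a)²}` (`y 0 = c`, `y 1 = a`). [folklore] -/
def oval : Set (Fin 2 → ℝ) := {y | 0 < y 1 ∧ y 1 < 3 ∧ 0 < y 0 ∧ 4 * y 0 < y 1 * (3 - y 1) ^ 2}

/-- Defining polynomials. [folklore] -/
def cellLoPolys : Fin 3 → MvPolynomial (Fin 2) ℚ := ![X 0, X 1, 3 - X 0 - 2 * X 1]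

/-- Defining polynomials. [folklore] -/
def cellHiPolys : Fin 4 → MvPolynomial (Fin 2) ℚ := ![X 0, X 1, 3 - X 0 - X 1, 2 * X 1 - 3 + X 0]

/-- Defining polynomials. [folklore] -/
def ovalPolys : Fin 4 → MvPolynomial (Fin 2) ℚ :=
  ![X 1, 3 - X 1, X 0, X 1 * (3 - X 1) ^ 2 - 4 * X 0]

/-- `aeval` of the numeral `3`. [folklore] -/
private theorem aeval_three (x : Fin 2 → ℝ) : aeval x (3 : MvPolynomial (Fin 2) ℚ) = (3 : ℝ) := by
  rw [show (3 : MvPolynomial (Fin 2) ℚ) = C 3 by simp [map_ofNat], MvPolynomial.aeval_C]; simp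

/-- `aeval` of the numeral `2`. [folklore] -/
private theorem aeval_two (x : Fin 2 → ℝ) : aeval x (2 : MvPolynomial (Fin 2) ℚ) = (2 : ℝ) := by
  rw [show (2 : MvPolynomial (Fin 2) ℚ) = C 2 by simp [map_ofNat], MvPolynomial.aeval_C]; simp

/-- `aeval` of the numeral `4`. [folklore] -/
private theorem aeval_four (x : Fin 2 → ℝ) : aeval x (4 : MvPolynomial (Fin 2) ℚ) = (4 : ℝ) := by
  rw [show (4 : MvPolynomial (Fin 2) ℚ) = C 4 by simp [map_ofNat], MvPolynomial.aeval_C]; simp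

/-- `cellLo` is `ℚ`-semialgebraic. [folklore] -/
theorem isSemialgebraic_cellLo : IsSemialgebraic ℚ cellLo := by
  have : cellLo = {x | ∀ l, 0 < aeval x (cellLoPolys l)} := by
    ext x
    simp only [cellLo, mem_setOf_eq, Fin.forall_fin_succ, cellLoPolys, Matrix.cons_val_zero,
      Matrix.cons_val_succ, map_sub, map_mul, MvPolynomial.aeval_X, aeval_three, aeval_two]
    constructor
    · rintro ⟨h0, h1, h2⟩; exact ⟨h0, h1, by linarith, fun i => Fin.elim0 i⟩
    · rintro ⟨h0, h1, h2, -⟩; exact ⟨h0, h1, by linarith⟩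
  rw [this]; exact isSemialgebraic_setOf_forall_aeval_pos _

/-- `cellHi` is `ℚ`-semialgebraic. [folklore] -/
theorem isSemialgebraic_cellHi : IsSemialgebraic ℚ cellHi := by
  have : cellHi = {x | ∀ l, 0 < aeval x (cellHiPolys l)} := by
    ext x
    simp only [cellHi, mem_setOf_eq, Fin.forall_fin_succ, cellHiPolys, Matrix.cons_val_zero,
      Matrix.cons_val_succ, map_sub, map_mul, map_add, MvPolynomial.aeval_X, aeval_three, aeval_two]
    constructor
    · rintro ⟨h0, h1, h2, h3⟩; exact ⟨h0, h1, by linarith, by linarith, fun i => Fin.elim0 i⟩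
    · rintro ⟨h0, h1, h2, h3, -⟩; exact ⟨h0, h1, by linarith, by linarith⟩
  rw [this]; exact isSemialgebraic_setOf_forall_aeval_pos _

/-- `Σ_oval` is `ℚ`-semialgebraic. [folklore] -/
theorem isSemialgebraic_oval : IsSemialgebraic ℚ oval := by
  have : oval = {x | ∀ l, 0 < aeval x (ovalPolys l)} := by
    ext x
    simp only [oval, mem_setOf_eq, Fin.forall_fin_succ, ovalPolys, Matrix.cons_val_zero,
      Matrix.cons_val_succ, map_sub, map_mul, map_pow, MvPolynomial.aeval_X, aeval_three, aeval_four]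
    constructor
    · rintro ⟨h0, h1, h2, h3⟩; exact ⟨h0, by linarith, h2, by linarith, fun i => Fin.elim0 i⟩
    · rintro ⟨h0, h1, h2, h3, -⟩; exact ⟨h0, by linarith, h2, by linarith⟩
  rw [this]; exact isSemialgebraic_setOf_forall_aeval_pos _

/-- The lower cell lies in the triangle. [folklore] -/
theorem cellLo_subset_triangle : cellLo ⊆ triangle := fun _ ⟨h0, h1, h2⟩ =>
  ⟨h0, h1, by linarith⟩

/-- The upper cell lies in the triangle. [folklore] -/
theorem cellHi_subset_triangle : cellHi ⊆ triangle := fun _ ⟨h0, h1, h2, _⟩ => ⟨h0, h1, h2⟩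

/-- The shear `Θ(σ₀,σ₁) = (c, a) = (σ₀σ₁(3−σ₀−σ₁), σ₀)`. [folklore] -/
def Θm (x : Fin 2 → ℝ) : Fin 2 → ℝ := ![x 0 * x 1 * (3 - x 0 - x 1), x 0]

/-- First component of the simplex shear (`c`). [folklore] -/
@[simp] theorem Θm_apply_zero (x : Fin 2 → ℝ) : Θm x 0 = x 0 * x 1 * (3 - x 0 - x 1) := rfl
/-- Second component of the simplex shear (`a`). [folklore] -/
@[simp] theorem Θm_apply_one (x : Fin 2 → ℝ) : Θm x 1 = x 0 := rfl

/-- Jacobian matrix of the shear. [folklore] -/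
def Θjac (x : Fin 2 → ℝ) : Matrix (Fin 2) (Fin 2) ℝ :=
  !![x 1 * (3 - 2 * x 0 - x 1), x 0 * (3 - x 0 - 2 * x 1); 1, 0]

/-- Derivative of the shear. [folklore] -/
def Θm' (x : Fin 2 → ℝ) : (Fin 2 → ℝ) →L[ℝ] (Fin 2 → ℝ) :=
  LinearMap.toContinuousLinearMap (Matrix.toLin' (Θjac x))

/-- Derivative of the simplex shear applied to a vector, first component. [folklore] -/
@[simp] theorem Θm'_apply_zero (x v : Fin 2 → ℝ) :
    Θm' x v 0 = x 1 * (3 - 2 * x 0 - x 1) * v 0 + x 0 * (3 - x 0 - 2 * x 1) * v 1 := by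
  change Matrix.toLin' (Θjac x) v 0 = _
  rw [Matrix.toLin'_apply]
  simp [Θjac, Matrix.mulVec, dotProduct, Fin.sum_univ_two]

/-- Derivative of the simplex shear applied to a vector, second component. [folklore] -/
@[simp] theorem Θm'_apply_one (x v : Fin 2 → ℝ) : Θm' x v 1 = v 0 := by
  change Matrix.toLin' (Θjac x) v 1 = _
  rw [Matrix.toLin'_apply]
  simp [Θjac, Matrix.mulVec, dotProduct, Fin.sum_univ_two]

/-- `det DΘ(σ) = −σ₀(3 − σ₀ − 2σ₁)`. [folklore] -/
theorem det_Θm' (x : Fin 2 → ℝ) : (Θm' x).det = -(x 0 * (3 - x 0 - 2 * x 1)) := by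
  change LinearMap.det (Matrix.toLin' (Θjac x)) = _
  rw [LinearMap.det_toLin', Matrix.det_fin_two]
  simp [Θjac]

/-- The simplex shear is differentiable with derivative `Θm'`. [folklore] -/
theorem hasFDerivAt_Θm (x : Fin 2 → ℝ) : HasFDerivAt Θm (Θm' x) x := by
  have h0 : HasFDerivAt (fun y : Fin 2 → ℝ => y 0)
      (ContinuousLinearMap.proj (R := ℝ) (φ := fun _ : Fin 2 => ℝ) 0) x :=
    hasFDerivAt_apply 0 x
  have h1 : HasFDerivAt (fun y : Fin 2 → ℝ => y 1)
      (ContinuousLinearMap.proj (R := ℝ) (φ := fun _ : Fin 2 => ℝ) 1) x :=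
    hasFDerivAt_apply 1 x
  rw [hasFDerivAt_pi']
  refine Fin.forall_fin_two.mpr ⟨?_, ?_⟩
  · have hf : (fun y : Fin 2 → ℝ => Θm y 0) = fun y => y 0 * y 1 * (3 - y 0 - y 1) :=
      funext fun y => rfl
    rw [hf]
    refine ((h0.mul h1).mul ((h0.const_sub 3).sub h1)).congr_fderiv
      (ContinuousLinearMap.ext fun v => ?_)
    simp
    ring
  · have hf : (fun y : Fin 2 → ℝ => Θm y 1) = fun y => y 0 := funext fun y => rfl
    rw [hf]
    refine h0.congr_fderiv (ContinuousLinearMap.ext fun v => ?_)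
    simp

/-- Substitution polynomials of the shear. [folklore] -/
def ΘSubst : Fin 2 → MvPolynomial (Fin 2) ℚ := ![X 0 * X 1 * (3 - X 0 - X 1), X 0]

/-- Evaluating the substitution polynomials is the simplex shear. [folklore] -/
theorem aeval_ΘSubst (x : Fin 2 → ℝ) : (fun i => aeval x (ΘSubst i)) = Θm x := by
  funext i
  fin_cases i
  · simp [ΘSubst]
  · simp [ΘSubst]

/-- The simplex shear is a `ℚ`-semialgebraic map on any `ℚ`-semialgebraic set. [folklore] -/
theorem isSemialgebraicMapOn_Θm {S : Set (Fin 2 → ℝ)} (hS : IsSemialgebraic ℚ S) :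
    IsSemialgebraicMapOn ℚ S Θm := by
  convert isSemialgebraicMapOn_aeval hS ΘSubst using 2 with z
  exact (aeval_ΘSubst z).symm

/-- The simplex shear is injective on the lower cell. [folklore] -/
theorem injOn_Θm_cellLo : InjOn Θm cellLo := by
  rintro x ⟨hx0, hx1, hx2⟩ y ⟨hy0, hy1, hy2⟩ hxy
  have h1 : x 0 = y 0 := by simpa using congrFun hxy 1
  have h0 := congrFun hxy 0
  simp only [Θm_apply_zero, h1] at h0
  -- y0 * (x1 (3 - y0 - x1) - y1 (3 - y0 - y1)) = 0, i.e. (x1 - y1)(3 - y0 - x1 - y1) = 0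
  have hfac : y 0 * ((x 1 - y 1) * (3 - y 0 - x 1 - y 1)) = 0 := by linear_combination h0
  have hpos : 0 < 3 - y 0 - x 1 - y 1 := by rw [h1] at hx2; linarith
  rcases mul_eq_zero.mp hfac with h | h
  · linarith
  · rcases mul_eq_zero.mp h with h | h
    · funext i; fin_cases i
      · exact h1
      · simpa [sub_eq_zero] using h
    · linarith

/-- The simplex shear is injective on the upper cell. [folklore] -/
theorem injOn_Θm_cellHi : InjOn Θm cellHi := by
  rintro x ⟨hx0, hx1, hx2, hx3⟩ y ⟨hy0, hy1, hy2, hy3⟩ hxy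
  have h1 : x 0 = y 0 := by simpa using congrFun hxy 1
  have h0 := congrFun hxy 0
  simp only [Θm_apply_zero, h1] at h0
  have hfac : y 0 * ((x 1 - y 1) * (3 - y 0 - x 1 - y 1)) = 0 := by linear_combination h0
  have hneg : 3 - y 0 - x 1 - y 1 < 0 := by rw [h1] at hx3; linarith
  rcases mul_eq_zero.mp hfac with h | h
  · linarith
  · rcases mul_eq_zero.mp h with h | h
    · funext i; fin_cases i
      · exact h1
      · simpa [sub_eq_zero] using h
    · linarith

/-- The simplex shear maps the lower cell into `Σ_oval`. [folklore] -/
theorem mapsTo_Θm_cellLo : MapsTo Θm cellLo oval := by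
  rintro x ⟨h0, h1, h2⟩
  refine ⟨h0, by simp; linarith, ?_, ?_⟩
  · simp only [Θm_apply_zero]
    exact mul_pos (mul_pos h0 h1) (by linarith)
  · simp only [Θm_apply_zero, Θm_apply_one]
    have : 0 < (3 - x 0 - 2 * x 1) ^ 2 := by
      have : 3 - x 0 - 2 * x 1 ≠ 0 := by linarith
      positivity
    nlinarith [mul_pos h0 this]

/-- The simplex shear maps the upper cell into `Σ_oval`. [folklore] -/
theorem mapsTo_Θm_cellHi : MapsTo Θm cellHi oval := by
  rintro x ⟨h0, h1, h2, h3⟩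
  refine ⟨h0, by simp; linarith, ?_, ?_⟩
  · simp only [Θm_apply_zero]
    exact mul_pos (mul_pos h0 h1) (by linarith)
  · simp only [Θm_apply_zero, Θm_apply_one]
    have : 0 < (3 - x 0 - 2 * x 1) ^ 2 := by
      have : 3 - x 0 - 2 * x 1 ≠ 0 := by linarith
      positivity
    nlinarith [mul_pos h0 this]

/-- The two preimages of `(c, a) ∈ Σ_oval`: `σ₁ = ((3−a) ∓ √((3−a)² − 4c/a))/2`. [folklore] -/
theorem oval_disc_pos {y : Fin 2 → ℝ} (hy : y ∈ oval) : 0 < (3 - y 1) ^ 2 - 4 * y 0 / y 1 := by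
  obtain ⟨h0, h1, h2, h3⟩ := hy
  have : 4 * y 0 / y 1 < (3 - y 1) ^ 2 := by rw [div_lt_iff₀ h0]; linarith
  linarith

/-- The simplex shear maps the lower cell ONTO `Σ_oval`. [folklore] -/
theorem image_Θm_cellLo : Θm '' cellLo = oval := by
  refine (mapsTo_Θm_cellLo.image_subset).antisymm fun y hy => ?_
  have hd := oval_disc_pos hy
  obtain ⟨h0, h1, h2, h3⟩ := hy
  set D := Real.sqrt ((3 - y 1) ^ 2 - 4 * y 0 / y 1) with hD
  have hDpos : 0 < D := Real.sqrt_pos.mpr hd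
  have hDsq : D ^ 2 = (3 - y 1) ^ 2 - 4 * y 0 / y 1 := Real.sq_sqrt hd.le
  have hDlt : D < 3 - y 1 := by
    have h4 : 0 < 4 * y 0 / y 1 := by positivity
    nlinarith [hDsq, hDpos]
  refine ⟨![y 1, ((3 - y 1) - D) / 2], ⟨h0, ?_, ?_⟩, ?_⟩
  · change 0 < ((3 - y 1) - D) / 2
    linarith
  · change 2 * (((3 - y 1) - D) / 2) < 3 - y 1
    linarith
  · funext i
    fin_cases i
    · change y 1 * (((3 - y 1) - D) / 2) * (3 - y 1 - ((3 - y 1) - D) / 2) = y 0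
      have : y 1 * (((3 - y 1) - D) / 2) * (3 - y 1 - ((3 - y 1) - D) / 2) =
          y 1 * ((3 - y 1) ^ 2 - D ^ 2) / 4 := by ring
      rw [this, hDsq]
      field_simp
      ring
    · rfl

/-- The simplex shear maps the upper cell ONTO `Σ_oval`. [folklore] -/
theorem image_Θm_cellHi : Θm '' cellHi = oval := by
  refine (mapsTo_Θm_cellHi.image_subset).antisymm fun y hy => ?_
  have hd := oval_disc_pos hy
  obtain ⟨h0, h1, h2, h3⟩ := hy
  set D := Real.sqrt ((3 - y 1) ^ 2 - 4 * y 0 / y 1) with hD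
  have hDpos : 0 < D := Real.sqrt_pos.mpr hd
  have hDsq : D ^ 2 = (3 - y 1) ^ 2 - 4 * y 0 / y 1 := Real.sq_sqrt hd.le
  have hDlt : D < 3 - y 1 := by
    have h4 : 0 < 4 * y 0 / y 1 := by positivity
    nlinarith [hDsq, hDpos]
  refine ⟨![y 1, ((3 - y 1) + D) / 2], ⟨h0, ?_, ?_, ?_⟩, ?_⟩
  · change 0 < ((3 - y 1) + D) / 2
    linarith
  · change y 1 + ((3 - y 1) + D) / 2 < 3
    linarith
  · change 3 - y 1 < 2 * (((3 - y 1) + D) / 2)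
    linarith
  · funext i
    fin_cases i
    · change y 1 * (((3 - y 1) + D) / 2) * (3 - y 1 - ((3 - y 1) + D) / 2) = y 0
      have : y 1 * (((3 - y 1) + D) / 2) * (3 - y 1 - ((3 - y 1) + D) / 2) =
          y 1 * ((3 - y 1) ^ 2 - D ^ 2) / 4 := by ring
      rw [this, hDsq]
      field_simp
      ring
    · rfl

/-! ### The oval integrand `2·c^{s−1}/√Q(a,c)` and the rule-(2) relation -/

/-- `Q(a,c) = a²(3−a)² − 4ca` in coordinates `(y 0, y 1) = (c, a)`. [folklore] -/
def Qf (y : Fin 2 → ℝ) : ℝ := y 1 ^ 2 * (3 - y 1) ^ 2 - 4 * y 0 * y 1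

/-- The oval density `c^{s−1} Q^{−1/2}`. [folklore] -/
def ovalFun (s : ℚ) (y : Fin 2 → ℝ) : ℝ := y 0 ^ ((s:ℝ) - 1) * Qf y ^ (-(1:ℝ)/2)

/-- `Q ∘ Θ = (det DΘ)²`. [folklore] -/
theorem Qf_Θm (x : Fin 2 → ℝ) : Qf (Θm x) = (x 0 * (3 - x 0 - 2 * x 1)) ^ 2 := by
  simp only [Qf, Θm_apply_zero, Θm_apply_one]
  ring

/-- `Q > 0` on `Σ_oval`. [folklore] -/
theorem Qf_pos_of_mem_oval {y : Fin 2 → ℝ} (hy : y ∈ oval) : 0 < Qf y := by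
  obtain ⟨h0, h1, h2, h3⟩ := hy
  have : Qf y = y 1 * (y 1 * (3 - y 1) ^ 2 - 4 * y 0) := by simp only [Qf]; ring
  rw [this]
  exact mul_pos h0 (by linarith)

/-- The rule-(2) integrand relation of the simplex shear on either cell. [folklore] -/
theorem simplexFun_eq_Θ_jacobian {s : ℚ} {x : Fin 2 → ℝ} (hx0 : 0 < x 0)
    (hne : 3 - x 0 - 2 * x 1 ≠ 0) :
    simplexFun s x = ovalFun s (Θm x) * |(Θm' x).det| := by
  rw [det_Θm', abs_neg]
  simp only [ovalFun, Qf_Θm, Θm_apply_zero, simplexFun]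
  set d := x 0 * (3 - x 0 - 2 * x 1) with hd
  have hdne : d ≠ 0 := mul_ne_zero hx0.ne' hne
  have habs : 0 < |d| := abs_pos.mpr hdne
  have hpow : (d ^ 2) ^ (-(1:ℝ)/2) = |d|⁻¹ := by
    rw [show d ^ 2 = |d| ^ 2 by rw [sq_abs], show (|d| ^ 2 : ℝ) = |d| ^ (2:ℝ) by rw [rpow_two],
      ← Real.rpow_mul habs.le, show (2:ℝ) * (-(1:ℝ)/2) = -1 by norm_num, Real.rpow_neg_one]
  rw [hpow, inv_mul_cancel_right₀ habs.ne']

/-- **The simplex shear is ONE rule-(2) instance on each cell.** [folklore] -/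
theorem cellLo_move {s : ℚ} (hs : 0 < s) (R' : IntegralRep 2) (hR' : R'.domain = oval)
    (hR'i : EqOn R'.integrand (ovalFun s) R'.domain) :
    of ((simplexRep s hs).restrict cellLo isSemialgebraic_cellLo cellLo_subset_triangle) - of R' ∈
      changeOfVariablesRel := by
  refine ⟨2, _, R', Θm, Θm', isSemialgebraicMapOn_Θm isSemialgebraic_cellLo,
    fun x _ => (hasFDerivAt_Θm x).hasFDerivWithinAt, injOn_Θm_cellLo, ?_, fun x hx => ?_, rfl⟩
  · rw [hR']; exact image_Θm_cellLo.symm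
  · obtain ⟨h0, h1, h2⟩ := hx
    change simplexFun s x = _
    rw [simplexFun_eq_Θ_jacobian h0 (by linarith), hR'i (by rw [hR']; exact mapsTo_Θm_cellLo ⟨h0, h1, h2⟩)]

/-- The simplex shear on the upper cell is ONE rule-(2) instance. [folklore] -/
theorem cellHi_move {s : ℚ} (hs : 0 < s) (R' : IntegralRep 2) (hR' : R'.domain = oval)
    (hR'i : EqOn R'.integrand (ovalFun s) R'.domain) :
    of ((simplexRep s hs).restrict cellHi isSemialgebraic_cellHi cellHi_subset_triangle) - of R' ∈
      changeOfVariablesRel := by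
  refine ⟨2, _, R', Θm, Θm', isSemialgebraicMapOn_Θm isSemialgebraic_cellHi,
    fun x _ => (hasFDerivAt_Θm x).hasFDerivWithinAt, injOn_Θm_cellHi, ?_, fun x hx => ?_, rfl⟩
  · rw [hR']; exact image_Θm_cellHi.symm
  · obtain ⟨h0, h1, h2, h3⟩ := hx
    change simplexFun s x = _
    rw [simplexFun_eq_Θ_jacobian h0 (by linarith),
      hR'i (by rw [hR']; exact mapsTo_Θm_cellHi ⟨h0, h1, h2, h3⟩)]

/-! ### Existence of the oval representation -/

/-- The oval density is integrable (transported from the lower cell). [folklore] -/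
theorem integrableOn_ovalFun {s : ℚ} (hs : 0 < s) : IntegrableOn (ovalFun s) oval := by
  have hmeas : MeasurableSet cellLo := IsSemialgebraic.measurableSet_holds isSemialgebraic_cellLo
  have h := (integrableOn_image_iff_integrableOn_abs_det_fderiv_smul volume hmeas
    (fun x _ => (hasFDerivAt_Θm x).hasFDerivWithinAt) injOn_Θm_cellLo (ovalFun s)).mpr ?_
  · rwa [image_Θm_cellLo] at h
  · refine ((integrableOn_simplexFun hs).mono_set cellLo_subset_triangle).congr_fun
      (fun x hx => ?_) hmeas
    obtain ⟨h0, h1, h2⟩ := hx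
    rw [simplexFun_eq_Θ_jacobian h0 (by linarith), smul_eq_mul, mul_comm]

/-- The polynomial `Q` as an `MvPolynomial`. [folklore] -/
def QPoly : MvPolynomial (Fin 2) ℚ := X 1 ^ 2 * (3 - X 1) ^ 2 - 4 * X 0 * X 1

/-- Evaluating `QPoly` is `Q`. [folklore] -/
theorem aeval_QPoly (y : Fin 2 → ℝ) : aeval y QPoly = Qf y := by
  simp [QPoly, Qf]

/-- The oval density is `ℚ`-semialgebraic on `Σ_oval` (Euler–Mellin integrand). [folklore] -/
theorem isSemialgebraicFunOn_ovalFun (s : ℚ) : IsSemialgebraicFunOn ℚ oval (ovalFun s) := by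
  have hmel := isSemialgebraicFunOn_mellinIntegrand isSemialgebraic_oval
    (![X 0, QPoly] : Fin 2 → MvPolynomial (Fin 2) ℚ) (![s - 1, -1/2]) 1 ?_
  · refine hmel.congr fun x _ => ?_
    simp only [ovalFun, mellinIntegrand, Fin.prod_univ_two, Matrix.cons_val_zero,
      Matrix.cons_val_one, MvPolynomial.aeval_X, aeval_QPoly, Rat.cast_sub, Rat.cast_one,
      Rat.cast_div, Rat.cast_neg, Rat.cast_ofNat]
    ring_nf
  · intro x hx k
    fin_cases k
    · simpa using hx.2.2.1
    · simpa [aeval_QPoly] using Qf_pos_of_mem_oval hx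

/-- **The oval representation** `[Σ_oval, c^{s−1}/√Q(a,c)]`. [folklore] -/
def ovalRep (s : ℚ) (hs : 0 < s) : IntegralRep 2 where
  domain := oval
  integrand := ovalFun s
  isSemialgebraic_domain := isSemialgebraic_oval
  isSemialgebraicFunOn_integrand := isSemialgebraicFunOn_ovalFun s
  integrableOn := integrableOn_ovalFun hs

/-! ### Assembly: `[simplexRep] ~ [Σ_oval, 2c^{s−1}/√Q]` -/

/-- The cut line `σ₀ + 2σ₁ = 3` is null. [folklore] -/
theorem volume_cutLine : volume {x : Fin 2 → ℝ | 2 * x 1 = 3 - x 0} = 0 := by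
  have hu : IsSemialgebraicFunOn ℚ (univ : Set (Fin 1 → ℝ))
      (fun w => aeval w ((3 - X 0) * C (1/2 : ℚ) : MvPolynomial (Fin 1) ℚ)) :=
    isSemialgebraicFunOn_aeval Literature.ModelTheory.ExponentialFields.isSemialgebraic_univ _
  refine measure_mono_null (fun x hx => ?_) (volume_graph_eq_zero hu)
  simp only [mem_setOf_eq] at hx ⊢
  refine ⟨mem_univ _, ?_⟩
  have h3 : aeval (Fin.init x) (3 : MvPolynomial (Fin 1) ℚ) = (3 : ℝ) := by
    rw [show (3 : MvPolynomial (Fin 1) ℚ) = C 3 by simp [map_ofNat], MvPolynomial.aeval_C]; simp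
  simp only [map_mul, map_sub, h3, MvPolynomial.aeval_X, MvPolynomial.aeval_C, Fin.init,
    Fin.castSucc_zero, eq_ratCast, Rat.cast_div, Rat.cast_one, Rat.cast_ofNat]
  change x 1 = (3 - x 0) * (1 / 2)
  linarith

/-- The triangle minus the two open cells is contained in the cut line. [folklore] -/
theorem triangle_diff_cells_subset :
    triangle \ (cellLo ∪ cellHi) ⊆ {x : Fin 2 → ℝ | 2 * x 1 = 3 - x 0} := by
  rintro x ⟨⟨h0, h1, h2⟩, hx⟩
  simp only [mem_union, not_or] at hx
  obtain ⟨hlo, hhi⟩ := hx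
  simp only [cellLo, cellHi, mem_setOf_eq, not_and, not_lt] at hlo hhi
  have a := hlo h0 h1
  have b := hhi h0 h1 h2
  simp only [mem_setOf_eq]
  linarith

/-- **The simplex side of the bolza chain, certified**:
`[simplexRep] ~ [Σ_oval, 2·c^{s−1}/√Q(a,c)]` by one null cut (1a), the split into the two cells
(1a), the shear on each cell (2, twice) and `2·[r] ≡ [2r]` (1b). [folklore] -/
theorem simplexRep_equivalent_ovalRep_two {s : ℚ} (hs : 0 < s) :
    Equivalent (simplexRep s hs) ((ovalRep s hs).constMul ((2:ℕ) : ℝ) (isAlgebraic_nat 2)) := by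
  have hE : IsSemialgebraic ℚ (cellLo ∪ cellHi) := isSemialgebraic_cellLo.union isSemialgebraic_cellHi
  have hEsub : cellLo ∪ cellHi ⊆ (simplexRep s hs).domain :=
    union_subset cellLo_subset_triangle cellHi_subset_triangle
  -- (1a) cut out the null line
  have h1 : of (simplexRep s hs) - of ((simplexRep s hs).restrict _ hE hEsub) ∈ relations :=
    KZ.IntegralRep.of_sub_of_restrict_mem_relations _ hE hEsub
      (measure_mono_null triangle_diff_cells_subset volume_cutLine)
  -- (1a) split into the two cells
  have h2 : of ((simplexRep s hs).restrict _ hE hEsub) -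
      of ((simplexRep s hs).restrict cellLo isSemialgebraic_cellLo cellLo_subset_triangle) -
      of ((simplexRep s hs).restrict cellHi isSemialgebraic_cellHi cellHi_subset_triangle) ∈
      relations := by
    refine domainAddRel_subset_relations ⟨2, (simplexRep s hs).restrict _ hE hEsub,
      (simplexRep s hs).restrict cellLo isSemialgebraic_cellLo cellLo_subset_triangle,
      (simplexRep s hs).restrict cellHi isSemialgebraic_cellHi cellHi_subset_triangle, rfl, ?_,
      fun _ _ => rfl, fun _ _ => rfl, rfl⟩
    have : cellLo ∩ cellHi = ∅ := by
      ext x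
      simp only [mem_inter_iff, mem_empty_iff_false, iff_false]
      rintro ⟨⟨-, -, h2⟩, ⟨-, -, -, h3⟩⟩
      linarith
    simp [this]
  -- (2) each cell ~ oval
  have h3 := changeOfVariablesRel_subset_relations (cellLo_move hs (ovalRep s hs) rfl fun _ _ => rfl)
  have h4 := changeOfVariablesRel_subset_relations (cellHi_move hs (ovalRep s hs) rfl fun _ _ => rfl)
  -- (1b) 2•[oval] ≡ [2·oval]
  have h5 := (ovalRep s hs).of_constMul_nat_sub_nsmul_mem_relations 2
  show of (simplexRep s hs) - of ((ovalRep s hs).constMul ((2:ℕ) : ℝ) (isAlgebraic_nat 2)) ∈ relations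
  have key : of (simplexRep s hs) - of ((ovalRep s hs).constMul ((2:ℕ) : ℝ) (isAlgebraic_nat 2)) =
      (of (simplexRep s hs) - of ((simplexRep s hs).restrict _ hE hEsub)) +
      (of ((simplexRep s hs).restrict _ hE hEsub) -
        of ((simplexRep s hs).restrict cellLo isSemialgebraic_cellLo cellLo_subset_triangle) -
        of ((simplexRep s hs).restrict cellHi isSemialgebraic_cellHi cellHi_subset_triangle)) +
      (of ((simplexRep s hs).restrict cellLo isSemialgebraic_cellLo cellLo_subset_triangle) -
        of (ovalRep s hs)) +
      (of ((simplexRep s hs).restrict cellHi isSemialgebraic_cellHi cellHi_subset_triangle) -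
        of (ovalRep s hs)) -
      (of ((ovalRep s hs).constMul ((2:ℕ) : ℝ) (isAlgebraic_nat 2)) - 2 • of (ovalRep s hs)) := by
    rw [two_nsmul]; abel
  rw [key]
  exact relations.sub_mem (relations.add_mem (relations.add_mem (relations.add_mem h1 h2) h3) h4) h5



/-! ### The crux, reduced by certified moves to MellinCoarea's fibred pair -/

/-- Transitivity bookkeeping in `FormalRep ⧸ relations`. [folklore] -/
theorem equivalent_trans {a b c : ℕ} {r : IntegralRep a} {r' : IntegralRep b} {r'' : IntegralRep c}
    (h : Equivalent r r') (h' : Equivalent r' r'') : Equivalent r r'' := by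
  have : of r - of r'' = (of r - of r') + (of r' - of r'') := by abel
  show of r - of r'' ∈ relations
  rw [this]; exact relations.add_mem h h'

/-- Symmetry. [folklore] -/
theorem equivalent_symm {a b : ℕ} {r : IntegralRep a} {r' : IntegralRep b} (h : Equivalent r r') :
    Equivalent r' r := by
  have : of r' - of r = -(of r - of r') := by abel
  show of r' - of r ∈ relations
  rw [this]; exact relations.neg_mem h


/-- **MultiplicationThree ⇔ the sheared pair**: by the certified moves of §9–§10 the crux is
EQUIVALENT to `[Σ_box, u^{s−1}(ψ+ψ̄)/2] ~ [Σ_oval, 2·u^{s−1}/√Q(a,u)]` for every rational `s > 0` —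
two representations over the common weight `u^{s−1}` (MellinCoarea's fibred form,
TriplicationFibreTransfer shape), between which the bolza card's remaining moves are the cube-root
chart on two cells and the torsion translations of `E_u`. [folklore] -/
theorem multiplicationThree_iff_sheared :
    MultiplicationThree ↔ ∀ (s : ℚ) (hs : 0 < s),
      Equivalent (sigmaBoxAvgRep s hs) ((ovalRep s hs).constMul ((2:ℕ) : ℝ) (isAlgebraic_nat 2)) := by
  rw [multiplicationThree_iff_pinned]
  refine forall_congr' fun s => forall_congr' fun hs => ?_
  constructor
  · intro h
    exact equivalent_trans (equivalent_symm (boxRep_equivalent_sigmaBoxAvgRep hs))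
      (equivalent_trans h (simplexRep_equivalent_ovalRep_two hs))
  · intro h
    exact equivalent_trans (boxRep_equivalent_sigmaBoxAvgRep hs)
      (equivalent_trans h (equivalent_symm (simplexRep_equivalent_ovalRep_two hs)))

/-! ## Open adversarial questions (no theorem claimed)

* (Q1) Is `[boxRep s] − [simplexRep s]` in the subgroup generated by rules (1)+(2) IN DIMENSION 2
  (no Newton–Leibniz, no extra variable)? After §8: YES is expected — the bolza chain uses only
  (1a),(1b),(2) in dimension 2 and its two non-classical identities are now theorems; what remains
  is move-by-move bookkeeping (semialgebraicity, injectivity cells, Jacobians as stated). (Any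
  invariant that is ADDITIVE and order-continuous in the integrand is a multiple of evaluation —
  rule (2) with Kummer maps `u = t^k` straightens every algebraic power singularity locally, rule
  (1a) kills null sets — so a separating invariant for (1)+(2) would have to be non-constructive.)
* (Q2) Torsion: CLOSED for the Betti-transposition line by §7 (the transfer `q^!Z̄₀` is an integral
  relative cycle, `Θ₃ ∈ ℤ[H²]` is explicit, `deg q = 2d` is absorbed by rule (1b)). It survives only
  as the abstract question whether OTHER arguments might reach `N·([r] − [r'])` first; nothing forces
  that any more.
* (Q3) Uniformity in `s`: §7's `Θ₃` is uniform in `a` and depends on `s` only through `d` (the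
  group `H = μ_d × μ_3`; its image in `ℤ[μ_3²]` is `d`-independent); the bolza chain of §8 is
  uniform in `s` outright (the weight `u^{s−1}` rides inside every integrand). The fear "a chain
  uniform in `s` may not exist" has no support left.
* (Q4, new) The remaining burden of the line is purely constructive/formal: a compact semialgebraic
  `W₃` (explicit, or by a general "homologous semialgebraic cycles bound semialgebraically" theorem,
  absent from the tree) and "Stokes on a semialgebraic 3-cell = three Newton–Leibniz moves". A
  disprover has nothing to attack there short of a new invariant of `KZ.relations` (= ¬summit).
-/

end Summit.KontsevichZagierPeriods.KontsevichZagierPeriods.Cruxes.MultiplicationThree.Disproof
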